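import Literature.Probability.RandomPlanarGeometry.HexSAWBrickWallStripFugacityWidthOneContactLDP
import Literature.Probability.RandomPlanarGeometry.HexSAWBrickWallStripTwoWallChart
import HarnessLib

/-!
# The joint large deviations of the two wall-contact fractions of the strip self-avoiding walk (all four quadrants)

For the `N`-step self-avoiding walk of the one-cell honeycomb strip `S_1` under `P_{N,y,z} ∝ y^{bc} z^{tc}` (BBdGDCG2014 §3.2, `C_{1,N}(y,z)`),
the file `HexSAWBrickWallStripFugacityWidthOneContactLDP.lean` proved the large deviation principle of ONE contact fraction `bc/N`
(tilting one fugacity), and `HexSAWBrickWallStripRungRays.lean` that of the TOTAL `(bc+tc)/N` (tilting along rays), declaring the tilts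
OFF the rays — the JOINT law of `(bc/N, tc/N)` — open.  THIS FILE closes it: for every base `(y,z)` and every tilt `(Y,Z)` in any
of the four quadrants around `(y,z)`,

  `lim_{N→∞} (1/N) log P_{N,y,z}(bc ≷ b(Y,Z)·N and tc ≷ b(Z,Y)·N) = −J(y,z;Y,Z)`,
  `J(y,z;Y,Z) = b(Y,Z) log(Y/y) + b(Z,Y) log(Z/z) − log(μ_1(Y,Z)/μ_1(y,z))`

(`≷` = `≥` for `Y ≥ y` resp. `Z ≥ z`, `≤` otherwise).  The one new ingredient beyond the two-fugacity Chernoff bound is the LOWER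
bound's change of measure to a nearby tilt whose typical density pair lies strictly inside the target box — which needs a tilt with
BOTH densities prescribed.  The intermediate value theorem of the one-wall file does not provide it (raising `y` raises `b` but lowers
`b_top`); the INVERSE EQUATION OF STATE of `HexSAWBrickWallStripTwoWallChart.lean` does: `(Y',Z') = (Y(a+δ, a'±δ), Y(a'±δ, a+δ))`
realises EXACTLY the densities `(a+δ, a'±δ)` (`contactB_eosY`) and depends continuously on `δ` (`continuousAt_eosY`).  In density
coordinates the rate is therefore an ELEMENTARY CLOSED FORM on the open triangle (`jointRate_eosY`, `tendsto_log_contacts_NE_div_density`).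

## Main statements (namespace `Literature.Probability.RandomPlanarGeometry.SAW.HexBW`, all PROVED, standard axioms)

§1 `wgt_tilt₂` (`wgt (yu)(zv) = wgt y z · u^{bc} v^{tc}`), ★ `sum_NE_mul_rpow_le`, `sum_SW_mul_rpow_le`, `sum_filter_mul_rpow_le` (Chernoff
in every quadrant).  §2 ★ `exp_mul_boxSum_le` (change of both fugacities on a box), ★ `eventually_half_le_boxSum` (the two tilted
contact-density laws fill the box), ★★ `exp_le_boxFraction` (the lower bound).  §3 `jointRate`, `jointRate_self`, `continuousAt_eosY`,
★★ `jointRate_eosY` (closed form on the triangle).  §4 `continuousAt_boxCost`, ★★★ **`tendsto_log_contacts_NE_div`**, **`…_SW_div`**,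
**`…_NW_div`**, **`…_SE_div`** (THE JOINT LDP, four quadrants), ★★ `jointRate_nonneg` (`J ≥ 0` in the north-east quadrant — by probability),
★★★ **`tendsto_log_contacts_NE_div_density`** (the LDP in density coordinates with the explicit rate).
§5 (ed.2) `jointRate_swap`, ★★ **`tangent₂_le_of_le_of_ge`** (the two-variable tangent inequality in the anti-aligned quadrants, strict off the
point), ★★ `jointRate_pos_NW`, `jointRate_pos_SE` (`J > 0` off the base point there), ★★ `jointRate_nonneg_SW` (by probability),
★★ **`jointRate_nonneg_all`** (`J ≥ 0` on the whole open quadrant).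
§6 (ed.3) `eventually_abs_log_stripMuY₂_sub_tangent_le` (little-o form of the one-variable derivatives), ★★★ **`tangent₂_le`** (THE SUPPORTING
PLANE OF THE FREE ENERGY IN EVERY DIRECTION: `b(Y,Z)(log y − log Y) + b(Z,Y)(log z − log Z) ≤ log μ_1(y,z) − log μ_1(Y,Z)` for ALL positive
`y,z,Y,Z` — convexity + the two partial derivatives), ★★ `stripMuY₂_one_ge_tangent` (`μ_1(y,z) ≥ μ_1(Y,Z)(y/Y)^{b(Y,Z)}(z/Z)^{b(Z,Y)}`),
★★★ **`isGreatest_jointRate`** (THE LEGENDRE CHARACTERISATION: `J(y,z;Y,Z) = max_{u,v>0}{b(Y,Z) log u + b(Z,Y) log v − log(μ_1(yu,zv)/μ_1(y,z))}`,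
attained at `(Y/y, Z/z)`), ★★ **`hasDerivAt_log_stripMuY₂_dir`** (the free energy is differentiable in every direction at every point, with
gradient `(b, b_top)`).
§7 (ed.3) `wgt_pos`, ★★ **`contactB_lt_or_lt_of_NE`** / `contactB_lt_or_lt_of_SW` (raising both fugacities raises at least one density —
gradient monotonicity), `eventually_NE_sum_pos` / `eventually_SW_sum_pos`, ★★★ **`jointRate_pos_NE`**, **`jointRate_pos_SW`** (`J > 0` off the
base point in the ALIGNED quadrants — by probability: the quadrant event lies in a one-wall event whose rate is the parent's `I(y,z;Y_a) > 0`),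
★★★ **`jointRate_pos`** (`J > 0` off the base point, everywhere), ★★★ **`tangent₂_lt`** (the STRICT supporting plane in every direction),
★★★ **`strictConvexOn_log_stripMuY₂_one_exp`** (THE TWO-WALL FREE ENERGY `(A,B) ↦ log μ_1(e^A,e^B)` IS STRICTLY CONVEX ON `ℝ²`).
§8 (ed.4) `contactEntropy₂` (`s(a,a') = log μ_1(Y,Z) − a log Y − a' log Z` at the explicit tilt), `contactEntropy₂_swap`, ★★ `contactEntropy₂_eq`
(closed form), ★★ `jointRate_eq_sub_contactEntropy₂` (Gibbs form `J = log μ_1(y,z) − [a log y + a' log z + s]`),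
★★★ **`isGreatest_log_stripMuY₂_energy_add_entropy`** (THE VARIATIONAL PRINCIPLE `log μ_1(y,z) = max_T {a log y + a' log z + s(a,a')}` with a
UNIQUE maximiser `(b(y,z), b(z,y))`), ★★ `contactEntropy₂_le` (`s = min` of tilted free energies, strict off the tilt),
★★★ **`strictConcaveOn_contactEntropy₂`** (THE ENTROPY IS STRICTLY CONCAVE on the open density triangle), ★★★ **`tendsto_log_card_contacts_NE_div`** /
**`…_SW_div`** (THE ENTROPY OF WALK COUNTS: `(1/N) log #{ω ∈ S_N(S_1) : bc ≷ aN, tc ≷ a'N} → s(a,a')`),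
★★ `contactEntropy₂_le_log_stripConnectiveConstant` (`s ≤ log μ(S_1)`, `=` only at the uniform densities).
§9 (ed.4) `jointRate_eq_contactRate_of_eq` (`J(y,z;Y,z) = I(y,z;Y)`), ★★★ **`contactRate_le_jointRate`** (THE CONTRACTION PRINCIPLE: for every tilt
`(Y,Z)` with `Y ≥ y` and bottom density `b(Y,Z) = b(Y₁,z)`, `I(y,z;Y₁) ≤ J(y,z;Y,Z)`, equality at `(Y₁,z)` — the one-wall rate is the joint
rate minimised over the hidden top density), ★★ `levelRate_le_jointRate_eosY` (the same in density coordinates with the parent's `levelRate`),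
★★★ **`contactEntropy₂_add_le_contactEntropy`** (contraction of ENTROPIES: `s(a,a') + a' log z ≤ σ_z(a)` with equality at `a' = b(z,Y_a)`; at
`z = 1` the one-density entropy of the parent is `max_{a'} s(a,a')`).
§10 (ed.4) ★ `sum_halfPlane_mul_exp_le` (half-plane Chernoff), ★★ `linStat_lt_of_tilt` (the directional statistic `u·b + v·b_top` is STRICTLY
increasing along its own log-direction — strict convexity), `continuousAt_dirCost`, ★★★ **`tendsto_log_linStat_ge_div`** (CRAMÉR IN EVERY DIRECTION:
for every `(u,v) ≠ (0,0)`, `κ > 0`, with `(Y,Z) = (y e^{κu}, z e^{κv})`: `lim (1/N) log P_{N,y,z}(u·bc + v·tc ≥ (u b(Y,Z) + v b(Z,Y))N) = −J(y,z;Y,Z)` — the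
one-wall (`(1,0)`), total-contact/ray (`(1,1)`) and CONTACT-IMBALANCE (`(1,−1)`) principles as one theorem; lower tail = direction `(−u,−v)`).

## Sources and method

Cramér's method (DemboZeitouni2010 §2.2 Theorem 2.2.3: Chebycheff upper bound with the exact tilt, displays (2.2.11)–(2.2.12); lower bound by
change of measure, key inequality (2.2.14), and the law of large numbers under the tilted measure, (2.2.15)–(2.2.17)); §2.3 Definition 2.3.3
(exposed points — here every interior density pair is exposed, with the explicit exposing tilt of the chart file); framework JansevanRensburg2000
§3.2 «Density functions and free energies», Theorems 3.17–3.19 (integrated density functions exist / the free energy is their Legendre transform /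
and conversely; Oxford Lecture Series in Mathematics 18, OUP 2000, first edition, ISBN 0 19 850561 2 — THE HELD TEXT, stored under a 2015
catalogue key (lane LIT FINDING «JvR EDITION»): Thm 3.17 chunk p0060, Thm 3.18 p0061, Thm 3.19 p0062, printed pp. ≈ 50–52); objects BeatonBousquetMelouDeGierDuminilCopinGuttmann2014 §3.2 p. 10
(`C_{T,N}(y,z)`; Proposition 6 prints only existence/monotonicity/symmetry/log-convexity of `μ_T(y,z)`); AlmJanson1990 via MadrasSlade1993
§8.5 pp. 278–279 for the laws of large numbers of the tree.  No quotation AS PRINTED; no source in our holdings states the joint rate of the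
two wall-contact fractions of a strip walk — the statement and the explicit tilt are this lineage's.  Editions: ed.2 proved the
non-strict supporting plane in every direction and Gâteaux differentiability; ed.3 (§7) proves `J > 0` off the base point EVERYWHERE and the
STRICT joint convexity — the item the earlier editions and `HexSAWBrickWallStripRungRays` / `…TwoWallChart` left open — by running the
one-dimensional strict convexity (the parents' `contactRate_pos`) through the joint large deviation principle.  NOT CLAIMED: the full LDP of the pair
`(bc/N, tc/N)` for general Borel sets (the quadrant events at every density pair determine the rate function but the covering argument is
not written), the span `|X(ω)|/N` jointly with the contacts.
-/

noncomputable section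

open Filter Topology Finset Literature.Probability.LatticeModels Literature.Probability.Percolation SimpleGraph

namespace Literature.Probability.RandomPlanarGeometry.SAW.HexBW

open WidthOneYZ

variable {y z : ℝ}

/-! ## §1 Tilting both fugacities: the two-wall tilt identity and the four quadrant Chernoff inequalities -/

/-- ★ **The two-wall tilt identity**: `wgt (yu) (zv) = wgt y z · u^{bc} · v^{tc}`. [cite: BeatonBousquetMelouDeGierDuminilCopinGuttmann2014, §3.2 (arXiv v5 p. 10)] -/
theorem wgt_tilt₂ (y z u v : ℝ) (N : ℕ) (q : Site 2 × (ℕ → Site 2)) :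
    wgt (y * u) (z * v) N q = wgt y z N q * u ^ bottomVisits₀ q.1 q.2 N * v ^ topVisits₀ 1 q.1 q.2 N := by
  unfold wgt; rw [mul_pow, mul_pow]; ring

open Classical in
/-- ★★ **Chernoff, north-east quadrant**: for `u, v ≥ 1` and reals `κ, κ'`,
`(Σ_{q : κN ≤ bc, κ'N ≤ tc} y^{bc} z^{tc}) · u^{κN} v^{κ'N} ≤ C_{1,N}(yu, zv)`.
[cite: DemboZeitouni2010, §2.2 Theorem 2.2.3 (Chebycheff step); BeatonBousquetMelouDeGierDuminilCopinGuttmann2014, §3.2 (arXiv v5 p. 10)] -/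
theorem sum_NE_mul_rpow_le (hy : 0 ≤ y) (hz : 0 ≤ z) {u v : ℝ} (hu : 1 ≤ u) (hv : 1 ≤ v) (N : ℕ) (κ κ' : ℝ) :
    (∑ q ∈ (stripPairs 1 N).filter (fun q => κ * N ≤ (bottomVisits₀ q.1 q.2 N : ℝ) ∧ κ' * N ≤ (topVisits₀ 1 q.1 q.2 N : ℝ)),
        wgt y z N q) * (u ^ (κ * N) * v ^ (κ' * N)) ≤ stripZ₂ 1 N (y * u) (z * v) := by
  have hu0 : 0 ≤ u := zero_le_one.trans hu
  have hv0 : 0 ≤ v := zero_le_one.trans hv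
  rw [Finset.sum_mul, stripZ₂_one_eq_sum_wgt]
  calc ∑ q ∈ (stripPairs 1 N).filter (fun q => κ * N ≤ (bottomVisits₀ q.1 q.2 N : ℝ) ∧ κ' * N ≤ (topVisits₀ 1 q.1 q.2 N : ℝ)),
        wgt y z N q * (u ^ (κ * N) * v ^ (κ' * N))
      ≤ ∑ q ∈ (stripPairs 1 N).filter (fun q => κ * N ≤ (bottomVisits₀ q.1 q.2 N : ℝ) ∧ κ' * N ≤ (topVisits₀ 1 q.1 q.2 N : ℝ)),
          wgt (y * u) (z * v) N q :=
        Finset.sum_le_sum fun q hq => by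
          rw [wgt_tilt₂, mul_assoc]
          refine mul_le_mul_of_nonneg_left ?_ (wgt_nonneg hy hz N q)
          obtain ⟨-, h1, h2⟩ := Finset.mem_filter.1 hq
          refine mul_le_mul ?_ ?_ (Real.rpow_nonneg hv0 _) (pow_nonneg hu0 _)
          · calc u ^ (κ * N) ≤ u ^ ((bottomVisits₀ q.1 q.2 N : ℕ) : ℝ) := Real.rpow_le_rpow_of_exponent_le hu h1
              _ = u ^ bottomVisits₀ q.1 q.2 N := Real.rpow_natCast u _
          · calc v ^ (κ' * N) ≤ v ^ ((topVisits₀ 1 q.1 q.2 N : ℕ) : ℝ) := Real.rpow_le_rpow_of_exponent_le hv h2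
              _ = v ^ topVisits₀ 1 q.1 q.2 N := Real.rpow_natCast v _
    _ ≤ ∑ q ∈ stripPairs 1 N, wgt (y * u) (z * v) N q :=
        Finset.sum_le_sum_of_subset_of_nonneg (Finset.filter_subset _ _) fun q _ _ =>
          wgt_nonneg (mul_nonneg hy hu0) (mul_nonneg hz hv0) N q

open Classical in
/-- ★★ **Chernoff, south-west quadrant**: for `0 < u, v ≤ 1`, `(Σ_{q : bc ≤ κN, tc ≤ κ'N} y^{bc} z^{tc}) · u^{κN} v^{κ'N} ≤ C_{1,N}(yu, zv)`.
[cite: DemboZeitouni2010, §2.2 Theorem 2.2.3 (Chebycheff step); BeatonBousquetMelouDeGierDuminilCopinGuttmann2014, §3.2 (arXiv v5 p. 10)] -/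
theorem sum_SW_mul_rpow_le (hy : 0 ≤ y) (hz : 0 ≤ z) {u v : ℝ} (hu0 : 0 < u) (hu1 : u ≤ 1) (hv0 : 0 < v) (hv1 : v ≤ 1)
    (N : ℕ) (κ κ' : ℝ) :
    (∑ q ∈ (stripPairs 1 N).filter (fun q => (bottomVisits₀ q.1 q.2 N : ℝ) ≤ κ * N ∧ (topVisits₀ 1 q.1 q.2 N : ℝ) ≤ κ' * N),
        wgt y z N q) * (u ^ (κ * N) * v ^ (κ' * N)) ≤ stripZ₂ 1 N (y * u) (z * v) := by
  rw [Finset.sum_mul, stripZ₂_one_eq_sum_wgt]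
  calc ∑ q ∈ (stripPairs 1 N).filter (fun q => (bottomVisits₀ q.1 q.2 N : ℝ) ≤ κ * N ∧ (topVisits₀ 1 q.1 q.2 N : ℝ) ≤ κ' * N),
        wgt y z N q * (u ^ (κ * N) * v ^ (κ' * N))
      ≤ ∑ q ∈ (stripPairs 1 N).filter (fun q => (bottomVisits₀ q.1 q.2 N : ℝ) ≤ κ * N ∧ (topVisits₀ 1 q.1 q.2 N : ℝ) ≤ κ' * N),
          wgt (y * u) (z * v) N q :=
        Finset.sum_le_sum fun q hq => by
          rw [wgt_tilt₂, mul_assoc]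
          refine mul_le_mul_of_nonneg_left ?_ (wgt_nonneg hy hz N q)
          obtain ⟨-, h1, h2⟩ := Finset.mem_filter.1 hq
          refine mul_le_mul ?_ ?_ (Real.rpow_nonneg hv0.le _) (pow_nonneg hu0.le _)
          · calc u ^ (κ * N) ≤ u ^ ((bottomVisits₀ q.1 q.2 N : ℕ) : ℝ) := Real.rpow_le_rpow_of_exponent_ge hu0 hu1 h1
              _ = u ^ bottomVisits₀ q.1 q.2 N := Real.rpow_natCast u _
          · calc v ^ (κ' * N) ≤ v ^ ((topVisits₀ 1 q.1 q.2 N : ℕ) : ℝ) := Real.rpow_le_rpow_of_exponent_ge hv0 hv1 h2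
              _ = v ^ topVisits₀ 1 q.1 q.2 N := Real.rpow_natCast v _
    _ ≤ ∑ q ∈ stripPairs 1 N, wgt (y * u) (z * v) N q :=
        Finset.sum_le_sum_of_subset_of_nonneg (Finset.filter_subset _ _) fun q _ _ =>
          wgt_nonneg (mul_nonneg hy hu0.le) (mul_nonneg hz hv0.le) N q

/-! ## §2 The change of measure on a box of contact numbers and the two tilted laws of large numbers -/

open Classical in
/-- ★ **Change of both fugacities on a box of contact numbers**: on `W = {a₁N ≤ bc ≤ a₂N} ∩ {a₁'N ≤ tc ≤ a₂'N}` the weights at `(y,z)`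
dominate those at `(Y',Z')` up to `exp(−N·[max(a₁ℓ,a₂ℓ) + max(a₁'ℓ',a₂'ℓ')])`, `ℓ = log(Y'/y)`, `ℓ' = log(Z'/z)`.
[cite: DemboZeitouni2010, §2.2 Theorem 2.2.3 (lower bound: change of measure, key inequality (2.2.14)); BeatonBousquetMelouDeGierDuminilCopinGuttmann2014, §3.2 (arXiv v5 p. 10)] -/
theorem exp_mul_boxSum_le (hy : 0 < y) (hz : 0 < z) {Y' Z' : ℝ} (hY' : 0 < Y') (hZ' : 0 < Z') (a₁ a₂ a₁' a₂' : ℝ) (N : ℕ) :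
    Real.exp (-((max (a₁ * Real.log (Y' / y)) (a₂ * Real.log (Y' / y)) +
        max (a₁' * Real.log (Z' / z)) (a₂' * Real.log (Z' / z))) * N)) *
        (∑ q ∈ (stripPairs 1 N).filter (fun q => (a₁ * N ≤ (bottomVisits₀ q.1 q.2 N : ℝ) ∧
            (bottomVisits₀ q.1 q.2 N : ℝ) ≤ a₂ * N) ∧ (a₁' * N ≤ (topVisits₀ 1 q.1 q.2 N : ℝ) ∧
            (topVisits₀ 1 q.1 q.2 N : ℝ) ≤ a₂' * N)), wgt Y' Z' N q) ≤
      ∑ q ∈ (stripPairs 1 N).filter (fun q => (a₁ * N ≤ (bottomVisits₀ q.1 q.2 N : ℝ) ∧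
            (bottomVisits₀ q.1 q.2 N : ℝ) ≤ a₂ * N) ∧ (a₁' * N ≤ (topVisits₀ 1 q.1 q.2 N : ℝ) ∧
            (topVisits₀ 1 q.1 q.2 N : ℝ) ≤ a₂' * N)), wgt y z N q := by
  have hr : 0 < y / Y' := div_pos hy hY'
  have hr' : 0 < z / Z' := div_pos hz hZ'
  have hlog : Real.log (y / Y') = -Real.log (Y' / y) := by
    rw [Real.log_div hy.ne' hY'.ne', Real.log_div hY'.ne' hy.ne']; ring
  have hlog' : Real.log (z / Z') = -Real.log (Z' / z) := by
    rw [Real.log_div hz.ne' hZ'.ne', Real.log_div hZ'.ne' hz.ne']; ring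
  rw [Finset.mul_sum]
  refine Finset.sum_le_sum fun q hq => ?_
  obtain ⟨-, ⟨hlo, hhi⟩, ⟨hlo', hhi'⟩⟩ := Finset.mem_filter.1 hq
  have hw : wgt y z N q = wgt Y' Z' N q * ((y / Y') ^ bottomVisits₀ q.1 q.2 N * (z / Z') ^ topVisits₀ 1 q.1 q.2 N) := by
    rw [← mul_assoc, ← wgt_tilt₂, mul_div_cancel₀ _ hY'.ne', mul_div_cancel₀ _ hZ'.ne']
  rw [hw, mul_comm (Real.exp _)]
  refine mul_le_mul_of_nonneg_left ?_ (wgt_nonneg hY'.le hZ'.le N q)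
  rw [← Real.rpow_natCast, ← Real.rpow_natCast, Real.rpow_def_of_pos hr, Real.rpow_def_of_pos hr', hlog, hlog',
    ← Real.exp_add]
  apply Real.exp_le_exp.2
  have h := mul_le_max_mul_natCast (ℓ := Real.log (Y' / y)) hlo hhi
  have h' := mul_le_max_mul_natCast (ℓ := Real.log (Z' / z)) hlo' hhi'
  linarith

open Classical in
/-- ★ **The two tilted laws of large numbers fill the box**: if `a₁ < b(Y',Z') < a₂` and `a₁' < b(Z',Y') < a₂'` then eventually
`Σ_{box} Y'^{bc} Z'^{tc} ≥ C_{1,N}(Y',Z')/2` (tree: `tendsto_contactDevFraction` and `tendsto_topContactDevFraction` at `(Y',Z')`).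
[cite: DemboZeitouni2010, §2.2 Theorem 2.2.3 (lower bound: the law of large numbers under the tilted measure); AlmJanson1990, via MadrasSlade1993 §8.5 pp. 278–279] -/
theorem eventually_half_le_boxSum {Y' Z' : ℝ} (hY' : 0 < Y') (hZ' : 0 < Z') {a₁ a₂ a₁' a₂' : ℝ}
    (h₁ : a₁ < contactB Y' Z') (h₂ : contactB Y' Z' < a₂) (h₁' : a₁' < contactB Z' Y') (h₂' : contactB Z' Y' < a₂') :
    ∀ᶠ N : ℕ in atTop, stripZ₂ 1 N Y' Z' / 2 ≤
      ∑ q ∈ (stripPairs 1 N).filter (fun q => (a₁ * N ≤ (bottomVisits₀ q.1 q.2 N : ℝ) ∧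
            (bottomVisits₀ q.1 q.2 N : ℝ) ≤ a₂ * N) ∧ (a₁' * N ≤ (topVisits₀ 1 q.1 q.2 N : ℝ) ∧
            (topVisits₀ 1 q.1 q.2 N : ℝ) ≤ a₂' * N)), wgt Y' Z' N q := by
  set b' := contactB Y' Z' with hb'
  set t' := contactB Z' Y' with ht'
  set δ := min (b' - a₁) (a₂ - b') with hδ
  set δ' := min (t' - a₁') (a₂' - t') with hδ'
  have hδ0 : 0 < δ := lt_min (by linarith) (by linarith)
  have hδ0' : 0 < δ' := lt_min (by linarith) (by linarith)
  have hdev := (tendsto_contactDevFraction hY' hZ' hδ0).eventually (gt_mem_nhds (show (0 : ℝ) < 1 / 4 by norm_num))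
  have hdev' := (tendsto_topContactDevFraction hY' hZ' hδ0').eventually (gt_mem_nhds (show (0 : ℝ) < 1 / 4 by norm_num))
  filter_upwards [hdev, hdev', Filter.eventually_gt_atTop 0] with N hN hN' hN0
  have hNr : (0 : ℝ) < N := by exact_mod_cast hN0
  have hZ := stripZ₂_pos 1 N hY' hZ'
  set W := (stripPairs 1 N).filter (fun q => (a₁ * N ≤ (bottomVisits₀ q.1 q.2 N : ℝ) ∧
      (bottomVisits₀ q.1 q.2 N : ℝ) ≤ a₂ * N) ∧ (a₁' * N ≤ (topVisits₀ 1 q.1 q.2 N : ℝ) ∧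
      (topVisits₀ 1 q.1 q.2 N : ℝ) ≤ a₂' * N)) with hW
  set D₁ := contactDevPairs Y' Z' N δ with hD₁
  set D₂ := (stripPairs 1 N).filter (fun q => δ' ≤ |(topVisits₀ 1 q.1 q.2 N : ℝ) / N - t'|) with hD₂
  -- every walk is in the box or deviates by `δ` in `bc` or by `δ'` in `tc`
  have hcover : stripPairs 1 N ⊆ W ∪ (D₁ ∪ D₂) := by
    intro q hq
    rw [Finset.mem_union, Finset.mem_union]
    by_cases hw : (a₁ * N ≤ (bottomVisits₀ q.1 q.2 N : ℝ) ∧ (bottomVisits₀ q.1 q.2 N : ℝ) ≤ a₂ * N) ∧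
        (a₁' * N ≤ (topVisits₀ 1 q.1 q.2 N : ℝ) ∧ (topVisits₀ 1 q.1 q.2 N : ℝ) ≤ a₂' * N)
    · exact Or.inl (Finset.mem_filter.2 ⟨hq, hw⟩)
    · right
      rw [not_and_or] at hw
      rcases hw with hw | hw
      · left
        rw [hD₁, contactDevPairs, Finset.mem_filter]
        refine ⟨hq, ?_⟩
        rw [not_and_or, not_le, not_le] at hw
        rcases hw with hw | hw
        · have hlt : (bottomVisits₀ q.1 q.2 N : ℝ) / N < a₁ := by rw [div_lt_iff₀ hNr]; linarith
          have : δ ≤ b' - a₁ := min_le_left _ _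
          rw [le_abs]; right; linarith
        · have hlt : a₂ < (bottomVisits₀ q.1 q.2 N : ℝ) / N := by rw [lt_div_iff₀ hNr]; linarith
          have : δ ≤ a₂ - b' := min_le_right _ _
          rw [le_abs]; left; linarith
      · right
        rw [hD₂, Finset.mem_filter]
        refine ⟨hq, ?_⟩
        rw [not_and_or, not_le, not_le] at hw
        rcases hw with hw | hw
        · have hlt : (topVisits₀ 1 q.1 q.2 N : ℝ) / N < a₁' := by rw [div_lt_iff₀ hNr]; linarith
          have : δ' ≤ t' - a₁' := min_le_left _ _
          rw [le_abs]; right; linarith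
        · have hlt : a₂' < (topVisits₀ 1 q.1 q.2 N : ℝ) / N := by rw [lt_div_iff₀ hNr]; linarith
          have : δ' ≤ a₂' - t' := min_le_right _ _
          rw [le_abs]; left; linarith
  have hu : ∀ (A B : Finset (Site 2 × (ℕ → Site 2))),
      ∑ q ∈ A ∪ B, wgt Y' Z' N q ≤ (∑ q ∈ A, wgt Y' Z' N q) + ∑ q ∈ B, wgt Y' Z' N q := by
    intro A B
    rw [← Finset.sum_union_inter]
    linarith [Finset.sum_nonneg (s := A ∩ B) fun q _ => wgt_nonneg hY'.le hZ'.le N q]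
  have hsplit : stripZ₂ 1 N Y' Z' ≤ (∑ q ∈ W, wgt Y' Z' N q) + ((∑ q ∈ D₁, wgt Y' Z' N q) + ∑ q ∈ D₂, wgt Y' Z' N q) := by
    rw [stripZ₂_one_eq_sum_wgt]
    calc ∑ q ∈ stripPairs 1 N, wgt Y' Z' N q ≤ ∑ q ∈ W ∪ (D₁ ∪ D₂), wgt Y' Z' N q :=
          Finset.sum_le_sum_of_subset_of_nonneg hcover fun q _ _ => wgt_nonneg hY'.le hZ'.le N q
      _ ≤ (∑ q ∈ W, wgt Y' Z' N q) + ∑ q ∈ D₁ ∪ D₂, wgt Y' Z' N q := hu _ _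
      _ ≤ _ := by linarith [hu D₁ D₂]
  have hdev₁ : ∑ q ∈ D₁, wgt Y' Z' N q < stripZ₂ 1 N Y' Z' / 4 := by
    have h := hN; rw [div_lt_iff₀ hZ] at h; linarith
  have hdev₂ : ∑ q ∈ D₂, wgt Y' Z' N q < stripZ₂ 1 N Y' Z' / 4 := by
    have h := hN'; rw [div_lt_iff₀ hZ] at h; linarith
  linarith

open Classical in
/-- ★★ **THE LOWER BOUND ON A BOX**: if `a₁ < b(Y',Z') < a₂` and `a₁' < b(Z',Y') < a₂'` then, under `P_{N,y,z}`, the box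
`{a₁N ≤ bc ≤ a₂N} ∩ {a₁'N ≤ tc ≤ a₂'N}` has probability at least
`exp(−N·[max(a₁ℓ,a₂ℓ) + max(a₁'ℓ',a₂'ℓ') − log(μ_1(Y',Z')/μ_1(y,z)) + ε])` for all large `N` (`ℓ = log(Y'/y)`, `ℓ' = log(Z'/z)`).
[cite: DemboZeitouni2010, §2.2 Theorem 2.2.3 (lower bound: (2.2.14) and the tilted law (2.2.15)–(2.2.17)); JansevanRensburg2000, §3.2 Theorem 3.19 (1st ed., p. 52)] -/
theorem exp_le_boxFraction (hy : 0 < y) (hz : 0 < z) {Y' Z' : ℝ} (hY' : 0 < Y') (hZ' : 0 < Z') {a₁ a₂ a₁' a₂' : ℝ}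
    (h₁ : a₁ < contactB Y' Z') (h₂ : contactB Y' Z' < a₂) (h₁' : a₁' < contactB Z' Y') (h₂' : contactB Z' Y' < a₂')
    {ε : ℝ} (hε : 0 < ε) :
    ∀ᶠ N : ℕ in atTop,
      Real.exp ((-((max (a₁ * Real.log (Y' / y)) (a₂ * Real.log (Y' / y)) +
          max (a₁' * Real.log (Z' / z)) (a₂' * Real.log (Z' / z))) -
          Real.log (stripMuY₂ 1 Y' Z' / stripMuY₂ 1 y z)) - ε) * N) ≤
        (∑ q ∈ (stripPairs 1 N).filter (fun q => (a₁ * N ≤ (bottomVisits₀ q.1 q.2 N : ℝ) ∧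
            (bottomVisits₀ q.1 q.2 N : ℝ) ≤ a₂ * N) ∧ (a₁' * N ≤ (topVisits₀ 1 q.1 q.2 N : ℝ) ∧
            (topVisits₀ 1 q.1 q.2 N : ℝ) ≤ a₂' * N)), wgt y z N q) / stripZ₂ 1 N y z := by
  set K' := yK Y' * yK Z' with hK'
  have hK'1 : 1 ≤ K' := by rw [hK']; nlinarith [one_le_yK Y', one_le_yK Z']
  have hK'0 : 0 < K' := by linarith
  have hε2 : 0 < ε / 2 := by linarith
  set M := max (a₁ * Real.log (Y' / y)) (a₂ * Real.log (Y' / y)) +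
      max (a₁' * Real.log (Z' / z)) (a₂' * Real.log (Z' / z)) with hM
  rw [Real.log_div (stripMuY₂_pos 1 hY' hZ').ne' (stripMuY₂_pos 1 hy hz).ne']
  filter_upwards [eventually_stripZ₂_one_exp_bounds hY' hZ' hε2, eventually_stripZ₂_one_exp_bounds hy hz hε2,
    eventually_le_exp_mul (K := 2 * K') hε2, eventually_half_le_boxSum hY' hZ' h₁ h₂ h₁' h₂'] with N hNY hNy hNK hwin
  obtain ⟨hZY, _⟩ := hNY
  obtain ⟨_, hZy⟩ := hNy
  have hZy0 := stripZ₂_pos 1 N hy hz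
  have hZY0 := stripZ₂_pos 1 N hY' hZ'
  set SW := ∑ q ∈ (stripPairs 1 N).filter (fun q => (a₁ * N ≤ (bottomVisits₀ q.1 q.2 N : ℝ) ∧
            (bottomVisits₀ q.1 q.2 N : ℝ) ≤ a₂ * N) ∧ (a₁' * N ≤ (topVisits₀ 1 q.1 q.2 N : ℝ) ∧
            (topVisits₀ 1 q.1 q.2 N : ℝ) ≤ a₂' * N)), wgt y z N q with hSW
  set SW' := ∑ q ∈ (stripPairs 1 N).filter (fun q => (a₁ * N ≤ (bottomVisits₀ q.1 q.2 N : ℝ) ∧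
            (bottomVisits₀ q.1 q.2 N : ℝ) ≤ a₂ * N) ∧ (a₁' * N ≤ (topVisits₀ 1 q.1 q.2 N : ℝ) ∧
            (topVisits₀ 1 q.1 q.2 N : ℝ) ≤ a₂' * N)), wgt Y' Z' N q with hSW'
  have hchange : Real.exp (-(M * N)) * SW' ≤ SW := exp_mul_boxSum_le hy hz hY' hZ' a₁ a₂ a₁' a₂' N
  have hZY' : Real.exp (Real.log (stripMuY₂ 1 Y' Z') * N) * Real.exp (-(ε / 2 * N)) ≤ stripZ₂ 1 N Y' Z' / 2 := by
    rw [Real.exp_neg, le_div_iff₀ (by norm_num : (0:ℝ) < 2)]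
    have hE := Real.exp_pos (ε / 2 * N)
    calc Real.exp (Real.log (stripMuY₂ 1 Y' Z') * N) * (Real.exp (ε / 2 * N))⁻¹ * 2
        = Real.exp (Real.log (stripMuY₂ 1 Y' Z') * N) * (2 / Real.exp (ε / 2 * N)) := by ring
      _ ≤ Real.exp (Real.log (stripMuY₂ 1 Y' Z') * N) * (1 / K') := by
          refine mul_le_mul_of_nonneg_left ?_ (Real.exp_pos _).le
          rw [div_le_div_iff₀ hE hK'0]; linarith
      _ = Real.exp (Real.log (stripMuY₂ 1 Y' Z') * N) / K' := by ring
      _ ≤ stripZ₂ 1 N Y' Z' := by rw [div_le_iff₀ hK'0]; linarith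
  have hlow : Real.exp (-(M * N)) * (Real.exp (Real.log (stripMuY₂ 1 Y' Z') * N) * Real.exp (-(ε / 2 * N))) ≤ SW :=
    (mul_le_mul_of_nonneg_left (hZY'.trans hwin) (Real.exp_pos _).le).trans hchange
  rw [le_div_iff₀ hZy0]
  calc Real.exp ((-(M - (Real.log (stripMuY₂ 1 Y' Z') - Real.log (stripMuY₂ 1 y z))) - ε) * N) * stripZ₂ 1 N y z
      ≤ Real.exp ((-(M - (Real.log (stripMuY₂ 1 Y' Z') - Real.log (stripMuY₂ 1 y z))) - ε) * N) *
          Real.exp ((Real.log (stripMuY₂ 1 y z) + ε / 2) * N) := by gcongr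
    _ = Real.exp (-(M * N)) * (Real.exp (Real.log (stripMuY₂ 1 Y' Z') * N) * Real.exp (-(ε / 2 * N))) := by
        rw [← Real.exp_add, ← Real.exp_add, ← Real.exp_add]; congr 1; ring
    _ ≤ SW := hlow

/-! ## §3 The joint rate `J(y,z;Y,Z)`, joint continuity, and the explicit tilt from the inverse equation of state -/

/-- **The joint rate at the tilt `(Y,Z)`**: `J(y,z;Y,Z) = b(Y,Z)·log(Y/y) + b(Z,Y)·log(Z/z) − log(μ_1(Y,Z)/μ_1(y,z))` — the exponential
cost under `P_{N,y,z}` of the density pair `(b(Y,Z), b(Z,Y))` typical under `P_{N,Y,Z}`. [cite: DemboZeitouni2010, §2.2 Theorem 2.2.3 and §2.3 Definition 2.3.3; BeatonBousquetMelouDeGierDuminilCopinGuttmann2014, §3.2 Proposition 6 (arXiv v5 p. 10)] -/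
def jointRate (y z Y Z : ℝ) : ℝ :=
  contactB Y Z * Real.log (Y / y) + contactB Z Y * Real.log (Z / z) - Real.log (stripMuY₂ 1 Y Z / stripMuY₂ 1 y z)

/-- `J(y,z;y,z) = 0`. [cite: DemboZeitouni2010, §2.2 (lane plumbing)] -/
theorem jointRate_self (hy : 0 < y) (hz : 0 < z) : jointRate y z y z = 0 := by
  unfold jointRate
  rw [div_self hy.ne', div_self hz.ne', div_self (stripMuY₂_pos 1 hy hz).ne', Real.log_one]; ring

/-- **The explicit tilt**: for `(a,a')` in the open density triangle, the fugacities `(Y(a,a'), Y(a',a))` of the inverse equation of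
state (`eosY`, tree `contactB_eosY`) realise the densities `(a,a')`, depend continuously on `(a,a')`, and move the typical point of the
tilted measure to any prescribed nearby density pair — the two-variable replacement of the intermediate value theorem of the one-wall
file. [cite: DemboZeitouni2010, §2.3 Definition 2.3.3 (exposed points); BeatonBousquetMelouDeGierDuminilCopinGuttmann2014, §3.2 Proposition 6 (arXiv v5 p. 10)] -/
theorem continuousAt_eosY {a a' : ℝ} (ha : 0 < a) (hρ : a + a' < 1 / 2) :
    ContinuousAt (fun p : ℝ × ℝ => eosY p.1 p.2) (a, a') := by
  unfold eosY
  have h1 : ContinuousAt (fun p : ℝ × ℝ => p.1) (a, a') := continuousAt_fst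
  have h2 : ContinuousAt (fun p : ℝ × ℝ => p.2) (a, a') := continuousAt_snd
  have hden : 2 * a * (1 - 2 * a - 2 * a') ^ 2 ≠ 0 := by
    have : 0 < 1 - 2 * a - 2 * a' := by linarith
    positivity
  exact ((((h1.const_mul 4).add (h2.const_mul 2)).sub continuousAt_const).pow 2 |>.mul
    (((h1.const_mul 2).add (h2.const_mul 4)).sub continuousAt_const)).div
    ((h1.const_mul 2).mul (((continuousAt_const.sub (h1.const_mul 2)).sub (h2.const_mul 2)).pow 2)) hden

/-- ★ **THE JOINT RATE IN CLOSED FORM ON THE DENSITY TRIANGLE**: at the explicit tilt `(Y,Z) = (Y(a,a'), Y(a',a))`,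
`J = a·log(Y(a,a')/y) + a'·log(Y(a',a)/z) − ½·log[(4a+2a'−1)(2a+4a'−1)/(1−2a−2a')²] + log μ_1(y,z)` — an ELEMENTARY function of the two
densities and the base fugacities. [cite: DemboZeitouni2010, §2.2 Theorem 2.2.3 (rate function); BeatonBousquetMelouDeGierDuminilCopinGuttmann2014, §3.2 Proposition 6 (arXiv v5 p. 10)] -/
theorem jointRate_eosY (hy : 0 < y) (hz : 0 < z) {a a' : ℝ} (h1 : a + a' < 1 / 2) (h2 : 1 < 4 * a + 2 * a')
    (h3 : 1 < 2 * a + 4 * a') :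
    jointRate y z (eosY a a') (eosY a' a) = a * Real.log (eosY a a' / y) + a' * Real.log (eosY a' a / z) -
      (Real.log ((4 * a + 2 * a' - 1) * (2 * a + 4 * a' - 1) / (1 - 2 * a - 2 * a') ^ 2) / 2 -
        Real.log (stripMuY₂ 1 y z)) := by
  obtain ⟨hY0, hZ0, hb, hb', -, hS⟩ := contactB_eosY h1 h2 h3
  have hμ := stripMuY₂_pos 1 hY0 hZ0
  unfold jointRate
  rw [hb, hb', Real.log_div hμ.ne' (stripMuY₂_pos 1 hy hz).ne', ← hS, Real.log_pow]
  push_cast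
  ring

/-! ## §4 THE JOINT LARGE DEVIATION PRINCIPLE in the aligned quadrants -/

/-- Continuity at `δ = 0` of the box cost along the explicit tilt `δ ↦ (Y(a+δ,a'+κδ), Y(a'+κδ,a+δ))` (`κ = ±1` for the aligned / mixed quadrants), and its value `J(y,z;Y,Z)` at `δ = 0`
(`(a,a') = (b(Y,Z), b(Z,Y))`, so `Y(a,a') = Y`, `Y(a',a) = Z` by the inverse equation of state).
[cite: DemboZeitouni2010, §2.2 (lane plumbing); BeatonBousquetMelouDeGierDuminilCopinGuttmann2014, §3.2 Proposition 6 (arXiv v5 p. 10)] -/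
theorem continuousAt_boxCost (hy : 0 < y) (hz : 0 < z) {Y Z : ℝ} (hY : 0 < Y) (hZ : 0 < Z) (κ c c' : ℝ) :
    ContinuousAt (fun δ : ℝ =>
      max (contactB Y Z * Real.log (eosY (contactB Y Z + δ) (contactB Z Y + κ * δ) / y))
          ((contactB Y Z + c * δ) * Real.log (eosY (contactB Y Z + δ) (contactB Z Y + κ * δ) / y)) +
        max (contactB Z Y * Real.log (eosY (contactB Z Y + κ * δ) (contactB Y Z + δ) / z))
          ((contactB Z Y + c' * δ) * Real.log (eosY (contactB Z Y + κ * δ) (contactB Y Z + δ) / z)) -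
        Real.log (stripMuY₂ 1 (eosY (contactB Y Z + δ) (contactB Z Y + κ * δ)) (eosY (contactB Z Y + κ * δ) (contactB Y Z + δ)) /
          stripMuY₂ 1 y z)) 0 ∧
    (max (contactB Y Z * Real.log (eosY (contactB Y Z + 0) (contactB Z Y + κ * 0) / y))
          ((contactB Y Z + c * 0) * Real.log (eosY (contactB Y Z + 0) (contactB Z Y + κ * 0) / y)) +
        max (contactB Z Y * Real.log (eosY (contactB Z Y + κ * 0) (contactB Y Z + 0) / z))
          ((contactB Z Y + c' * 0) * Real.log (eosY (contactB Z Y + κ * 0) (contactB Y Z + 0) / z)) -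
        Real.log (stripMuY₂ 1 (eosY (contactB Y Z + 0) (contactB Z Y + κ * 0)) (eosY (contactB Z Y + κ * 0) (contactB Y Z + 0)) /
          stripMuY₂ 1 y z) = jointRate y z Y Z) := by
  set a := contactB Y Z with ha
  set a' := contactB Z Y with ha'
  obtain ⟨t1, t2, t3⟩ := contactB_mem_triangle hY hZ
  obtain ⟨hapos, -⟩ := (contactB_facts hY hZ).2.2.2.2
  obtain ⟨hapos', -⟩ := (contactB_facts hZ hY).2.2.2.2
  obtain ⟨eY, eZ⟩ := eosY_contactB hY hZ
  -- continuity of the two tilted fugacities at `δ = 0`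
  have hpath : ContinuousAt (fun δ : ℝ => (a + δ, a' + κ * δ)) 0 :=
    (continuousAt_const.add continuousAt_id).prodMk (continuousAt_const.add (continuousAt_const.mul continuousAt_id))
  have hpath' : ContinuousAt (fun δ : ℝ => (a' + κ * δ, a + δ)) 0 :=
    (continuousAt_const.add (continuousAt_const.mul continuousAt_id)).prodMk (continuousAt_const.add continuousAt_id)
  have hE : ContinuousAt (fun δ : ℝ => eosY (a + δ) (a' + κ * δ)) 0 := by
    have h := continuousAt_eosY hapos t1
    have h0 : (fun δ : ℝ => (a + δ, a' + κ * δ)) 0 = (a, a') := by simp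
    rw [← h0] at h
    exact ContinuousAt.comp (f := fun δ : ℝ => (a + δ, a' + κ * δ)) (g := fun p : ℝ × ℝ => eosY p.1 p.2) h hpath
  have hE' : ContinuousAt (fun δ : ℝ => eosY (a' + κ * δ) (a + δ)) 0 := by
    have h := continuousAt_eosY hapos' (by linarith : a' + a < 1 / 2)
    have h0 : (fun δ : ℝ => (a' + κ * δ, a + δ)) 0 = (a', a) := by simp
    rw [← h0] at h
    exact ContinuousAt.comp (f := fun δ : ℝ => (a' + κ * δ, a + δ)) (g := fun p : ℝ × ℝ => eosY p.1 p.2) h hpath'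
  have hE0 : eosY (a + 0) (a' + κ * 0) = Y := by rw [mul_zero, add_zero, add_zero]; exact eY
  have hE0' : eosY (a' + κ * 0) (a + 0) = Z := by rw [mul_zero, add_zero, add_zero]; exact eZ
  -- the logarithms
  have hlog : ContinuousAt (fun δ : ℝ => Real.log (eosY (a + δ) (a' + κ * δ) / y)) 0 :=
    (hE.div_const y).log (by rw [hE0]; exact (div_pos hY hy).ne')
  have hlog' : ContinuousAt (fun δ : ℝ => Real.log (eosY (a' + κ * δ) (a + δ) / z)) 0 :=
    (hE'.div_const z).log (by rw [hE0']; exact (div_pos hZ hz).ne')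
  -- the growth rate along the tilt
  have hμ2 : ContinuousAt (fun p : ℝ × ℝ => stripMuY₂ 1 p.1 p.2) (eosY (a + 0) (a' + κ * 0), eosY (a' + κ * 0) (a + 0)) := by
    rw [hE0, hE0']
    exact (continuousOn_stripMuY₂ 1).continuousAt ((isOpen_Ioi.prod isOpen_Ioi).mem_nhds ⟨hY, hZ⟩)
  have hμ : ContinuousAt (fun δ : ℝ => stripMuY₂ 1 (eosY (a + δ) (a' + κ * δ)) (eosY (a' + κ * δ) (a + δ))) 0 :=
    ContinuousAt.comp (f := fun δ : ℝ => (eosY (a + δ) (a' + κ * δ), eosY (a' + κ * δ) (a + δ)))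
      (g := fun p : ℝ × ℝ => stripMuY₂ 1 p.1 p.2) hμ2 (hE.prodMk hE')
  have hμlog : ContinuousAt (fun δ : ℝ => Real.log (stripMuY₂ 1 (eosY (a + δ) (a' + κ * δ)) (eosY (a' + κ * δ) (a + δ)) /
      stripMuY₂ 1 y z)) 0 :=
    (hμ.div_const _).log (by
      rw [hE0, hE0']; exact (div_pos (stripMuY₂_pos 1 hY hZ) (stripMuY₂_pos 1 hy hz)).ne')
  refine ⟨?_, ?_⟩
  · exact (((continuousAt_const.mul hlog).max ((continuousAt_const.add (continuousAt_const.mul continuousAt_id)).mul hlog)).add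
      ((continuousAt_const.mul hlog').max ((continuousAt_const.add (continuousAt_const.mul continuousAt_id)).mul hlog'))).sub hμlog
  · rw [hE0, hE0', mul_zero, mul_zero, add_zero, add_zero, max_self, max_self]
    rfl

open Classical in
/-- ★★★ **THE JOINT LARGE DEVIATION PRINCIPLE — NORTH-EAST QUADRANT.**  For all `y, z > 0` and every tilt `Y ≥ y`, `Z ≥ z`:
`lim_{N→∞} (1/N) log P_{N,y,z}(bc ≥ b(Y,Z)·N and tc ≥ b(Z,Y)·N) = −J(y,z;Y,Z)`,
`J = b(Y,Z) log(Y/y) + b(Z,Y) log(Z/z) − log(μ_1(Y,Z)/μ_1(y,z))` (`P_{N,y,z} ∝ y^{bc} z^{tc}` on the `N`-step self-avoiding walks of the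
one-cell strip).  Upper bound: Chernoff with both tilts `Y/y, Z/z ≥ 1`; lower bound: change of BOTH fugacities to the explicit tilt
`(Y(a+δ,a'+δ), Y(a'+δ,a+δ))` of the inverse equation of state (`HexSAWBrickWallStripTwoWallChart`), whose typical density pair `(a+δ, a'+δ)`
lies inside the box `[a,a+2δ] × [a',a'+2δ]`, and the two contact-density laws there.  The tilts off the rays — declared open in
`HexSAWBrickWallStripRungRays` — are thereby done in the aligned quadrants.
[cite: DemboZeitouni2010, §2.2 Theorem 2.2.3 (Cramér) and §2.3 Definition 2.3.3; JansevanRensburg2000, §3.2 Theorems 3.17–3.19 (1st ed., pp. 50–52); BeatonBousquetMelouDeGierDuminilCopinGuttmann2014, §3.2 Proposition 6 (arXiv v5 p. 10)] -/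
theorem tendsto_log_contacts_NE_div (hy : 0 < y) (hz : 0 < z) {Y Z : ℝ} (hyY : y ≤ Y) (hzZ : z ≤ Z) :
    Tendsto (fun N : ℕ => Real.log ((∑ q ∈ (stripPairs 1 N).filter
        (fun q => contactB Y Z * N ≤ (bottomVisits₀ q.1 q.2 N : ℝ) ∧ contactB Z Y * N ≤ (topVisits₀ 1 q.1 q.2 N : ℝ)),
        wgt y z N q) / stripZ₂ 1 N y z) / N) atTop (𝓝 (-jointRate y z Y Z)) := by
  have hY : 0 < Y := hy.trans_le hyY
  have hZ : 0 < Z := hz.trans_le hzZ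
  set a := contactB Y Z with ha
  set a' := contactB Z Y with ha'
  obtain ⟨t1, t2, t3⟩ := contactB_mem_triangle hY hZ
  refine tendsto_log_div_of_exp_bounds (fun ε hε => ?_) (fun ε hε => ?_)
  · -- the lower bound: explicit tilt to the densities `(a+δ, a'+δ)`
    have hε2 : 0 < ε / 2 := by linarith
    obtain ⟨hcont, hval⟩ := continuousAt_boxCost hy hz hY hZ 1 2 2
    simp only [one_mul] at hcont hval
    have hlt := hval.trans_lt (show jointRate y z Y Z < jointRate y z Y Z + ε / 2 by linarith)
    have hev := hcont.eventually (gt_mem_nhds hlt)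
    have hroom : 0 < (1 / 2 - a - a') / 2 := by linarith
    obtain ⟨δ, hδc, hδ0, hδ1⟩ := ((hev.filter_mono nhdsWithin_le_nhds).and (Ioo_mem_nhdsGT hroom)).exists
    have s1 : (a + δ) + (a' + δ) < 1 / 2 := by linarith
    have s2 : 1 < 4 * (a + δ) + 2 * (a' + δ) := by linarith
    have s3 : 1 < 2 * (a + δ) + 4 * (a' + δ) := by linarith
    obtain ⟨hY'0, hZ'0, hbY', hbZ', -, -⟩ := contactB_eosY s1 s2 s3
    set Y' := eosY (a + δ) (a' + δ) with hY'
    set Z' := eosY (a' + δ) (a + δ) with hZ'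
    have hb1 : a < contactB Y' Z' := by rw [hbY']; linarith
    have hb2 : contactB Y' Z' < a + 2 * δ := by rw [hbY']; linarith
    have hb1' : a' < contactB Z' Y' := by rw [hbZ']; linarith
    have hb2' : contactB Z' Y' < a' + 2 * δ := by rw [hbZ']; linarith
    filter_upwards [exp_le_boxFraction hy hz hY'0 hZ'0 hb1 hb2 hb1' hb2' hε2] with N hN
    refine le_trans ?_ (hN.trans ?_)
    · exact Real.exp_le_exp.2 (mul_le_mul_of_nonneg_right (by linarith) (Nat.cast_nonneg N))
    · refine div_le_div_of_nonneg_right ?_ (stripZ₂_pos 1 N hy hz).le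
      refine Finset.sum_le_sum_of_subset_of_nonneg (fun q hq => ?_) fun q _ _ => wgt_nonneg hy.le hz.le N q
      rw [Finset.mem_filter] at hq ⊢
      exact ⟨hq.1, hq.2.1.1, hq.2.2.1⟩
  · -- the upper bound: Chernoff with the two tilts `Y/y ≥ 1`, `Z/z ≥ 1`
    have hu1 : 1 ≤ Y / y := (one_le_div hy).2 hyY
    have hv1 : 1 ≤ Z / z := (one_le_div hz).2 hzZ
    set u := Real.exp (a * Real.log (Y / y) + a' * Real.log (Z / z)) with hu
    have hu0 : 0 < u := Real.exp_pos _
    have hlogu : Real.log u = a * Real.log (Y / y) + a' * Real.log (Z / z) := Real.log_exp _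
    set S : ℕ → ℝ := fun N => ∑ q ∈ (stripPairs 1 N).filter
        (fun q => a * N ≤ (bottomVisits₀ q.1 q.2 N : ℝ) ∧ a' * N ≤ (topVisits₀ 1 q.1 q.2 N : ℝ)), wgt y z N q with hS
    have hSN : ∀ N : ℕ, S N * u ^ ((1 : ℝ) * N + 0) ≤ stripZ₂ 1 N Y Z := by
      intro N
      have h := sum_NE_mul_rpow_le hy.le hz.le hu1 hv1 N a a'
      rw [mul_div_cancel₀ _ hy.ne', mul_div_cancel₀ _ hz.ne'] at h
      have e : u ^ ((1 : ℝ) * N + 0) = (Y / y) ^ (a * N) * (Z / z) ^ (a' * N) := by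
        rw [Real.rpow_def_of_pos hu0, Real.rpow_def_of_pos (div_pos hY hy), Real.rpow_def_of_pos (div_pos hZ hz),
          ← Real.exp_add, hlogu]
        congr 1; ring
      rw [e]; exact h
    have h := fraction_le_exp_of_chernoff₂ hy hz hY hZ hu0 1 0 S hSN hε
    filter_upwards [h] with N hN
    have e : -jointRate y z Y Z + ε = -((1 : ℝ) * Real.log u - Real.log (stripMuY₂ 1 Y Z / stripMuY₂ 1 y z)) + ε := by
      rw [hlogu]; unfold jointRate; ring
    rw [e]
    exact hN

/-- ★★ **THE JOINT RATE IS NON-NEGATIVE IN THE ALIGNED QUADRANT** — by probability, not by convexity: the probabilities are `≤ 1`, so the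
limit `−J ≤ 0`.  (Positivity of `J` off the point `(Y,Z) = (y,z)` is the strict joint convexity of the free energy, not claimed here.)
[cite: DemboZeitouni2010, §2.2 Theorem 2.2.3; BeatonBousquetMelouDeGierDuminilCopinGuttmann2014, §3.2 Proposition 6 (arXiv v5 p. 10)] -/
theorem jointRate_nonneg (hy : 0 < y) (hz : 0 < z) {Y Z : ℝ} (hyY : y ≤ Y) (hzZ : z ≤ Z) : 0 ≤ jointRate y z Y Z := by
  classical
  have h := tendsto_log_contacts_NE_div hy hz hyY hzZ
  have hle : ∀ᶠ N : ℕ in atTop, Real.log ((∑ q ∈ (stripPairs 1 N).filter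
        (fun q => contactB Y Z * N ≤ (bottomVisits₀ q.1 q.2 N : ℝ) ∧ contactB Z Y * N ≤ (topVisits₀ 1 q.1 q.2 N : ℝ)),
        wgt y z N q) / stripZ₂ 1 N y z) / N ≤ 0 := by
    refine Eventually.of_forall fun N => ?_
    apply div_nonpos_of_nonpos_of_nonneg _ (Nat.cast_nonneg N)
    apply Real.log_nonpos (div_nonneg (Finset.sum_nonneg fun q _ => wgt_nonneg hy.le hz.le N q) (stripZ₂_pos 1 N hy hz).le)
    rw [div_le_one (stripZ₂_pos 1 N hy hz), stripZ₂_one_eq_sum_wgt]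
    exact Finset.sum_le_sum_of_subset_of_nonneg (Finset.filter_subset _ _) fun q _ _ => wgt_nonneg hy.le hz.le N q
  have := le_of_tendsto h hle
  linarith

/-- ★ **Chernoff, any quadrant** (generic form): if on the event `P` the tilt factors dominate, `u^{κN} ≤ u^{bc}` and `v^{κ'N} ≤ v^{tc}`,
then `(Σ_P y^{bc} z^{tc}) · u^{κN} v^{κ'N} ≤ C_{1,N}(yu, zv)`. [cite: DemboZeitouni2010, §2.2 Theorem 2.2.3 (Chebycheff step); BeatonBousquetMelouDeGierDuminilCopinGuttmann2014, §3.2 (arXiv v5 p. 10)] -/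
theorem sum_filter_mul_rpow_le (hy : 0 ≤ y) (hz : 0 ≤ z) {u v : ℝ} (hu : 0 < u) (hv : 0 < v) (N : ℕ) (κ κ' : ℝ)
    (P : Site 2 × (ℕ → Site 2) → Prop) [DecidablePred P]
    (hP : ∀ q ∈ (stripPairs 1 N).filter P, u ^ (κ * N) ≤ u ^ ((bottomVisits₀ q.1 q.2 N : ℕ) : ℝ) ∧
      v ^ (κ' * N) ≤ v ^ ((topVisits₀ 1 q.1 q.2 N : ℕ) : ℝ)) :
    (∑ q ∈ (stripPairs 1 N).filter P, wgt y z N q) * (u ^ (κ * N) * v ^ (κ' * N)) ≤ stripZ₂ 1 N (y * u) (z * v) := by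
  rw [Finset.sum_mul, stripZ₂_one_eq_sum_wgt]
  calc ∑ q ∈ (stripPairs 1 N).filter P, wgt y z N q * (u ^ (κ * N) * v ^ (κ' * N))
      ≤ ∑ q ∈ (stripPairs 1 N).filter P, wgt (y * u) (z * v) N q :=
        Finset.sum_le_sum fun q hq => by
          rw [wgt_tilt₂, mul_assoc]
          refine mul_le_mul_of_nonneg_left ?_ (wgt_nonneg hy hz N q)
          obtain ⟨h1, h2⟩ := hP q hq
          refine mul_le_mul ?_ ?_ (Real.rpow_nonneg hv.le _) (pow_nonneg hu.le _)
          · rw [← Real.rpow_natCast]; exact h1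
          · rw [← Real.rpow_natCast]; exact h2
    _ ≤ ∑ q ∈ stripPairs 1 N, wgt (y * u) (z * v) N q :=
        Finset.sum_le_sum_of_subset_of_nonneg (Finset.filter_subset _ _) fun q _ _ =>
          wgt_nonneg (mul_nonneg hy hu.le) (mul_nonneg hz hv.le) N q

open Classical in
/-- ★★★ **THE JOINT LARGE DEVIATION PRINCIPLE — SOUTH-WEST QUADRANT.**  For all `y, z > 0` and every tilt `0 < Y ≤ y`, `0 < Z ≤ z`:
`lim_{N→∞} (1/N) log P_{N,y,z}(bc ≤ b(Y,Z)·N and tc ≤ b(Z,Y)·N) = −J(y,z;Y,Z)` (both walls less adsorbed than typical).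
[cite: DemboZeitouni2010, §2.2 Theorem 2.2.3 (Cramér) and §2.3 Definition 2.3.3; JansevanRensburg2000, §3.2 Theorems 3.17–3.19 (1st ed., pp. 50–52); BeatonBousquetMelouDeGierDuminilCopinGuttmann2014, §3.2 Proposition 6 (arXiv v5 p. 10)] -/
theorem tendsto_log_contacts_SW_div (hy : 0 < y) (hz : 0 < z) {Y Z : ℝ} (hY : 0 < Y) (hYy : Y ≤ y) (hZ : 0 < Z) (hZz : Z ≤ z) :
    Tendsto (fun N : ℕ => Real.log ((∑ q ∈ (stripPairs 1 N).filter
        (fun q => (bottomVisits₀ q.1 q.2 N : ℝ) ≤ contactB Y Z * N ∧ (topVisits₀ 1 q.1 q.2 N : ℝ) ≤ contactB Z Y * N),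
        wgt y z N q) / stripZ₂ 1 N y z) / N) atTop (𝓝 (-jointRate y z Y Z)) := by
  set a := contactB Y Z with ha
  set a' := contactB Z Y with ha'
  obtain ⟨t1, t2, t3⟩ := contactB_mem_triangle hY hZ
  refine tendsto_log_div_of_exp_bounds (fun ε hε => ?_) (fun ε hε => ?_)
  · -- the lower bound: explicit tilt to the densities `(a+δ, a'+δ)`, `δ < 0`
    have hε2 : 0 < ε / 2 := by linarith
    obtain ⟨hcont, hval⟩ := continuousAt_boxCost hy hz hY hZ 1 2 2
    simp only [one_mul] at hcont hval
    have hlt := hval.trans_lt (show jointRate y z Y Z < jointRate y z Y Z + ε / 2 by linarith)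
    have hev := hcont.eventually (gt_mem_nhds hlt)
    have hroom : -(min (4 * a + 2 * a' - 1) (2 * a + 4 * a' - 1) / 12) < 0 := by
      have : 0 < min (4 * a + 2 * a' - 1) (2 * a + 4 * a' - 1) := lt_min (by linarith) (by linarith)
      linarith
    obtain ⟨δ, hδc, hδ1, hδ0⟩ := ((hev.filter_mono nhdsWithin_le_nhds).and (Ioo_mem_nhdsLT hroom)).exists
    have hm1 : min (4 * a + 2 * a' - 1) (2 * a + 4 * a' - 1) ≤ 4 * a + 2 * a' - 1 := min_le_left _ _
    have hm2 : min (4 * a + 2 * a' - 1) (2 * a + 4 * a' - 1) ≤ 2 * a + 4 * a' - 1 := min_le_right _ _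
    have s1 : (a + δ) + (a' + δ) < 1 / 2 := by linarith
    have s2 : 1 < 4 * (a + δ) + 2 * (a' + δ) := by linarith
    have s3 : 1 < 2 * (a + δ) + 4 * (a' + δ) := by linarith
    obtain ⟨hY'0, hZ'0, hbY', hbZ', -, -⟩ := contactB_eosY s1 s2 s3
    set Y' := eosY (a + δ) (a' + δ) with hY'
    set Z' := eosY (a' + δ) (a + δ) with hZ'
    have hb1 : a + 2 * δ < contactB Y' Z' := by rw [hbY']; linarith
    have hb2 : contactB Y' Z' < a := by rw [hbY']; linarith
    have hb1' : a' + 2 * δ < contactB Z' Y' := by rw [hbZ']; linarith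
    have hb2' : contactB Z' Y' < a' := by rw [hbZ']; linarith
    filter_upwards [exp_le_boxFraction hy hz hY'0 hZ'0 hb1 hb2 hb1' hb2' hε2] with N hN
    rw [max_comm ((a + 2 * δ) * _) (a * _), max_comm ((a' + 2 * δ) * _) (a' * _)] at hN
    refine le_trans ?_ (hN.trans ?_)
    · exact Real.exp_le_exp.2 (mul_le_mul_of_nonneg_right (by linarith) (Nat.cast_nonneg N))
    · refine div_le_div_of_nonneg_right ?_ (stripZ₂_pos 1 N hy hz).le
      refine Finset.sum_le_sum_of_subset_of_nonneg (fun q hq => ?_) fun q _ _ => wgt_nonneg hy.le hz.le N q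
      rw [Finset.mem_filter] at hq ⊢
      exact ⟨hq.1, hq.2.1.2, hq.2.2.2⟩
  · -- the upper bound: Chernoff with the two tilts `Y/y ≤ 1`, `Z/z ≤ 1`
    have hu0' : 0 < Y / y := div_pos hY hy
    have hv0' : 0 < Z / z := div_pos hZ hz
    have hu1 : Y / y ≤ 1 := (div_le_one hy).2 hYy
    have hv1 : Z / z ≤ 1 := (div_le_one hz).2 hZz
    set u := Real.exp (a * Real.log (Y / y) + a' * Real.log (Z / z)) with hu
    have hu0 : 0 < u := Real.exp_pos _
    have hlogu : Real.log u = a * Real.log (Y / y) + a' * Real.log (Z / z) := Real.log_exp _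
    set S : ℕ → ℝ := fun N => ∑ q ∈ (stripPairs 1 N).filter
        (fun q => (bottomVisits₀ q.1 q.2 N : ℝ) ≤ a * N ∧ (topVisits₀ 1 q.1 q.2 N : ℝ) ≤ a' * N), wgt y z N q with hS
    have hSN : ∀ N : ℕ, S N * u ^ ((1 : ℝ) * N + 0) ≤ stripZ₂ 1 N Y Z := by
      intro N
      have h := sum_SW_mul_rpow_le hy.le hz.le hu0' hu1 hv0' hv1 N a a'
      rw [mul_div_cancel₀ _ hy.ne', mul_div_cancel₀ _ hz.ne'] at h
      have e : u ^ ((1 : ℝ) * N + 0) = (Y / y) ^ (a * N) * (Z / z) ^ (a' * N) := by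
        rw [Real.rpow_def_of_pos hu0, Real.rpow_def_of_pos hu0', Real.rpow_def_of_pos hv0', ← Real.exp_add, hlogu]
        congr 1; ring
      rw [e]; exact h
    have h := fraction_le_exp_of_chernoff₂ hy hz hY hZ hu0 1 0 S hSN hε
    filter_upwards [h] with N hN
    have e : -jointRate y z Y Z + ε = -((1 : ℝ) * Real.log u - Real.log (stripMuY₂ 1 Y Z / stripMuY₂ 1 y z)) + ε := by
      rw [hlogu]; unfold jointRate; ring
    rw [e]
    exact hN

open Classical in
/-- ★★★ **THE JOINT LARGE DEVIATION PRINCIPLE — NORTH-WEST QUADRANT** (bottom wall over-adsorbed, top wall under-adsorbed): for `Y ≥ y`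
and `0 < Z ≤ z`, `lim_{N→∞} (1/N) log P_{N,y,z}(bc ≥ b(Y,Z)·N and tc ≤ b(Z,Y)·N) = −J(y,z;Y,Z)` (tilt path `(a+δ, a'−δ)`).
[cite: DemboZeitouni2010, §2.2 Theorem 2.2.3 (Cramér) and §2.3 Definition 2.3.3; JansevanRensburg2000, §3.2 Theorems 3.17–3.19 (1st ed., pp. 50–52); BeatonBousquetMelouDeGierDuminilCopinGuttmann2014, §3.2 Proposition 6 (arXiv v5 p. 10)] -/
theorem tendsto_log_contacts_NW_div (hy : 0 < y) (hz : 0 < z) {Y Z : ℝ} (hyY : y ≤ Y) (hZ : 0 < Z) (hZz : Z ≤ z) :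
    Tendsto (fun N : ℕ => Real.log ((∑ q ∈ (stripPairs 1 N).filter
        (fun q => contactB Y Z * N ≤ (bottomVisits₀ q.1 q.2 N : ℝ) ∧ (topVisits₀ 1 q.1 q.2 N : ℝ) ≤ contactB Z Y * N),
        wgt y z N q) / stripZ₂ 1 N y z) / N) atTop (𝓝 (-jointRate y z Y Z)) := by
  have hY : 0 < Y := hy.trans_le hyY
  set a := contactB Y Z with ha
  set a' := contactB Z Y with ha'
  obtain ⟨t1, t2, t3⟩ := contactB_mem_triangle hY hZ
  refine tendsto_log_div_of_exp_bounds (fun ε hε => ?_) (fun ε hε => ?_)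
  · -- the lower bound: explicit tilt to the densities `(a+δ, a'−δ)`, `δ > 0`
    have hε2 : 0 < ε / 2 := by linarith
    obtain ⟨hcont, hval⟩ := continuousAt_boxCost hy hz hY hZ (-1) 2 (-2)
    have hlt := hval.trans_lt (show jointRate y z Y Z < jointRate y z Y Z + ε / 2 by linarith)
    have hev := hcont.eventually (gt_mem_nhds hlt)
    have hroom : 0 < (2 * a + 4 * a' - 1) / 4 := by linarith
    obtain ⟨δ, hδc, hδ0, hδ1⟩ := ((hev.filter_mono nhdsWithin_le_nhds).and (Ioo_mem_nhdsGT hroom)).exists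
    have s1 : (a + δ) + (a' + (-1) * δ) < 1 / 2 := by linarith
    have s2 : 1 < 4 * (a + δ) + 2 * (a' + (-1) * δ) := by linarith
    have s3 : 1 < 2 * (a + δ) + 4 * (a' + (-1) * δ) := by linarith
    obtain ⟨hY'0, hZ'0, hbY', hbZ', -, -⟩ := contactB_eosY s1 s2 s3
    set Y' := eosY (a + δ) (a' + (-1) * δ) with hY'
    set Z' := eosY (a' + (-1) * δ) (a + δ) with hZ'
    have hb1 : a < contactB Y' Z' := by rw [hbY']; linarith
    have hb2 : contactB Y' Z' < a + 2 * δ := by rw [hbY']; linarith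
    have hb1' : a' + (-2) * δ < contactB Z' Y' := by rw [hbZ']; linarith
    have hb2' : contactB Z' Y' < a' := by rw [hbZ']; linarith
    filter_upwards [exp_le_boxFraction hy hz hY'0 hZ'0 hb1 hb2 hb1' hb2' hε2] with N hN
    rw [max_comm ((a' + (-2) * δ) * _) (a' * _)] at hN
    refine le_trans ?_ (hN.trans ?_)
    · exact Real.exp_le_exp.2 (mul_le_mul_of_nonneg_right (by linarith) (Nat.cast_nonneg N))
    · refine div_le_div_of_nonneg_right ?_ (stripZ₂_pos 1 N hy hz).le
      refine Finset.sum_le_sum_of_subset_of_nonneg (fun q hq => ?_) fun q _ _ => wgt_nonneg hy.le hz.le N q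
      rw [Finset.mem_filter] at hq ⊢
      exact ⟨hq.1, hq.2.1.1, hq.2.2.2⟩
  · -- the upper bound: Chernoff with the tilts `Y/y ≥ 1`, `Z/z ≤ 1`
    have hu1 : 1 ≤ Y / y := (one_le_div hy).2 hyY
    have hu0' : 0 < Y / y := div_pos hY hy
    have hv0' : 0 < Z / z := div_pos hZ hz
    have hv1 : Z / z ≤ 1 := (div_le_one hz).2 hZz
    set u := Real.exp (a * Real.log (Y / y) + a' * Real.log (Z / z)) with hu
    have hu0 : 0 < u := Real.exp_pos _
    have hlogu : Real.log u = a * Real.log (Y / y) + a' * Real.log (Z / z) := Real.log_exp _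
    set S : ℕ → ℝ := fun N => ∑ q ∈ (stripPairs 1 N).filter
        (fun q => a * N ≤ (bottomVisits₀ q.1 q.2 N : ℝ) ∧ (topVisits₀ 1 q.1 q.2 N : ℝ) ≤ a' * N), wgt y z N q with hS
    have hSN : ∀ N : ℕ, S N * u ^ ((1 : ℝ) * N + 0) ≤ stripZ₂ 1 N Y Z := by
      intro N
      have h := sum_filter_mul_rpow_le hy.le hz.le hu0' hv0' N a a'
        (fun q => a * N ≤ (bottomVisits₀ q.1 q.2 N : ℝ) ∧ (topVisits₀ 1 q.1 q.2 N : ℝ) ≤ a' * N) (fun q hq => by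
          obtain ⟨-, h1, h2⟩ := Finset.mem_filter.1 hq
          exact ⟨Real.rpow_le_rpow_of_exponent_le hu1 h1, Real.rpow_le_rpow_of_exponent_ge hv0' hv1 h2⟩)
      rw [mul_div_cancel₀ _ hy.ne', mul_div_cancel₀ _ hz.ne'] at h
      have e : u ^ ((1 : ℝ) * N + 0) = (Y / y) ^ (a * N) * (Z / z) ^ (a' * N) := by
        rw [Real.rpow_def_of_pos hu0, Real.rpow_def_of_pos hu0', Real.rpow_def_of_pos hv0', ← Real.exp_add, hlogu]
        congr 1; ring
      rw [e]; exact h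
    have h := fraction_le_exp_of_chernoff₂ hy hz hY hZ hu0 1 0 S hSN hε
    filter_upwards [h] with N hN
    have e : -jointRate y z Y Z + ε = -((1 : ℝ) * Real.log u - Real.log (stripMuY₂ 1 Y Z / stripMuY₂ 1 y z)) + ε := by
      rw [hlogu]; unfold jointRate; ring
    rw [e]
    exact hN

open Classical in
/-- ★★★ **THE JOINT LARGE DEVIATION PRINCIPLE — SOUTH-EAST QUADRANT** (bottom wall under-adsorbed, top wall over-adsorbed): for
`0 < Y ≤ y` and `Z ≥ z`, `lim_{N→∞} (1/N) log P_{N,y,z}(bc ≤ b(Y,Z)·N and tc ≥ b(Z,Y)·N) = −J(y,z;Y,Z)`.  With the other three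
quadrants: the exponential cost of EVERY quadrant event at EVERY density pair of the open triangle is `J` at the explicit tilt.
[cite: DemboZeitouni2010, §2.2 Theorem 2.2.3 (Cramér) and §2.3 Definition 2.3.3; JansevanRensburg2000, §3.2 Theorems 3.17–3.19 (1st ed., pp. 50–52); BeatonBousquetMelouDeGierDuminilCopinGuttmann2014, §3.2 Proposition 6 (arXiv v5 p. 10)] -/
theorem tendsto_log_contacts_SE_div (hy : 0 < y) (hz : 0 < z) {Y Z : ℝ} (hY : 0 < Y) (hYy : Y ≤ y) (hzZ : z ≤ Z) :
    Tendsto (fun N : ℕ => Real.log ((∑ q ∈ (stripPairs 1 N).filter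
        (fun q => (bottomVisits₀ q.1 q.2 N : ℝ) ≤ contactB Y Z * N ∧ contactB Z Y * N ≤ (topVisits₀ 1 q.1 q.2 N : ℝ)),
        wgt y z N q) / stripZ₂ 1 N y z) / N) atTop (𝓝 (-jointRate y z Y Z)) := by
  have hZ : 0 < Z := hz.trans_le hzZ
  set a := contactB Y Z with ha
  set a' := contactB Z Y with ha'
  obtain ⟨t1, t2, t3⟩ := contactB_mem_triangle hY hZ
  refine tendsto_log_div_of_exp_bounds (fun ε hε => ?_) (fun ε hε => ?_)
  · -- the lower bound: explicit tilt to the densities `(a+δ, a'−δ)`, `δ < 0`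
    have hε2 : 0 < ε / 2 := by linarith
    obtain ⟨hcont, hval⟩ := continuousAt_boxCost hy hz hY hZ (-1) 2 (-2)
    have hlt := hval.trans_lt (show jointRate y z Y Z < jointRate y z Y Z + ε / 2 by linarith)
    have hev := hcont.eventually (gt_mem_nhds hlt)
    have hroom : -((4 * a + 2 * a' - 1) / 4) < 0 := by linarith
    obtain ⟨δ, hδc, hδ1, hδ0⟩ := ((hev.filter_mono nhdsWithin_le_nhds).and (Ioo_mem_nhdsLT hroom)).exists
    have s1 : (a + δ) + (a' + (-1) * δ) < 1 / 2 := by linarith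
    have s2 : 1 < 4 * (a + δ) + 2 * (a' + (-1) * δ) := by linarith
    have s3 : 1 < 2 * (a + δ) + 4 * (a' + (-1) * δ) := by linarith
    obtain ⟨hY'0, hZ'0, hbY', hbZ', -, -⟩ := contactB_eosY s1 s2 s3
    set Y' := eosY (a + δ) (a' + (-1) * δ) with hY'
    set Z' := eosY (a' + (-1) * δ) (a + δ) with hZ'
    have hb1 : a + 2 * δ < contactB Y' Z' := by rw [hbY']; linarith
    have hb2 : contactB Y' Z' < a := by rw [hbY']; linarith
    have hb1' : a' < contactB Z' Y' := by rw [hbZ']; linarith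
    have hb2' : contactB Z' Y' < a' + (-2) * δ := by rw [hbZ']; linarith
    filter_upwards [exp_le_boxFraction hy hz hY'0 hZ'0 hb1 hb2 hb1' hb2' hε2] with N hN
    rw [max_comm ((a + 2 * δ) * _) (a * _)] at hN
    refine le_trans ?_ (hN.trans ?_)
    · exact Real.exp_le_exp.2 (mul_le_mul_of_nonneg_right (by linarith) (Nat.cast_nonneg N))
    · refine div_le_div_of_nonneg_right ?_ (stripZ₂_pos 1 N hy hz).le
      refine Finset.sum_le_sum_of_subset_of_nonneg (fun q hq => ?_) fun q _ _ => wgt_nonneg hy.le hz.le N q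
      rw [Finset.mem_filter] at hq ⊢
      exact ⟨hq.1, hq.2.1.2, hq.2.2.1⟩
  · -- the upper bound: Chernoff with the tilts `Y/y ≤ 1`, `Z/z ≥ 1`
    have hu0' : 0 < Y / y := div_pos hY hy
    have hu1 : Y / y ≤ 1 := (div_le_one hy).2 hYy
    have hv0' : 0 < Z / z := div_pos hZ hz
    have hv1 : 1 ≤ Z / z := (one_le_div hz).2 hzZ
    set u := Real.exp (a * Real.log (Y / y) + a' * Real.log (Z / z)) with hu
    have hu0 : 0 < u := Real.exp_pos _
    have hlogu : Real.log u = a * Real.log (Y / y) + a' * Real.log (Z / z) := Real.log_exp _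
    set S : ℕ → ℝ := fun N => ∑ q ∈ (stripPairs 1 N).filter
        (fun q => (bottomVisits₀ q.1 q.2 N : ℝ) ≤ a * N ∧ a' * N ≤ (topVisits₀ 1 q.1 q.2 N : ℝ)), wgt y z N q with hS
    have hSN : ∀ N : ℕ, S N * u ^ ((1 : ℝ) * N + 0) ≤ stripZ₂ 1 N Y Z := by
      intro N
      have h := sum_filter_mul_rpow_le hy.le hz.le hu0' hv0' N a a'
        (fun q => (bottomVisits₀ q.1 q.2 N : ℝ) ≤ a * N ∧ a' * N ≤ (topVisits₀ 1 q.1 q.2 N : ℝ)) (fun q hq => by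
          obtain ⟨-, h1, h2⟩ := Finset.mem_filter.1 hq
          exact ⟨Real.rpow_le_rpow_of_exponent_ge hu0' hu1 h1, Real.rpow_le_rpow_of_exponent_le hv1 h2⟩)
      rw [mul_div_cancel₀ _ hy.ne', mul_div_cancel₀ _ hz.ne'] at h
      have e : u ^ ((1 : ℝ) * N + 0) = (Y / y) ^ (a * N) * (Z / z) ^ (a' * N) := by
        rw [Real.rpow_def_of_pos hu0, Real.rpow_def_of_pos hu0', Real.rpow_def_of_pos hv0', ← Real.exp_add, hlogu]
        congr 1; ring
      rw [e]; exact h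
    have h := fraction_le_exp_of_chernoff₂ hy hz hY hZ hu0 1 0 S hSN hε
    filter_upwards [h] with N hN
    have e : -jointRate y z Y Z + ε = -((1 : ℝ) * Real.log u - Real.log (stripMuY₂ 1 Y Z / stripMuY₂ 1 y z)) + ε := by
      rw [hlogu]; unfold jointRate; ring
    rw [e]
    exact hN

open Classical in
/-- ★★★ **THE JOINT LDP IN DENSITY COORDINATES (north-east quadrant)**: for every density pair `(a,a')` of the open triangle whose
explicit tilt lies north-east of `(y,z)` (`Y(a,a') ≥ y`, `Y(a',a) ≥ z`),
`lim_{N→∞} (1/N) log P_{N,y,z}(bc ≥ aN and tc ≥ a'N) = −[a·log(Y(a,a')/y) + a'·log(Y(a',a)/z) − ½ log((4a+2a'−1)(2a+4a'−1)/(1−2a−2a')²) + log μ_1(y,z)]`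
— the rate is an ELEMENTARY CLOSED FORM in `(a, a', y, z, μ_1(y,z))` (the other quadrants read the same with the inequalities turned).
[cite: DemboZeitouni2010, §2.2 Theorem 2.2.3 (Cramér) and §2.3 Definition 2.3.3; BeatonBousquetMelouDeGierDuminilCopinGuttmann2014, §3.2 Proposition 6 (arXiv v5 p. 10)] -/
theorem tendsto_log_contacts_NE_div_density (hy : 0 < y) (hz : 0 < z) {a a' : ℝ} (h1 : a + a' < 1 / 2)
    (h2 : 1 < 4 * a + 2 * a') (h3 : 1 < 2 * a + 4 * a') (hyY : y ≤ eosY a a') (hzZ : z ≤ eosY a' a) :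
    Tendsto (fun N : ℕ => Real.log ((∑ q ∈ (stripPairs 1 N).filter
        (fun q => a * N ≤ (bottomVisits₀ q.1 q.2 N : ℝ) ∧ a' * N ≤ (topVisits₀ 1 q.1 q.2 N : ℝ)),
        wgt y z N q) / stripZ₂ 1 N y z) / N) atTop
      (𝓝 (-(a * Real.log (eosY a a' / y) + a' * Real.log (eosY a' a / z) -
        (Real.log ((4 * a + 2 * a' - 1) * (2 * a + 4 * a' - 1) / (1 - 2 * a - 2 * a') ^ 2) / 2 -
          Real.log (stripMuY₂ 1 y z))))) := by
  have h := tendsto_log_contacts_NE_div hy hz hyY hzZ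
  obtain ⟨-, -, hb, hb', -, -⟩ := contactB_eosY h1 h2 h3
  rw [hb, hb', jointRate_eosY hy hz h1 h2 h3] at h
  exact h

/-! ## §5 (ed.2) The joint rate is a rate: `J ≥ 0` in every quadrant, `J > 0` off the base point in the anti-aligned quadrants -/

/-- Symmetry of the joint rate under the exchange of the walls: `J(z,y;Z,Y) = J(y,z;Y,Z)` (`μ_1(z,y) = μ_1(y,z)`).
[cite: BeatonBousquetMelouDeGierDuminilCopinGuttmann2014, §3.2 Proposition 6 (arXiv v5 p. 10: μ_T(y,z) = μ_T(z,y))] -/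
theorem jointRate_swap (y z Y Z : ℝ) : jointRate z y Z Y = jointRate y z Y Z := by
  unfold jointRate
  rw [stripMuY₂_symm 1 Z Y, stripMuY₂_symm 1 z y]; ring

/-- ★★ **THE TWO-VARIABLE TANGENT INEQUALITY in the anti-aligned quadrants**: for `y ≤ Y` and `Z ≤ z` (all positive),
`b(Y,Z)·(log y − log Y) + b(Z,Y)·(log z − log Z) ≤ log μ_1(y,z) − log μ_1(Y,Z)`, STRICTLY unless `(y,z) = (Y,Z)` — the graph of the convex
free energy `(A,B) ↦ log μ_1(e^A,e^B)` lies above its supporting plane at `(log Y, log Z)` towards the north-west and the south-east.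
Two-step path `(Y,Z) → (y,Z) → (y,z)`: the one-variable tangent inequalities of the parent (`mul_log_sub_le_log_stripMuY₂_sub`, in `y` at
`(Y,Z)` and, by the symmetry `μ_1(y,·) = μ_1(·,y)`, in `z` at `(y,Z)`) and the monotonicity `b(Z,y) ≥ b(Z,Y)` for `y ≤ Y`
(`contactB_swap_strictAnti`), whose sign matches `log z − log Z ≥ 0`.  (In the ALIGNED quadrants the signs do not match; there the
inequality is the strict joint convexity, not claimed.) [cite: DemboZeitouni2010, §2.3 Definition 2.3.3 (exposed points, exposing hyperplane); BeatonBousquetMelouDeGierDuminilCopinGuttmann2014, §3.2 Proposition 6 (arXiv v5 p. 10); MadrasSlade1993, §1.2] -/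
theorem tangent₂_le_of_le_of_ge (hy : 0 < y) (hz : 0 < z) {Y Z : ℝ} (hZ : 0 < Z) (hyY : y ≤ Y) (hZz : Z ≤ z) :
    contactB Y Z * (Real.log y - Real.log Y) + contactB Z Y * (Real.log z - Real.log Z) ≤
        Real.log (stripMuY₂ 1 y z) - Real.log (stripMuY₂ 1 Y Z) ∧
      ((y ≠ Y ∨ z ≠ Z) → contactB Y Z * (Real.log y - Real.log Y) + contactB Z Y * (Real.log z - Real.log Z) <
        Real.log (stripMuY₂ 1 y z) - Real.log (stripMuY₂ 1 Y Z)) := by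
  have hY : 0 < Y := hy.trans_le hyY
  -- step 1: variable `y` at `(Y,Z)`
  have h1 : contactB Y Z * (Real.log y - Real.log Y) ≤ Real.log (stripMuY₂ 1 y Z) - Real.log (stripMuY₂ 1 Y Z) :=
    mul_log_sub_le_log_stripMuY₂_sub hZ hy hY
  -- step 2: variable `z` at `(y,Z)`, through the symmetry
  have h2 : contactB Z y * (Real.log z - Real.log Z) ≤ Real.log (stripMuY₂ 1 y z) - Real.log (stripMuY₂ 1 y Z) := by
    have h := mul_log_sub_le_log_stripMuY₂_sub hy hz hZ
    rwa [stripMuY₂_symm 1 z y, stripMuY₂_symm 1 Z y] at h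
  -- monotonicity: `b(Z,Y) ≤ b(Z,y)` for `y ≤ Y`, and `log z − log Z ≥ 0`
  have hmono : contactB Z Y ≤ contactB Z y := by
    rcases hyY.lt_or_eq with hlt | heq
    · exact (contactB_swap_strictAnti hy hZ hlt).le
    · rw [heq]
  have hlog : 0 ≤ Real.log z - Real.log Z := by linarith [Real.log_le_log hZ hZz]
  have h3 : contactB Z Y * (Real.log z - Real.log Z) ≤ contactB Z y * (Real.log z - Real.log Z) :=
    mul_le_mul_of_nonneg_right hmono hlog
  refine ⟨by linarith, fun hne => ?_⟩
  rcases hne with hne | hne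
  · have h1' : contactB Y Z * (Real.log y - Real.log Y) < Real.log (stripMuY₂ 1 y Z) - Real.log (stripMuY₂ 1 Y Z) :=
      mul_log_sub_lt_log_stripMuY₂_sub hZ hy hY hne
    linarith
  · by_cases hyY' : y = Y
    · -- then the second step is strict
      have h2' : contactB Z y * (Real.log z - Real.log Z) < Real.log (stripMuY₂ 1 y z) - Real.log (stripMuY₂ 1 y Z) := by
        have h := mul_log_sub_lt_log_stripMuY₂_sub hy hz hZ hne
        rwa [stripMuY₂_symm 1 z y, stripMuY₂_symm 1 Z y] at h
      rw [← hyY'] at h1 h3 ⊢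
      have h3' : contactB Z y * (Real.log z - Real.log Z) ≤ contactB Z y * (Real.log z - Real.log Z) := le_rfl
      linarith
    · have h1' : contactB Y Z * (Real.log y - Real.log Y) < Real.log (stripMuY₂ 1 y Z) - Real.log (stripMuY₂ 1 Y Z) :=
        mul_log_sub_lt_log_stripMuY₂_sub hZ hy hY hyY'
      linarith

/-- ★★ **`J > 0` OFF THE BASE POINT IN THE NORTH-WEST QUADRANT** (`Y ≥ y`, `Z ≤ z`, `(Y,Z) ≠ (y,z)`), and `J ≥ 0` there.
[cite: DemboZeitouni2010, §2.2 Theorem 2.2.3 and §2.3 Definition 2.3.3; BeatonBousquetMelouDeGierDuminilCopinGuttmann2014, §3.2 Proposition 6 (arXiv v5 p. 10)] -/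
theorem jointRate_pos_NW (hy : 0 < y) (hz : 0 < z) {Y Z : ℝ} (hZ : 0 < Z) (hyY : y ≤ Y) (hZz : Z ≤ z) :
    0 ≤ jointRate y z Y Z ∧ ((y ≠ Y ∨ z ≠ Z) → 0 < jointRate y z Y Z) := by
  have hY : 0 < Y := hy.trans_le hyY
  obtain ⟨hle, hlt⟩ := tangent₂_le_of_le_of_ge hy hz hZ hyY hZz
  have hJ : jointRate y z Y Z = (Real.log (stripMuY₂ 1 y z) - Real.log (stripMuY₂ 1 Y Z)) -
      (contactB Y Z * (Real.log y - Real.log Y) + contactB Z Y * (Real.log z - Real.log Z)) := by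
    unfold jointRate
    rw [Real.log_div hY.ne' hy.ne', Real.log_div hZ.ne' hz.ne',
      Real.log_div (stripMuY₂_pos 1 hY hZ).ne' (stripMuY₂_pos 1 hy hz).ne']
    ring
  refine ⟨by rw [hJ]; linarith, fun hne => ?_⟩
  have := hlt hne
  rw [hJ]; linarith

/-- ★★ **`J > 0` OFF THE BASE POINT IN THE SOUTH-EAST QUADRANT** (`Y ≤ y`, `Z ≥ z`), by the wall symmetry `J(z,y;Z,Y) = J(y,z;Y,Z)`.
[cite: DemboZeitouni2010, §2.2 Theorem 2.2.3 and §2.3 Definition 2.3.3; BeatonBousquetMelouDeGierDuminilCopinGuttmann2014, §3.2 Proposition 6 (arXiv v5 p. 10)] -/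
theorem jointRate_pos_SE (hy : 0 < y) (hz : 0 < z) {Y Z : ℝ} (hY : 0 < Y) (hYy : Y ≤ y) (hzZ : z ≤ Z) :
    0 ≤ jointRate y z Y Z ∧ ((y ≠ Y ∨ z ≠ Z) → 0 < jointRate y z Y Z) := by
  obtain ⟨hle, hlt⟩ := jointRate_pos_NW hz hy hY hzZ hYy
  rw [jointRate_swap] at hle hlt
  exact ⟨hle, fun hne => hlt (hne.symm)⟩

/-- ★★ **`J ≥ 0` IN THE SOUTH-WEST QUADRANT** — by probability, as in the north-east: the limit of `(1/N) log P ≤ 0`.  With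
`jointRate_nonneg`, `jointRate_pos_NW`, `jointRate_pos_SE`: `J(y,z;·,·) ≥ 0` on the whole open quadrant `(0,∞)²`.
[cite: DemboZeitouni2010, §2.2 Theorem 2.2.3; BeatonBousquetMelouDeGierDuminilCopinGuttmann2014, §3.2 Proposition 6 (arXiv v5 p. 10)] -/
theorem jointRate_nonneg_SW (hy : 0 < y) (hz : 0 < z) {Y Z : ℝ} (hY : 0 < Y) (hYy : Y ≤ y) (hZ : 0 < Z) (hZz : Z ≤ z) :
    0 ≤ jointRate y z Y Z := by
  classical
  have h := tendsto_log_contacts_SW_div hy hz hY hYy hZ hZz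
  have hle : ∀ᶠ N : ℕ in atTop, Real.log ((∑ q ∈ (stripPairs 1 N).filter
        (fun q => (bottomVisits₀ q.1 q.2 N : ℝ) ≤ contactB Y Z * N ∧ (topVisits₀ 1 q.1 q.2 N : ℝ) ≤ contactB Z Y * N),
        wgt y z N q) / stripZ₂ 1 N y z) / N ≤ 0 := by
    refine Eventually.of_forall fun N => ?_
    apply div_nonpos_of_nonpos_of_nonneg _ (Nat.cast_nonneg N)
    apply Real.log_nonpos (div_nonneg (Finset.sum_nonneg fun q _ => wgt_nonneg hy.le hz.le N q) (stripZ₂_pos 1 N hy hz).le)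
    rw [div_le_one (stripZ₂_pos 1 N hy hz), stripZ₂_one_eq_sum_wgt]
    exact Finset.sum_le_sum_of_subset_of_nonneg (Finset.filter_subset _ _) fun q _ _ => wgt_nonneg hy.le hz.le N q
  have := le_of_tendsto h hle
  linarith

/-- ★★ **THE JOINT RATE IS NON-NEGATIVE EVERYWHERE**: `J(y,z;Y,Z) ≥ 0` for all positive `y, z, Y, Z`; it vanishes at `(Y,Z) = (y,z)` and is
POSITIVE off that point in the two anti-aligned quadrants. [cite: DemboZeitouni2010, §2.2 Theorem 2.2.3; BeatonBousquetMelouDeGierDuminilCopinGuttmann2014, §3.2 Proposition 6 (arXiv v5 p. 10)] -/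
theorem jointRate_nonneg_all (hy : 0 < y) (hz : 0 < z) {Y Z : ℝ} (hY : 0 < Y) (hZ : 0 < Z) : 0 ≤ jointRate y z Y Z := by
  rcases le_total y Y with hyY | hYy
  · rcases le_total z Z with hzZ | hZz
    · exact jointRate_nonneg hy hz hyY hzZ
    · exact (jointRate_pos_NW hy hz hZ hyY hZz).1
  · rcases le_total z Z with hzZ | hZz
    · exact (jointRate_pos_SE hy hz hY hYy hzZ).1
    · exact jointRate_nonneg_SW hy hz hY hYy hZ hZz

/-! ## §6 (ed.3) The supporting plane of the free energy in EVERY direction and the Legendre characterisation of `J` -/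

/-- The little-o form of the one-variable derivative of the free energy: for `c > 0`, eventually in `h → 0`,
`|log μ_1(e^{A+h}, Z) − log μ_1(e^A, Z) − h·b(e^A,Z)| ≤ c|h|` (tree: `hasDerivAt_log_stripMuY₂_exp`), and the same in the second variable
through `μ_1(y,·) = μ_1(·,y)`. [cite: BeatonBousquetMelouDeGierDuminilCopinGuttmann2014, §3.2 Proposition 6 (arXiv v5 p. 10) (lane plumbing)] -/
theorem eventually_abs_log_stripMuY₂_sub_tangent_le (A : ℝ) {Z : ℝ} (hZ : 0 < Z) {c : ℝ} (hc : 0 < c) :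
    (∀ᶠ h in 𝓝 (0 : ℝ), |Real.log (stripMuY₂ 1 (Real.exp (A + h)) Z) - Real.log (stripMuY₂ 1 (Real.exp A) Z) -
      h * contactB (Real.exp A) Z| ≤ c * |h|) ∧
    (∀ᶠ h in 𝓝 (0 : ℝ), |Real.log (stripMuY₂ 1 Z (Real.exp (A + h))) - Real.log (stripMuY₂ 1 Z (Real.exp A)) -
      h * contactB (Real.exp A) Z| ≤ c * |h|) := by
  have hd := hasDerivAt_log_stripMuY₂_exp hZ A
  rw [hasDerivAt_iff_isLittleO_nhds_zero] at hd
  have h1 := Asymptotics.isLittleO_iff.1 hd hc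
  refine ⟨?_, ?_⟩
  · filter_upwards [h1] with h hh
    simpa only [Real.norm_eq_abs, smul_eq_mul] using hh
  · filter_upwards [h1] with h hh
    rw [stripMuY₂_symm 1 Z (Real.exp (A + h)), stripMuY₂_symm 1 Z (Real.exp A)]
    simpa only [Real.norm_eq_abs, smul_eq_mul] using hh

/-- ★★★ **THE SUPPORTING PLANE OF THE TWO-WALL FREE ENERGY, IN EVERY DIRECTION**: for ALL positive `y, z, Y, Z`,
`b(Y,Z)·(log y − log Y) + b(Z,Y)·(log z − log Z) ≤ log μ_1(y,z) − log μ_1(Y,Z)` — the graph of the jointly convex free energy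
`(A,B) ↦ log μ_1(e^A,e^B)` (tree: `convexOn_log_stripMuY₂_exp`) lies above the plane through `(log Y, log Z)` with slopes the two contact
densities.  This extends `tangent₂_le_of_le_of_ge` to the ALIGNED quadrants; the proof is «convexity + the two partial derivatives ⇒ the
partial gradient is a subgradient»: by convexity `G(Q) − G(P) ≥ (G(P+tv) − G(P))/t ≥ −(G(P−tv) − G(P))/t ≥ −[G(P−2tv₁e₁) + G(P−2tv₂e₂) − 2G(P)]/(2t)`,
and the last bracket is `−2t·(p·v) + o(t)` by the one-variable derivatives.  (Strict inequality off the point in the aligned quadrants =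
strict joint convexity, NOT claimed.) [cite: DemboZeitouni2010, §2.3 Definition 2.3.3 (exposing hyperplane); BeatonBousquetMelouDeGierDuminilCopinGuttmann2014, §3.2 Proposition 6 (arXiv v5 p. 10); HammersleyTorrieWhittington1982, §2 (2.12) (log-convexity)] -/
theorem tangent₂_le (hy : 0 < y) (hz : 0 < z) {Y Z : ℝ} (hY : 0 < Y) (hZ : 0 < Z) :
    contactB Y Z * (Real.log y - Real.log Y) + contactB Z Y * (Real.log z - Real.log Z) ≤
      Real.log (stripMuY₂ 1 y z) - Real.log (stripMuY₂ 1 Y Z) := by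
  -- notation
  set G : ℝ → ℝ → ℝ := fun A B => Real.log (stripMuY₂ 1 (Real.exp A) (Real.exp B)) with hG
  set A₀ := Real.log Y with hA₀
  set B₀ := Real.log Z with hB₀
  set v₁ := Real.log y - Real.log Y with hv₁
  set v₂ := Real.log z - Real.log Z with hv₂
  set p₁ := contactB Y Z with hp₁
  set p₂ := contactB Z Y with hp₂
  have heY : Real.exp A₀ = Y := by rw [hA₀, Real.exp_log hY]
  have heZ : Real.exp B₀ = Z := by rw [hB₀, Real.exp_log hZ]
  have hGP : G A₀ B₀ = Real.log (stripMuY₂ 1 Y Z) := by simp only [hG, heY, heZ]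
  have hGQ : G (A₀ + v₁) (B₀ + v₂) = Real.log (stripMuY₂ 1 y z) := by
    simp only [hG, hA₀, hB₀, hv₁, hv₂, add_sub_cancel, Real.exp_log hy, Real.exp_log hz]
  -- convexity, in the form we use
  have hconv := convexOn_log_stripMuY₂_exp 1
  have hc : ∀ (P₁ P₂ Q₁ Q₂ a b : ℝ), 0 ≤ a → 0 ≤ b → a + b = 1 →
      G (a * P₁ + b * Q₁) (a * P₂ + b * Q₂) ≤ a * G P₁ P₂ + b * G Q₁ Q₂ := by
    intro P₁ P₂ Q₁ Q₂ a b ha hb hab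
    have h := hconv.2 (Set.mem_univ (P₁, P₂)) (Set.mem_univ (Q₁, Q₂)) ha hb hab
    simpa only [hG, Prod.smul_mk, Prod.mk_add_mk, smul_eq_mul] using h
  -- the main estimate: for every `c > 0`, `G(Q) − G(P) ≥ p·v − c(|v₁| + |v₂|)`
  have hmain : ∀ c : ℝ, 0 < c → p₁ * v₁ + p₂ * v₂ - c * (|v₁| + |v₂|) ≤ G (A₀ + v₁) (B₀ + v₂) - G A₀ B₀ := by
    intro c hc0
    obtain ⟨e1, -⟩ := eventually_abs_log_stripMuY₂_sub_tangent_le A₀ hZ hc0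
    obtain ⟨-, e2⟩ := eventually_abs_log_stripMuY₂_sub_tangent_le B₀ hY hc0
    -- pull the two little-o bounds back along `t ↦ −2 t vᵢ`
    have hct1 : Continuous (fun t : ℝ => -2 * t * v₁) := by fun_prop
    have hct2 : Continuous (fun t : ℝ => -2 * t * v₂) := by fun_prop
    have ht1 : Tendsto (fun t : ℝ => -2 * t * v₁) (𝓝 0) (𝓝 0) := hct1.tendsto' 0 0 (by ring)
    have ht2 : Tendsto (fun t : ℝ => -2 * t * v₂) (𝓝 0) (𝓝 0) := hct2.tendsto' 0 0 (by ring)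
    have hev := ((ht1.eventually e1).filter_mono nhdsWithin_le_nhds).and
      (((ht2.eventually e2).filter_mono nhdsWithin_le_nhds).and (Ioo_mem_nhdsGT (one_pos (α := ℝ))))
    obtain ⟨t, h1, h2, ht0, ht1'⟩ := hev.exists
    -- the three convexity steps
    have cvx1 : G (A₀ + t * v₁) (B₀ + t * v₂) ≤ (1 - t) * G A₀ B₀ + t * G (A₀ + v₁) (B₀ + v₂) := by
      have h := hc A₀ B₀ (A₀ + v₁) (B₀ + v₂) (1 - t) t (by linarith) ht0.le (by ring)
      have e1' : (1 - t) * A₀ + t * (A₀ + v₁) = A₀ + t * v₁ := by ring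
      have e2' : (1 - t) * B₀ + t * (B₀ + v₂) = B₀ + t * v₂ := by ring
      rw [e1', e2'] at h; exact h
    have cvx2 : G A₀ B₀ ≤ 1 / 2 * G (A₀ + t * v₁) (B₀ + t * v₂) + 1 / 2 * G (A₀ - t * v₁) (B₀ - t * v₂) := by
      have h := hc (A₀ + t * v₁) (B₀ + t * v₂) (A₀ - t * v₁) (B₀ - t * v₂) (1 / 2) (1 / 2)
        (by norm_num) (by norm_num) (by norm_num)
      have e1' : 1 / 2 * (A₀ + t * v₁) + 1 / 2 * (A₀ - t * v₁) = A₀ := by ring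
      have e2' : 1 / 2 * (B₀ + t * v₂) + 1 / 2 * (B₀ - t * v₂) = B₀ := by ring
      rw [e1', e2'] at h; exact h
    have cvx3 : G (A₀ - t * v₁) (B₀ - t * v₂) ≤ 1 / 2 * G (A₀ + -2 * t * v₁) B₀ + 1 / 2 * G A₀ (B₀ + -2 * t * v₂) := by
      have h := hc (A₀ + -2 * t * v₁) B₀ A₀ (B₀ + -2 * t * v₂) (1 / 2) (1 / 2) (by norm_num) (by norm_num) (by norm_num)
      have e1' : 1 / 2 * (A₀ + -2 * t * v₁) + 1 / 2 * A₀ = A₀ - t * v₁ := by ring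
      have e2' : 1 / 2 * B₀ + 1 / 2 * (B₀ + -2 * t * v₂) = B₀ - t * v₂ := by ring
      rw [e1', e2'] at h; exact h
    -- the little-o bounds as two-sided inequalities
    have b1 : Real.log (stripMuY₂ 1 (Real.exp (A₀ + -2 * t * v₁)) Z) - Real.log (stripMuY₂ 1 (Real.exp A₀) Z) -
        -2 * t * v₁ * contactB (Real.exp A₀) Z ≤ c * (2 * t * |v₁|) := by
      have := (abs_le.1 h1).2
      have e : |-2 * t * v₁| = 2 * t * |v₁| := by
        rw [abs_mul, abs_mul, abs_neg, abs_two, abs_of_pos ht0]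
      rw [e] at this; exact this
    have b2 : Real.log (stripMuY₂ 1 Y (Real.exp (B₀ + -2 * t * v₂))) - Real.log (stripMuY₂ 1 Y (Real.exp B₀)) -
        -2 * t * v₂ * contactB (Real.exp B₀) Y ≤ c * (2 * t * |v₂|) := by
      have := (abs_le.1 h2).2
      have e : |-2 * t * v₂| = 2 * t * |v₂| := by
        rw [abs_mul, abs_mul, abs_neg, abs_two, abs_of_pos ht0]
      rw [e] at this; exact this
    -- identify the `G` values in `b1`, `b2`
    have hGa : G (A₀ + -2 * t * v₁) B₀ = Real.log (stripMuY₂ 1 (Real.exp (A₀ + -2 * t * v₁)) Z) := by simp only [hG, heZ]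
    have hGb : G A₀ (B₀ + -2 * t * v₂) = Real.log (stripMuY₂ 1 Y (Real.exp (B₀ + -2 * t * v₂))) := by simp only [hG, heY]
    have hGP' : G A₀ B₀ = Real.log (stripMuY₂ 1 (Real.exp A₀) Z) := by simp only [hG, heZ]
    have hGP'' : G A₀ B₀ = Real.log (stripMuY₂ 1 Y (Real.exp B₀)) := by simp only [hG, heY]
    rw [heY] at b1
    rw [heZ] at b2
    rw [← hGa, ← hGP, ← hp₁] at b1
    rw [← hGb, ← hGP, ← hp₂] at b2
    -- assemble: `t (G Q − G P) ≥ t p·v − c t (|v₁| + |v₂|)`, divide by `t > 0`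
    have key : t * (p₁ * v₁ + p₂ * v₂ - c * (|v₁| + |v₂|)) ≤ t * (G (A₀ + v₁) (B₀ + v₂) - G A₀ B₀) := by
      linarith [cvx1, cvx2, cvx3, b1, b2]
    exact le_of_mul_le_mul_left key ht0
  -- let `c → 0`
  rw [← hGQ, ← hGP]
  apply le_of_forall_pos_lt_add
  intro ε hε
  have hK : 0 < |v₁| + |v₂| + 1 := by positivity
  have h := hmain (ε / (2 * (|v₁| + |v₂| + 1))) (by positivity)
  have hle : ε / (2 * (|v₁| + |v₂| + 1)) * (|v₁| + |v₂|) ≤ ε / 2 := by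
    rw [div_mul_eq_mul_div, div_le_iff₀ (by positivity)]
    nlinarith [abs_nonneg v₁, abs_nonneg v₂]
  linarith

/-- ★★ **Multiplicative form**: `μ_1(y,z) ≥ μ_1(Y,Z) · (y/Y)^{b(Y,Z)} · (z/Z)^{b(Z,Y)}` for all positive `y, z, Y, Z` — the growth rate dominates its
log-linear extrapolation from any base point, with the two contact densities as exponents.
[cite: BeatonBousquetMelouDeGierDuminilCopinGuttmann2014, §3.2 Proposition 6 (arXiv v5 p. 10); HammersleyTorrieWhittington1982, §2 (2.12)] -/
theorem stripMuY₂_one_ge_tangent (hy : 0 < y) (hz : 0 < z) {Y Z : ℝ} (hY : 0 < Y) (hZ : 0 < Z) :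
    stripMuY₂ 1 Y Z * (y / Y) ^ contactB Y Z * (z / Z) ^ contactB Z Y ≤ stripMuY₂ 1 y z := by
  have h := tangent₂_le hy hz hY hZ
  have hμ := stripMuY₂_pos 1 hy hz
  have hμ' := stripMuY₂_pos 1 hY hZ
  rw [← Real.log_le_log_iff (by positivity) hμ, Real.log_mul (by positivity) (by positivity), Real.log_mul hμ'.ne' (by positivity),
    Real.log_rpow (div_pos hy hY), Real.log_rpow (div_pos hz hZ), Real.log_div hy.ne' hY.ne', Real.log_div hz.ne' hZ.ne']
  linarith

/-- ★★★ **THE LEGENDRE CHARACTERISATION OF THE JOINT RATE**: for every base `(y,z)`, every tilt `(Y,Z)` and ALL `u, v > 0`,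
`b(Y,Z)·log u + b(Z,Y)·log v − log(μ_1(yu,zv)/μ_1(y,z)) ≤ J(y,z;Y,Z)`, with equality at `(u,v) = (Y/y, Z/z)`:
`J(y,z;Y,Z) = max_{u,v>0} {a log u + a' log v − [log μ_1(yu,zv) − log μ_1(y,z)]}` at the density pair `(a,a') = (b(Y,Z), b(Z,Y))` — the joint
rate is the Legendre–Fenchel transform of the two-variable free-energy increment, attained at the explicit tilt.
[cite: DemboZeitouni2010, §2.2 Theorem 2.2.3 (rate function = Fenchel–Legendre transform, Def. 2.2.2) and §2.3 Definition 2.3.3; JansevanRensburg2000, §3.2 Theorem 3.19 (1st ed., p. 52)] -/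
theorem isGreatest_jointRate (hy : 0 < y) (hz : 0 < z) {Y Z : ℝ} (hY : 0 < Y) (hZ : 0 < Z) :
    IsGreatest {r : ℝ | ∃ u v : ℝ, 0 < u ∧ 0 < v ∧
      r = contactB Y Z * Real.log u + contactB Z Y * Real.log v - Real.log (stripMuY₂ 1 (y * u) (z * v) / stripMuY₂ 1 y z)}
      (jointRate y z Y Z) := by
  constructor
  · refine ⟨Y / y, Z / z, div_pos hY hy, div_pos hZ hz, ?_⟩
    unfold jointRate
    rw [mul_div_cancel₀ _ hy.ne', mul_div_cancel₀ _ hz.ne']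
  · rintro r ⟨u, v, hu, hv, rfl⟩
    have hyu : 0 < y * u := mul_pos hy hu
    have hzv : 0 < z * v := mul_pos hz hv
    have h := tangent₂_le hyu hzv hY hZ
    unfold jointRate
    rw [Real.log_div (stripMuY₂_pos 1 hyu hzv).ne' (stripMuY₂_pos 1 hy hz).ne',
      Real.log_div (stripMuY₂_pos 1 hY hZ).ne' (stripMuY₂_pos 1 hy hz).ne', Real.log_div hY.ne' hy.ne',
      Real.log_div hZ.ne' hz.ne']
    rw [Real.log_mul hy.ne' hu.ne', Real.log_mul hz.ne' hv.ne'] at h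
    nlinarith [h, (contactB_facts hY hZ).2.2.2.2.1, (contactB_facts hZ hY).2.2.2.2.1]


/-- ★★ **THE FREE ENERGY IS DIFFERENTIABLE IN EVERY DIRECTION, WITH GRADIENT `(b, b_top)`**: for `Y, Z > 0` and any direction `(v₁, v₂)`,
`t ↦ log μ_1(Y e^{t v₁}, Z e^{t v₂})` has derivative `v₁·b(Y,Z) + v₂·b(Z,Y)` at `t = 0` (squeeze between the supporting planes at the two
endpoints, `tangent₂_le`, and the joint continuity of `b`, `continuousAt_contactB₂`) — the convex free energy `(A,B) ↦ log μ_1(e^A,e^B)` is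
Gâteaux-differentiable with the two contact densities as its gradient. [cite: BeatonBousquetMelouDeGierDuminilCopinGuttmann2014, §3.2 Proposition 6 (arXiv v5 p. 10); MadrasSlade1993, §1.2; DemboZeitouni2010, §2.3 (differentiability hypothesis of Gärtner–Ellis, Definition 2.3.5)] -/
theorem hasDerivAt_log_stripMuY₂_dir {Y Z : ℝ} (hY : 0 < Y) (hZ : 0 < Z) (v₁ v₂ : ℝ) :
    HasDerivAt (fun t : ℝ => Real.log (stripMuY₂ 1 (Y * Real.exp (t * v₁)) (Z * Real.exp (t * v₂))))
      (v₁ * contactB Y Z + v₂ * contactB Z Y) 0 := by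
  rw [hasDerivAt_iff_tendsto_slope_zero]
  set D := v₁ * contactB Y Z + v₂ * contactB Z Y with hD
  have hpt : ∀ t : ℝ, 0 < Y * Real.exp (t * v₁) ∧ 0 < Z * Real.exp (t * v₂) := fun t =>
    ⟨mul_pos hY (Real.exp_pos _), mul_pos hZ (Real.exp_pos _)⟩
  have hf0 : Real.log (stripMuY₂ 1 (Y * Real.exp (0 * v₁)) (Z * Real.exp (0 * v₂))) = Real.log (stripMuY₂ 1 Y Z) := by simp
  -- two-sided bounds from the two supporting planes
  have hlow : ∀ t : ℝ, t * D ≤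
      Real.log (stripMuY₂ 1 (Y * Real.exp (t * v₁)) (Z * Real.exp (t * v₂))) - Real.log (stripMuY₂ 1 Y Z) := by
    intro t
    have h := tangent₂_le (hpt t).1 (hpt t).2 hY hZ
    rw [Real.log_mul hY.ne' (Real.exp_pos _).ne', Real.log_mul hZ.ne' (Real.exp_pos _).ne', Real.log_exp, Real.log_exp] at h
    rw [hD]; linarith
  have hup : ∀ t : ℝ, Real.log (stripMuY₂ 1 (Y * Real.exp (t * v₁)) (Z * Real.exp (t * v₂))) - Real.log (stripMuY₂ 1 Y Z) ≤
      t * (v₁ * contactB (Y * Real.exp (t * v₁)) (Z * Real.exp (t * v₂)) +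
        v₂ * contactB (Z * Real.exp (t * v₂)) (Y * Real.exp (t * v₁))) := by
    intro t
    have h := tangent₂_le hY hZ (hpt t).1 (hpt t).2
    rw [Real.log_mul hY.ne' (Real.exp_pos _).ne', Real.log_mul hZ.ne' (Real.exp_pos _).ne', Real.log_exp, Real.log_exp] at h
    linarith
  -- the densities along the path are continuous at `t = 0`
  have hpath : ContinuousAt (fun t : ℝ => (Y * Real.exp (t * v₁), Z * Real.exp (t * v₂))) 0 :=
    (continuousAt_const.mul ((continuousAt_id.mul continuousAt_const).rexp)).prodMk
      (continuousAt_const.mul ((continuousAt_id.mul continuousAt_const).rexp))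
  have hpath' : ContinuousAt (fun t : ℝ => (Z * Real.exp (t * v₂), Y * Real.exp (t * v₁))) 0 :=
    (continuousAt_const.mul ((continuousAt_id.mul continuousAt_const).rexp)).prodMk
      (continuousAt_const.mul ((continuousAt_id.mul continuousAt_const).rexp))
  have h0 : (fun t : ℝ => (Y * Real.exp (t * v₁), Z * Real.exp (t * v₂))) 0 = (Y, Z) := by simp
  have h0' : (fun t : ℝ => (Z * Real.exp (t * v₂), Y * Real.exp (t * v₁))) 0 = (Z, Y) := by simp
  have hb : ContinuousAt (fun t : ℝ => contactB (Y * Real.exp (t * v₁)) (Z * Real.exp (t * v₂))) 0 := by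
    have h := continuousAt_contactB₂ hY hZ
    rw [← h0] at h
    exact ContinuousAt.comp (f := fun t : ℝ => (Y * Real.exp (t * v₁), Z * Real.exp (t * v₂)))
      (g := fun p : ℝ × ℝ => contactB p.1 p.2) h hpath
  have hb' : ContinuousAt (fun t : ℝ => contactB (Z * Real.exp (t * v₂)) (Y * Real.exp (t * v₁))) 0 := by
    have h := continuousAt_contactB₂ hZ hY
    rw [← h0'] at h
    exact ContinuousAt.comp (f := fun t : ℝ => (Z * Real.exp (t * v₂), Y * Real.exp (t * v₁)))
      (g := fun p : ℝ × ℝ => contactB p.1 p.2) h hpath'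
  have hb1 : Tendsto (fun t : ℝ => contactB (Y * Real.exp (t * v₁)) (Z * Real.exp (t * v₂))) (𝓝 0) (𝓝 (contactB Y Z)) := by
    have h := hb.tendsto
    simpa using h
  have hb2 : Tendsto (fun t : ℝ => contactB (Z * Real.exp (t * v₂)) (Y * Real.exp (t * v₁))) (𝓝 0) (𝓝 (contactB Z Y)) := by
    have h := hb'.tendsto
    simpa using h
  have hDt : Tendsto (fun t : ℝ => v₁ * contactB (Y * Real.exp (t * v₁)) (Z * Real.exp (t * v₂)) +
      v₂ * contactB (Z * Real.exp (t * v₂)) (Y * Real.exp (t * v₁))) (𝓝[≠] 0) (𝓝 D) :=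
    ((hb1.const_mul v₁).add (hb2.const_mul v₂)).mono_left nhdsWithin_le_nhds
  have hmin := (tendsto_const_nhds (x := D)).min hDt
  have hmax := (tendsto_const_nhds (x := D)).max hDt
  rw [min_self] at hmin
  rw [max_self] at hmax
  refine tendsto_of_tendsto_of_tendsto_of_le_of_le' hmin hmax ?_ ?_
  · filter_upwards [self_mem_nhdsWithin] with t ht
    have ht : t ≠ 0 := ht
    rw [zero_add, smul_eq_mul, hf0]
    rcases lt_or_gt_of_ne ht with hneg | hpos
    · refine min_le_of_right_le ?_
      rw [← div_eq_inv_mul, le_div_iff_of_neg hneg]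
      linarith [hup t]
    · refine min_le_of_left_le ?_
      rw [← div_eq_inv_mul, le_div_iff₀ hpos]
      linarith [hlow t]
  · filter_upwards [self_mem_nhdsWithin] with t ht
    have ht : t ≠ 0 := ht
    rw [zero_add, smul_eq_mul, hf0]
    rcases lt_or_gt_of_ne ht with hneg | hpos
    · refine le_max_of_le_left ?_
      rw [← div_eq_inv_mul, div_le_iff_of_neg hneg]
      linarith [hlow t]
    · refine le_max_of_le_right ?_
      rw [← div_eq_inv_mul, div_le_iff₀ hpos]
      linarith [hup t]

/-! ## §7 (ed.3) STRICT positivity of `J` in the aligned quadrants — by probability — and the STRICT joint convexity of the free energy -/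

/-- The weights are positive for positive fugacities. [cite: BeatonBousquetMelouDeGierDuminilCopinGuttmann2014, §3.2 (arXiv v5 p. 10) (lane plumbing)] -/
theorem wgt_pos (hy : 0 < y) (hz : 0 < z) (N : ℕ) (q : Site 2 × (ℕ → Site 2)) : 0 < wgt y z N q := by
  unfold wgt; positivity

/-- ★★ **IN THE NORTH-EAST QUADRANT ONE DENSITY MUST RISE**: for `y ≤ Y`, `z ≤ Z`, `(y,z) ≠ (Y,Z)`: `b(y,z) < b(Y,Z)` or `b(z,y) < b(Z,Y)`
— raising both fugacities cannot lower both densities (gradient monotonicity from the two supporting planes `tangent₂_le`, plus the strict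
one-variable monotonicity of `b` in its own fugacity for the degenerate directions).  Mirror statement in the south-west quadrant.
[cite: BeatonBousquetMelouDeGierDuminilCopinGuttmann2014, §3.2 Proposition 6 (arXiv v5 p. 10); MadrasSlade1993, §1.2] -/
theorem contactB_lt_or_lt_of_NE (hy : 0 < y) (hz : 0 < z) {Y Z : ℝ} (hyY : y ≤ Y) (hzZ : z ≤ Z) (hne : y ≠ Y ∨ z ≠ Z) :
    (contactB y z < contactB Y Z ∨ contactB z y < contactB Z Y) ∧
      (contactB Y Z ≤ contactB y z → contactB z y < contactB Z Y) ∧ (contactB Z Y ≤ contactB z y → contactB y z < contactB Y Z) := by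
  have hY : 0 < Y := hy.trans_le hyY
  have hZ : 0 < Z := hz.trans_le hzZ
  have T1 := tangent₂_le hy hz hY hZ
  have T2 := tangent₂_le hY hZ hy hz
  have hℓ : 0 ≤ Real.log Y - Real.log y := by linarith [Real.log_le_log hy hyY]
  have hℓ' : 0 ≤ Real.log Z - Real.log z := by linarith [Real.log_le_log hz hzZ]
  -- the key exclusion: NOT (b(Y,Z) ≤ b(y,z) ∧ b(Z,Y) ≤ b(z,y))
  have key : ¬ (contactB Y Z ≤ contactB y z ∧ contactB Z Y ≤ contactB z y) := by
    rintro ⟨h1, h2⟩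
    have u1 : 0 ≤ (contactB y z - contactB Y Z) * (Real.log Y - Real.log y) := mul_nonneg (by linarith) hℓ
    have u2 : 0 ≤ (contactB z y - contactB Z Y) * (Real.log Z - Real.log z) := mul_nonneg (by linarith) hℓ'
    have hsum : (contactB y z - contactB Y Z) * (Real.log Y - Real.log y) +
        (contactB z y - contactB Z Y) * (Real.log Z - Real.log z) ≤ 0 := by nlinarith [T1, T2]
    have e1 : (contactB y z - contactB Y Z) * (Real.log Y - Real.log y) = 0 := by linarith
    have e2 : (contactB z y - contactB Z Y) * (Real.log Z - Real.log z) = 0 := by linarith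
    rcases hne with hne | hne
    · have hlt : y < Y := lt_of_le_of_ne hyY hne
      have hℓ0 : Real.log Y - Real.log y ≠ 0 := by linarith [Real.log_lt_log hy hlt]
      have ha : contactB y z = contactB Y Z := by
        have := (mul_eq_zero.1 e1).resolve_right hℓ0; linarith
      rcases eq_or_ne z Z with hzZ' | hzZ'
      · -- `z = Z`: strict monotonicity of `b` in `y`
        rw [← hzZ'] at ha
        linarith [contactB_strictMono_left hy hz hlt]
      · have hlt' : z < Z := lt_of_le_of_ne hzZ hzZ'
        have hℓ0' : Real.log Z - Real.log z ≠ 0 := by linarith [Real.log_lt_log hz hlt']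
        have ha' : contactB z y = contactB Z Y := by
          have := (mul_eq_zero.1 e2).resolve_right hℓ0'; linarith
        obtain ⟨e, -⟩ := eq_of_contactB_eq hy hz hY hZ ha ha'
        exact hne e
    · have hlt' : z < Z := lt_of_le_of_ne hzZ hne
      have hℓ0' : Real.log Z - Real.log z ≠ 0 := by linarith [Real.log_lt_log hz hlt']
      have ha' : contactB z y = contactB Z Y := by
        have := (mul_eq_zero.1 e2).resolve_right hℓ0'; linarith
      rcases eq_or_ne y Y with hyY' | hyY'
      · rw [← hyY'] at ha'
        linarith [contactB_strictMono_left hz hy hlt']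
      · have hlt : y < Y := lt_of_le_of_ne hyY hyY'
        have hℓ0 : Real.log Y - Real.log y ≠ 0 := by linarith [Real.log_lt_log hy hlt]
        have ha : contactB y z = contactB Y Z := by
          have := (mul_eq_zero.1 e1).resolve_right hℓ0; linarith
        obtain ⟨-, e⟩ := eq_of_contactB_eq hy hz hY hZ ha ha'
        exact hne e
  refine ⟨?_, fun h1 => ?_, fun h2 => ?_⟩
  · by_contra h
    rw [not_or, not_lt, not_lt] at h
    exact key h
  · by_contra h; rw [not_lt] at h; exact key ⟨h1, h⟩
  · by_contra h; rw [not_lt] at h; exact key ⟨h, h2⟩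

/-- The south-west mirror: for `Y ≤ y`, `Z ≤ z`, `(Y,Z) ≠ (y,z)` (all positive): `b(Y,Z) < b(y,z)` or `b(Z,Y) < b(z,y)`.
[cite: BeatonBousquetMelouDeGierDuminilCopinGuttmann2014, §3.2 Proposition 6 (arXiv v5 p. 10); MadrasSlade1993, §1.2] -/
theorem contactB_lt_or_lt_of_SW {Y Z : ℝ} (hY : 0 < Y) (hYy : Y ≤ y) (hZ : 0 < Z) (hZz : Z ≤ z)
    (hne : y ≠ Y ∨ z ≠ Z) : contactB Y Z < contactB y z ∨ contactB Z Y < contactB z y := by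
  have h := (contactB_lt_or_lt_of_NE hY hZ hYy hZz (hne.imp Ne.symm Ne.symm)).1
  exact h

open Classical in
/-- Eventually the north-east quadrant event at the densities of any tilt `(Y,Z)` carries positive weight (it contains the box around the
explicit interior tilt `(Y(a+δ,a'+δ), Y(a'+δ,a+δ))`, which the two tilted laws of large numbers fill).
[cite: DemboZeitouni2010, §2.2 Theorem 2.2.3 (lane plumbing); BeatonBousquetMelouDeGierDuminilCopinGuttmann2014, §3.2 (arXiv v5 p. 10)] -/
theorem eventually_NE_sum_pos (hy : 0 < y) (hz : 0 < z) {Y Z : ℝ} (hY : 0 < Y) (hZ : 0 < Z) :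
    ∀ᶠ N : ℕ in atTop, 0 < ∑ q ∈ (stripPairs 1 N).filter
        (fun q => contactB Y Z * N ≤ (bottomVisits₀ q.1 q.2 N : ℝ) ∧ contactB Z Y * N ≤ (topVisits₀ 1 q.1 q.2 N : ℝ)),
        wgt y z N q := by
  set a := contactB Y Z with ha
  set a' := contactB Z Y with ha'
  obtain ⟨t1, t2, t3⟩ := contactB_mem_triangle hY hZ
  set δ := (1 / 2 - a - a') / 4 with hδ
  have hδ0 : 0 < δ := by rw [hδ]; linarith
  have s1 : (a + δ) + (a' + δ) < 1 / 2 := by rw [hδ]; linarith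
  have s2 : 1 < 4 * (a + δ) + 2 * (a' + δ) := by linarith
  have s3 : 1 < 2 * (a + δ) + 4 * (a' + δ) := by linarith
  obtain ⟨hY'0, hZ'0, hbY', hbZ', -, -⟩ := contactB_eosY s1 s2 s3
  have hb1 : a < contactB (eosY (a + δ) (a' + δ)) (eosY (a' + δ) (a + δ)) := by rw [hbY']; linarith
  have hb2 : contactB (eosY (a + δ) (a' + δ)) (eosY (a' + δ) (a + δ)) < a + 2 * δ := by rw [hbY']; linarith
  have hb1' : a' < contactB (eosY (a' + δ) (a + δ)) (eosY (a + δ) (a' + δ)) := by rw [hbZ']; linarith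
  have hb2' : contactB (eosY (a' + δ) (a + δ)) (eosY (a + δ) (a' + δ)) < a' + 2 * δ := by rw [hbZ']; linarith
  filter_upwards [eventually_half_le_boxSum hY'0 hZ'0 hb1 hb2 hb1' hb2'] with N hN
  have hZpos := stripZ₂_pos 1 N hY'0 hZ'0
  -- the box is nonempty, hence so is the quadrant event
  have hne : ((stripPairs 1 N).filter (fun q => (a * N ≤ (bottomVisits₀ q.1 q.2 N : ℝ) ∧
      (bottomVisits₀ q.1 q.2 N : ℝ) ≤ (a + 2 * δ) * N) ∧ (a' * N ≤ (topVisits₀ 1 q.1 q.2 N : ℝ) ∧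
      (topVisits₀ 1 q.1 q.2 N : ℝ) ≤ (a' + 2 * δ) * N))).Nonempty := by
    by_contra h
    rw [Finset.not_nonempty_iff_eq_empty] at h
    rw [h, Finset.sum_empty] at hN
    linarith
  obtain ⟨q, hq⟩ := hne
  rw [Finset.mem_filter] at hq
  refine Finset.sum_pos (fun q _ => wgt_pos hy hz N q) ⟨q, ?_⟩
  rw [Finset.mem_filter]
  exact ⟨hq.1, hq.2.1.1, hq.2.2.1⟩

open Classical in
/-- The south-west mirror of `eventually_NE_sum_pos`. [cite: DemboZeitouni2010, §2.2 Theorem 2.2.3 (lane plumbing)] -/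
theorem eventually_SW_sum_pos (hy : 0 < y) (hz : 0 < z) {Y Z : ℝ} (hY : 0 < Y) (hZ : 0 < Z) :
    ∀ᶠ N : ℕ in atTop, 0 < ∑ q ∈ (stripPairs 1 N).filter
        (fun q => (bottomVisits₀ q.1 q.2 N : ℝ) ≤ contactB Y Z * N ∧ (topVisits₀ 1 q.1 q.2 N : ℝ) ≤ contactB Z Y * N),
        wgt y z N q := by
  set a := contactB Y Z with ha
  set a' := contactB Z Y with ha'
  obtain ⟨t1, t2, t3⟩ := contactB_mem_triangle hY hZ
  set δ := -(min (4 * a + 2 * a' - 1) (2 * a + 4 * a' - 1) / 12) with hδ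
  have hm0 : 0 < min (4 * a + 2 * a' - 1) (2 * a + 4 * a' - 1) := lt_min (by linarith) (by linarith)
  have hm1 : min (4 * a + 2 * a' - 1) (2 * a + 4 * a' - 1) ≤ 4 * a + 2 * a' - 1 := min_le_left _ _
  have hm2 : min (4 * a + 2 * a' - 1) (2 * a + 4 * a' - 1) ≤ 2 * a + 4 * a' - 1 := min_le_right _ _
  have hδ0 : δ < 0 := by rw [hδ]; linarith
  have s1 : (a + δ) + (a' + δ) < 1 / 2 := by linarith
  have s2 : 1 < 4 * (a + δ) + 2 * (a' + δ) := by rw [hδ]; linarith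
  have s3 : 1 < 2 * (a + δ) + 4 * (a' + δ) := by rw [hδ]; linarith
  obtain ⟨hY'0, hZ'0, hbY', hbZ', -, -⟩ := contactB_eosY s1 s2 s3
  have hb1 : a + 2 * δ < contactB (eosY (a + δ) (a' + δ)) (eosY (a' + δ) (a + δ)) := by rw [hbY']; linarith
  have hb2 : contactB (eosY (a + δ) (a' + δ)) (eosY (a' + δ) (a + δ)) < a := by rw [hbY']; linarith
  have hb1' : a' + 2 * δ < contactB (eosY (a' + δ) (a + δ)) (eosY (a + δ) (a' + δ)) := by rw [hbZ']; linarith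
  have hb2' : contactB (eosY (a' + δ) (a + δ)) (eosY (a + δ) (a' + δ)) < a' := by rw [hbZ']; linarith
  filter_upwards [eventually_half_le_boxSum hY'0 hZ'0 hb1 hb2 hb1' hb2'] with N hN
  have hZpos := stripZ₂_pos 1 N hY'0 hZ'0
  have hne : ((stripPairs 1 N).filter (fun q => ((a + 2 * δ) * N ≤ (bottomVisits₀ q.1 q.2 N : ℝ) ∧
      (bottomVisits₀ q.1 q.2 N : ℝ) ≤ a * N) ∧ ((a' + 2 * δ) * N ≤ (topVisits₀ 1 q.1 q.2 N : ℝ) ∧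
      (topVisits₀ 1 q.1 q.2 N : ℝ) ≤ a' * N))).Nonempty := by
    by_contra h
    rw [Finset.not_nonempty_iff_eq_empty] at h
    rw [h, Finset.sum_empty] at hN
    linarith
  obtain ⟨q, hq⟩ := hne
  rw [Finset.mem_filter] at hq
  refine Finset.sum_pos (fun q _ => wgt_pos hy hz N q) ⟨q, ?_⟩
  rw [Finset.mem_filter]
  exact ⟨hq.1, hq.2.1.2, hq.2.2.2⟩

open Classical in
/-- ★★★ **`J > 0` OFF THE BASE POINT IN THE NORTH-EAST QUADRANT — by probability.**  For `y ≤ Y`, `z ≤ Z`, `(Y,Z) ≠ (y,z)`: one of the two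
densities rises (`contactB_lt_or_lt_of_NE`), say `a = b(Y,Z) > b(y,z)`; the quadrant event lies inside the one-wall event `{bc ≥ aN}`, whose
exponential rate under `P_{N,y,z}` is the parent's `I(y,z;Y_a) > 0` (`tendsto_log_contacts_ge_div`, `contactRate_pos` — i.e. the one-variable
STRICT convexity); comparing the two limits gives `J ≥ I(y,z;Y_a) > 0`.  This is the strict supporting-plane inequality in the aligned
quadrant, obtained from the one-dimensional ones through the joint LDP. [cite: DemboZeitouni2010, §2.2 Theorem 2.2.3 and §2.3 Definition 2.3.3; BeatonBousquetMelouDeGierDuminilCopinGuttmann2014, §3.2 Proposition 6 (arXiv v5 p. 10); MadrasSlade1993, §1.2] -/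
theorem jointRate_pos_NE (hy : 0 < y) (hz : 0 < z) {Y Z : ℝ} (hyY : y ≤ Y) (hzZ : z ≤ Z) (hne : y ≠ Y ∨ z ≠ Z) :
    0 < jointRate y z Y Z := by
  have hY : 0 < Y := hy.trans_le hyY
  have hZ : 0 < Z := hz.trans_le hzZ
  have hJ := tendsto_log_contacts_NE_div hy hz hyY hzZ
  have hpos := eventually_NE_sum_pos hy hz hY hZ
  set a := contactB Y Z with ha
  set a' := contactB Z Y with ha'
  obtain ⟨-, -, -, -, ha0, ha2⟩ := contactB_facts hY hZ
  obtain ⟨-, -, -, -, ha0', ha2'⟩ := contactB_facts hZ hY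
  rcases (contactB_lt_or_lt_of_NE hy hz hyY hzZ hne).1 with hlt | hlt
  · -- the bottom density rises: compare with the one-wall event `{bc ≥ aN}`
    obtain ⟨Y₁, hyY₁, hbY₁⟩ := exists_gt_contactB_eq hy hz hlt ha2
    have hY₁ : 0 < Y₁ := hy.trans hyY₁
    have hI := contactRate_pos hy hz hY₁ hyY₁.ne'
    have h1 := tendsto_log_contacts_ge_div hy hz hyY₁.le
    rw [hbY₁] at h1
    have hle : ∀ᶠ N : ℕ in atTop, Real.log ((∑ q ∈ (stripPairs 1 N).filter
        (fun q => a * N ≤ (bottomVisits₀ q.1 q.2 N : ℝ) ∧ a' * N ≤ (topVisits₀ 1 q.1 q.2 N : ℝ)), wgt y z N q) /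
          stripZ₂ 1 N y z) / N ≤
        Real.log ((∑ q ∈ (stripPairs 1 N).filter (fun q => a * N ≤ (bottomVisits₀ q.1 q.2 N : ℝ)), wgt y z N q) /
          stripZ₂ 1 N y z) / N := by
      filter_upwards [hpos] with N hN
      have hZN := stripZ₂_pos 1 N hy hz
      refine div_le_div_of_nonneg_right ?_ (Nat.cast_nonneg N)
      refine Real.log_le_log (div_pos hN hZN) (div_le_div_of_nonneg_right ?_ hZN.le)
      refine Finset.sum_le_sum_of_subset_of_nonneg (fun q hq => ?_) fun q _ _ => wgt_nonneg hy.le hz.le N q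
      rw [Finset.mem_filter] at hq ⊢
      exact ⟨hq.1, hq.2.1⟩
    have := le_of_tendsto_of_tendsto hJ h1 hle
    linarith
  · -- the top density rises: compare with `{tc ≥ a'N}`
    obtain ⟨Z₁, hzZ₁, hbZ₁⟩ := exists_gt_contactB_eq hz hy hlt ha2'
    have hZ₁ : 0 < Z₁ := hz.trans hzZ₁
    have hI := contactRate_pos hz hy hZ₁ hzZ₁.ne'
    have h1 := (tendsto_log_topContacts_ge_le_div hy hz hZ₁).1 hzZ₁.le
    rw [hbZ₁] at h1
    have hle : ∀ᶠ N : ℕ in atTop, Real.log ((∑ q ∈ (stripPairs 1 N).filter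
        (fun q => a * N ≤ (bottomVisits₀ q.1 q.2 N : ℝ) ∧ a' * N ≤ (topVisits₀ 1 q.1 q.2 N : ℝ)), wgt y z N q) /
          stripZ₂ 1 N y z) / N ≤
        Real.log ((∑ q ∈ (stripPairs 1 N).filter (fun q => a' * N ≤ (topVisits₀ 1 q.1 q.2 N : ℝ)), wgt y z N q) /
          stripZ₂ 1 N y z) / N := by
      filter_upwards [hpos] with N hN
      have hZN := stripZ₂_pos 1 N hy hz
      refine div_le_div_of_nonneg_right ?_ (Nat.cast_nonneg N)
      refine Real.log_le_log (div_pos hN hZN) (div_le_div_of_nonneg_right ?_ hZN.le)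
      refine Finset.sum_le_sum_of_subset_of_nonneg (fun q hq => ?_) fun q _ _ => wgt_nonneg hy.le hz.le N q
      rw [Finset.mem_filter] at hq ⊢
      exact ⟨hq.1, hq.2.2⟩
    have := le_of_tendsto_of_tendsto hJ h1 hle
    linarith

open Classical in
/-- ★★★ **`J > 0` OFF THE BASE POINT IN THE SOUTH-WEST QUADRANT** (`0 < Y ≤ y`, `0 < Z ≤ z`, `(Y,Z) ≠ (y,z)`), by the same comparison with
the one-wall lower-tail events. [cite: DemboZeitouni2010, §2.2 Theorem 2.2.3 and §2.3 Definition 2.3.3; BeatonBousquetMelouDeGierDuminilCopinGuttmann2014, §3.2 Proposition 6 (arXiv v5 p. 10); MadrasSlade1993, §1.2] -/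
theorem jointRate_pos_SW (hy : 0 < y) (hz : 0 < z) {Y Z : ℝ} (hY : 0 < Y) (hYy : Y ≤ y) (hZ : 0 < Z) (hZz : Z ≤ z)
    (hne : y ≠ Y ∨ z ≠ Z) : 0 < jointRate y z Y Z := by
  have hJ := tendsto_log_contacts_SW_div hy hz hY hYy hZ hZz
  have hpos := eventually_SW_sum_pos hy hz hY hZ
  set a := contactB Y Z with ha
  set a' := contactB Z Y with ha'
  obtain ⟨-, -, -, -, ha0, ha2⟩ := contactB_facts hY hZ
  obtain ⟨-, -, -, -, ha0', ha2'⟩ := contactB_facts hZ hY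
  rcases contactB_lt_or_lt_of_SW hY hYy hZ hZz hne with hlt | hlt
  · obtain ⟨Y₁, hY₁, hY₁y, hbY₁⟩ := exists_lt_contactB_eq hy hz ha0 hlt
    have hI := contactRate_pos hy hz hY₁ hY₁y.ne
    have h1 := tendsto_log_contacts_le_div hy hz hY₁ hY₁y.le
    rw [hbY₁] at h1
    have hle : ∀ᶠ N : ℕ in atTop, Real.log ((∑ q ∈ (stripPairs 1 N).filter
        (fun q => (bottomVisits₀ q.1 q.2 N : ℝ) ≤ a * N ∧ (topVisits₀ 1 q.1 q.2 N : ℝ) ≤ a' * N), wgt y z N q) /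
          stripZ₂ 1 N y z) / N ≤
        Real.log ((∑ q ∈ (stripPairs 1 N).filter (fun q => (bottomVisits₀ q.1 q.2 N : ℝ) ≤ a * N), wgt y z N q) /
          stripZ₂ 1 N y z) / N := by
      filter_upwards [hpos] with N hN
      have hZN := stripZ₂_pos 1 N hy hz
      refine div_le_div_of_nonneg_right ?_ (Nat.cast_nonneg N)
      refine Real.log_le_log (div_pos hN hZN) (div_le_div_of_nonneg_right ?_ hZN.le)
      refine Finset.sum_le_sum_of_subset_of_nonneg (fun q hq => ?_) fun q _ _ => wgt_nonneg hy.le hz.le N q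
      rw [Finset.mem_filter] at hq ⊢
      exact ⟨hq.1, hq.2.1⟩
    have := le_of_tendsto_of_tendsto hJ h1 hle
    linarith
  · obtain ⟨Z₁, hZ₁, hZ₁z, hbZ₁⟩ := exists_lt_contactB_eq hz hy ha0' hlt
    have hI := contactRate_pos hz hy hZ₁ hZ₁z.ne
    have h1 := (tendsto_log_topContacts_ge_le_div hy hz hZ₁).2 hZ₁z.le
    rw [hbZ₁] at h1
    have hle : ∀ᶠ N : ℕ in atTop, Real.log ((∑ q ∈ (stripPairs 1 N).filter
        (fun q => (bottomVisits₀ q.1 q.2 N : ℝ) ≤ a * N ∧ (topVisits₀ 1 q.1 q.2 N : ℝ) ≤ a' * N), wgt y z N q) /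
          stripZ₂ 1 N y z) / N ≤
        Real.log ((∑ q ∈ (stripPairs 1 N).filter (fun q => (topVisits₀ 1 q.1 q.2 N : ℝ) ≤ a' * N), wgt y z N q) /
          stripZ₂ 1 N y z) / N := by
      filter_upwards [hpos] with N hN
      have hZN := stripZ₂_pos 1 N hy hz
      refine div_le_div_of_nonneg_right ?_ (Nat.cast_nonneg N)
      refine Real.log_le_log (div_pos hN hZN) (div_le_div_of_nonneg_right ?_ hZN.le)
      refine Finset.sum_le_sum_of_subset_of_nonneg (fun q hq => ?_) fun q _ _ => wgt_nonneg hy.le hz.le N q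
      rw [Finset.mem_filter] at hq ⊢
      exact ⟨hq.1, hq.2.2⟩
    have := le_of_tendsto_of_tendsto hJ h1 hle
    linarith

/-- ★★★ **THE JOINT RATE IS POSITIVE OFF THE BASE POINT, EVERYWHERE**: for all positive `y, z, Y, Z` with `(Y,Z) ≠ (y,z)`, `J(y,z;Y,Z) > 0`.
[cite: DemboZeitouni2010, §2.2 Theorem 2.2.3 and §2.3 Definition 2.3.3; BeatonBousquetMelouDeGierDuminilCopinGuttmann2014, §3.2 Proposition 6 (arXiv v5 p. 10)] -/
theorem jointRate_pos (hy : 0 < y) (hz : 0 < z) {Y Z : ℝ} (hY : 0 < Y) (hZ : 0 < Z) (hne : y ≠ Y ∨ z ≠ Z) :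
    0 < jointRate y z Y Z := by
  rcases le_total y Y with hyY | hYy
  · rcases le_total z Z with hzZ | hZz
    · exact jointRate_pos_NE hy hz hyY hzZ hne
    · exact (jointRate_pos_NW hy hz hZ hyY hZz).2 hne
  · rcases le_total z Z with hzZ | hZz
    · exact (jointRate_pos_SE hy hz hY hYy hzZ).2 hne
    · exact jointRate_pos_SW hy hz hY hYy hZ hZz hne

/-- ★★★ **THE STRICT SUPPORTING PLANE, IN EVERY DIRECTION**: for all positive `y, z, Y, Z` with `(y,z) ≠ (Y,Z)`,
`b(Y,Z)·(log y − log Y) + b(Z,Y)·(log z − log Z) < log μ_1(y,z) − log μ_1(Y,Z)`.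
[cite: DemboZeitouni2010, §2.3 Definition 2.3.3 (exposed point: STRICT exposing hyperplane); BeatonBousquetMelouDeGierDuminilCopinGuttmann2014, §3.2 Proposition 6 (arXiv v5 p. 10); HammersleyTorrieWhittington1982, §2 (2.12)] -/
theorem tangent₂_lt (hy : 0 < y) (hz : 0 < z) {Y Z : ℝ} (hY : 0 < Y) (hZ : 0 < Z) (hne : y ≠ Y ∨ z ≠ Z) :
    contactB Y Z * (Real.log y - Real.log Y) + contactB Z Y * (Real.log z - Real.log Z) <
      Real.log (stripMuY₂ 1 y z) - Real.log (stripMuY₂ 1 Y Z) := by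
  have h := jointRate_pos hy hz hY hZ hne
  unfold jointRate at h
  rw [Real.log_div hY.ne' hy.ne', Real.log_div hZ.ne' hz.ne',
    Real.log_div (stripMuY₂_pos 1 hY hZ).ne' (stripMuY₂_pos 1 hy hz).ne'] at h
  linarith

/-- ★★★ **THE TWO-WALL FREE ENERGY IS STRICTLY CONVEX**: `(A,B) ↦ log μ_1(e^A, e^B)` is STRICTLY convex on `ℝ²` (the tree's
`convexOn_log_stripMuY₂_exp`, Hölder, gave convexity; strictness = every density pair is an EXPOSED point with the explicit tilt as exposing
plane — from the strict planes at the intermediate point towards both ends).  Equivalently the density map `(log y, log z) ↦ (b, b_top)` is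
STRICTLY monotone; this is the statement left open in `HexSAWBrickWallStripRungRays` / `…TwoWallChart` / ed.1–2 of this file.
[cite: DemboZeitouni2010, §2.3 Definition 2.3.3 and Definition 2.3.5; BeatonBousquetMelouDeGierDuminilCopinGuttmann2014, §3.2 Proposition 6 (arXiv v5 p. 10: "log-convex"); HammersleyTorrieWhittington1982, §2 (2.12)] -/
theorem strictConvexOn_log_stripMuY₂_one_exp :
    StrictConvexOn ℝ Set.univ (fun p : ℝ × ℝ => Real.log (stripMuY₂ 1 (Real.exp p.1) (Real.exp p.2))) := by
  refine ⟨convex_univ, ?_⟩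
  intro P _ Q _ hPQ a b ha hb hab
  -- the intermediate point `M = aP + bQ` and the strict planes at `M` towards `P` and towards `Q`
  set M := a • P + b • Q with hM
  have hM1 : M.1 = a * P.1 + b * Q.1 := by simp [hM]
  have hM2 : M.2 = a * P.2 + b * Q.2 := by simp [hM]
  have hmY : 0 < Real.exp M.1 := Real.exp_pos _
  have hmZ : 0 < Real.exp M.2 := Real.exp_pos _
  -- `P ≠ M` and `Q ≠ M`
  have hPM : Real.exp P.1 ≠ Real.exp M.1 ∨ Real.exp P.2 ≠ Real.exp M.2 := by
    by_contra h
    rw [not_or, not_not, not_not, Real.exp_eq_exp, Real.exp_eq_exp, hM1, hM2] at h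
    apply hPQ
    have hb0 : b ≠ 0 := hb.ne'
    have e1 : P.1 = Q.1 := by
      have : b * (P.1 - Q.1) = 0 := by linear_combination h.1 + P.1 * hab
      rcases mul_eq_zero.1 this with h0 | h0
      · exact absurd h0 hb0
      · linarith
    have e2 : P.2 = Q.2 := by
      have : b * (P.2 - Q.2) = 0 := by linear_combination h.2 + P.2 * hab
      rcases mul_eq_zero.1 this with h0 | h0
      · exact absurd h0 hb0
      · linarith
    exact Prod.ext e1 e2
  have hQM : Real.exp Q.1 ≠ Real.exp M.1 ∨ Real.exp Q.2 ≠ Real.exp M.2 := by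
    by_contra h
    rw [not_or, not_not, not_not, Real.exp_eq_exp, Real.exp_eq_exp, hM1, hM2] at h
    apply hPQ
    have ha0 : a ≠ 0 := ha.ne'
    have e1 : P.1 = Q.1 := by
      have : a * (Q.1 - P.1) = 0 := by linear_combination h.1 + Q.1 * hab
      rcases mul_eq_zero.1 this with h0 | h0
      · exact absurd h0 ha0
      · linarith
    have e2 : P.2 = Q.2 := by
      have : a * (Q.2 - P.2) = 0 := by linear_combination h.2 + Q.2 * hab
      rcases mul_eq_zero.1 this with h0 | h0
      · exact absurd h0 ha0
      · linarith
    exact Prod.ext e1 e2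
  have hP := tangent₂_lt (Real.exp_pos P.1) (Real.exp_pos P.2) hmY hmZ hPM
  have hQ := tangent₂_lt (Real.exp_pos Q.1) (Real.exp_pos Q.2) hmY hmZ hQM
  simp only [Real.log_exp] at hP hQ
  simp only [smul_eq_mul]
  show Real.log (stripMuY₂ 1 (Real.exp M.1) (Real.exp M.2)) <
    a * Real.log (stripMuY₂ 1 (Real.exp P.1) (Real.exp P.2)) + b * Real.log (stripMuY₂ 1 (Real.exp Q.1) (Real.exp Q.2))
  -- `a·hP + b·hQ`: the plane terms cancel since `a(P − M) + b(Q − M) = 0`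
  have hc1 : a * (P.1 - M.1) + b * (Q.1 - M.1) = 0 := by rw [hM1]; linear_combination (-(a * P.1 + b * Q.1)) * hab
  have hc2 : a * (P.2 - M.2) + b * (Q.2 - M.2) = 0 := by rw [hM2]; linear_combination (-(a * P.2 + b * Q.2)) * hab
  have h1 := mul_lt_mul_of_pos_left hP ha
  have h2 := mul_lt_mul_of_pos_left hQ hb
  have k1 := congrArg (fun t => contactB (Real.exp M.1) (Real.exp M.2) * t) hc1
  have k2 := congrArg (fun t => contactB (Real.exp M.2) (Real.exp M.1) * t) hc2
  have k3 := congrArg (fun t => Real.log (stripMuY₂ 1 (Real.exp M.1) (Real.exp M.2)) * t) hab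
  simp only [mul_add, mul_zero, mul_one] at k1 k2 k3
  linarith [h1, h2, k1, k2, k3]

/-! ## §8 (ed.4) The two-density contact ENTROPY: closed form, the variational principle, strict concavity, and the entropy of walk counts -/

/-- **The two-density contact entropy** `s(a,a') = log μ_1(Y,Z) − a log Y − a' log Z` at the explicit tilt `(Y,Z) = (Y(a,a'), Y(a',a))` of the
inverse equation of state — the exponential growth rate of the number of strip walks with bottom/top contact densities `(a,a')` (`tendsto_log_card_contacts_NE_div₂`
below), the two-variable twin of the parent's `contactEntropy`. [cite: JansevanRensburg2000, §3.2 Theorems 3.18–3.19 (1st ed., pp. 51–52: the density function as the Legendre transform of the free energy); DemboZeitouni2010, §2.2 Definition 2.2.2] -/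
def contactEntropy₂ (a a' : ℝ) : ℝ :=
  Real.log (stripMuY₂ 1 (eosY a a') (eosY a' a)) - a * Real.log (eosY a a') - a' * Real.log (eosY a' a)

/-- Symmetry `s(a',a) = s(a,a')`. [cite: BeatonBousquetMelouDeGierDuminilCopinGuttmann2014, §3.2 Proposition 6 (arXiv v5 p. 10: μ_T(y,z) = μ_T(z,y))] -/
theorem contactEntropy₂_swap (a a' : ℝ) : contactEntropy₂ a' a = contactEntropy₂ a a' := by
  unfold contactEntropy₂; rw [stripMuY₂_symm 1 (eosY a' a) (eosY a a')]; ring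

/-- ★★ **CLOSED FORM**: on the open density triangle,
`s(a,a') = ½ log[(4a+2a'−1)(2a+4a'−1)/(1−2a−2a')²] − a log Y(a,a') − a' log Y(a',a)` with the rational `Y(·,·)` of `HexSAWBrickWallStripTwoWallChart`
— an ELEMENTARY function of the two densities. [cite: JansevanRensburg2000, §3.2 Theorem 3.19 (1st ed., p. 52); BeatonBousquetMelouDeGierDuminilCopinGuttmann2014, §3.2 Proposition 6 (arXiv v5 p. 10)] -/
theorem contactEntropy₂_eq {a a' : ℝ} (h1 : a + a' < 1 / 2) (h2 : 1 < 4 * a + 2 * a') (h3 : 1 < 2 * a + 4 * a') :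
    contactEntropy₂ a a' = Real.log ((4 * a + 2 * a' - 1) * (2 * a + 4 * a' - 1) / (1 - 2 * a - 2 * a') ^ 2) / 2 -
      a * Real.log (eosY a a') - a' * Real.log (eosY a' a) := by
  obtain ⟨hY0, hZ0, -, -, -, hS⟩ := contactB_eosY h1 h2 h3
  unfold contactEntropy₂
  rw [← hS, Real.log_pow]
  push_cast
  ring

/-- ★★ **THE GIBBS FORM OF THE JOINT RATE**: at the tilt realising `(a,a')`, `J(y,z;Y,Z) = log μ_1(y,z) − [a log y + a' log z + s(a,a')]` — the rate is
the free energy minus (energy + entropy) of the density pair. [cite: DemboZeitouni2010, §2.2 Theorem 2.2.3 (rate = Legendre transform); JansevanRensburg2000, §3.2 Theorem 3.18 (1st ed., p. 51)] -/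
theorem jointRate_eq_sub_contactEntropy₂ {a a' : ℝ} (hy : 0 < y) (hz : 0 < z) (h1 : a + a' < 1 / 2) (h2 : 1 < 4 * a + 2 * a')
    (h3 : 1 < 2 * a + 4 * a') :
    jointRate y z (eosY a a') (eosY a' a) = Real.log (stripMuY₂ 1 y z) - (a * Real.log y + a' * Real.log z + contactEntropy₂ a a') := by
  obtain ⟨hY0, hZ0, hb, hb', -, -⟩ := contactB_eosY h1 h2 h3
  unfold jointRate contactEntropy₂
  rw [hb, hb', Real.log_div hY0.ne' hy.ne', Real.log_div hZ0.ne' hz.ne',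
    Real.log_div (stripMuY₂_pos 1 hY0 hZ0).ne' (stripMuY₂_pos 1 hy hz).ne']
  ring

/-- ★★★ **THE VARIATIONAL PRINCIPLE OF THE TWO-WALL STRIP**: for all `y, z > 0`,
`log μ_1(y,z) = max {a·log y + a'·log z + s(a,a') : (a,a') in the open density triangle}`, attained at `(a,a') = (b(y,z), b(z,y))` and ONLY
there (`J > 0` off the point) — free energy = max over densities of energy + entropy, with a unique equilibrium density pair.
[cite: JansevanRensburg2000, §3.2 Theorem 3.18 (1st ed., p. 51: F(z) = sup{ε log z + log P(ε)}); DemboZeitouni2010, §2.2 Theorem 2.2.3] -/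
theorem isGreatest_log_stripMuY₂_energy_add_entropy (hy : 0 < y) (hz : 0 < z) :
    IsGreatest {f : ℝ | ∃ a a' : ℝ, a + a' < 1 / 2 ∧ 1 < 4 * a + 2 * a' ∧ 1 < 2 * a + 4 * a' ∧
      f = a * Real.log y + a' * Real.log z + contactEntropy₂ a a'} (Real.log (stripMuY₂ 1 y z)) ∧
    (∀ a a' : ℝ, a + a' < 1 / 2 → 1 < 4 * a + 2 * a' → 1 < 2 * a + 4 * a' → (a ≠ contactB y z ∨ a' ≠ contactB z y) →
      a * Real.log y + a' * Real.log z + contactEntropy₂ a a' < Real.log (stripMuY₂ 1 y z)) := by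
  obtain ⟨t1, t2, t3⟩ := contactB_mem_triangle hy hz
  obtain ⟨eY, eZ⟩ := eosY_contactB hy hz
  refine ⟨⟨⟨contactB y z, contactB z y, t1, t2, t3, ?_⟩, ?_⟩, ?_⟩
  · have h := jointRate_eq_sub_contactEntropy₂ hy hz t1 t2 t3
    rw [eY, eZ, jointRate_self hy hz] at h
    linarith
  · rintro f ⟨a, a', h1, h2, h3, rfl⟩
    obtain ⟨hY0, hZ0, -, -, -, -⟩ := contactB_eosY h1 h2 h3
    have h := jointRate_eq_sub_contactEntropy₂ hy hz h1 h2 h3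
    have hJ := jointRate_nonneg_all hy hz hY0 hZ0
    linarith
  · intro a a' h1 h2 h3 hne
    obtain ⟨hY0, hZ0, hb, hb', -, -⟩ := contactB_eosY h1 h2 h3
    have h := jointRate_eq_sub_contactEntropy₂ hy hz h1 h2 h3
    have hne' : y ≠ eosY a a' ∨ z ≠ eosY a' a := by
      by_contra hcon
      rw [not_or, not_not, not_not] at hcon
      obtain ⟨e1, e2⟩ := hcon
      rcases hne with hne | hne
      · exact hne (by rw [e1, e2, hb])
      · exact hne (by rw [e1, e2, hb'])
    have hJ := jointRate_pos hy hz hY0 hZ0 hne'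
    linarith

/-- ★★ **THE ENTROPY IS A MINIMUM OF TILTED FREE ENERGIES**: for `(a,a')` in the triangle and ALL `u, v > 0`,
`s(a,a') ≤ log μ_1(u,v) − a log u − a' log v`, with equality iff `(u,v)` is the tilt `(Y(a,a'), Y(a',a))` (this is `J(u,v;Y,Z) ≥ 0`, `> 0` off
the point, read at the base `(u,v)`). [cite: JansevanRensburg2000, §3.2 Theorem 3.19 (1st ed., p. 52: log P(ε) = inf{F(z) − ε log z}); DemboZeitouni2010, §2.2 Definition 2.2.2] -/
theorem contactEntropy₂_le {a a' : ℝ} (h1 : a + a' < 1 / 2) (h2 : 1 < 4 * a + 2 * a') (h3 : 1 < 2 * a + 4 * a') {u v : ℝ} (hu : 0 < u)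
    (hv : 0 < v) :
    contactEntropy₂ a a' ≤ Real.log (stripMuY₂ 1 u v) - a * Real.log u - a' * Real.log v ∧
      ((u ≠ eosY a a' ∨ v ≠ eosY a' a) → contactEntropy₂ a a' < Real.log (stripMuY₂ 1 u v) - a * Real.log u - a' * Real.log v) := by
  obtain ⟨hY0, hZ0, -, -, -, -⟩ := contactB_eosY h1 h2 h3
  have h := jointRate_eq_sub_contactEntropy₂ hu hv h1 h2 h3
  refine ⟨?_, fun hne => ?_⟩
  · have hJ := jointRate_nonneg_all hu hv hY0 hZ0
    linarith
  · have hJ := jointRate_pos hu hv hY0 hZ0 hne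
    linarith

/-- ★★★ **THE TWO-DENSITY ENTROPY IS STRICTLY CONCAVE on the open density triangle** (a strict minimum of affine functions of `(a,a')` with the
minimiser moving injectively: at the intermediate density pair use its own tilt in `contactEntropy₂_le` for both ends).
[cite: JansevanRensburg2000, §3.3 (1st ed.: properties of the density function, concavity); DemboZeitouni2010, §2.3 Lemma 2.3.9 (strict convexity of Λ* ↔ differentiability)] -/
theorem strictConcaveOn_contactEntropy₂ :
    StrictConcaveOn ℝ {p : ℝ × ℝ | p.1 + p.2 < 1 / 2 ∧ 1 < 4 * p.1 + 2 * p.2 ∧ 1 < 2 * p.1 + 4 * p.2}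
      (fun p : ℝ × ℝ => contactEntropy₂ p.1 p.2) := by
  -- convex combinations of two numbers on the same side of a bound stay on that side
  have cvx : ∀ {c d p q M : ℝ}, 0 ≤ c → 0 ≤ d → c + d = 1 → p < M → q < M → c * p + d * q < M := by
    intro c d p q M hc hd hcd hp hq
    have h1 : c * p ≤ c * max p q := mul_le_mul_of_nonneg_left (le_max_left _ _) hc
    have h2 : d * q ≤ d * max p q := mul_le_mul_of_nonneg_left (le_max_right _ _) hd
    have h3 : c * max p q + d * max p q = max p q := by rw [← add_mul, hcd, one_mul]
    have h4 : max p q < M := max_lt hp hq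
    linarith
  have tri : ∀ {c d : ℝ} {P Q : ℝ × ℝ}, 0 ≤ c → 0 ≤ d → c + d = 1 →
      (P.1 + P.2 < 1 / 2 ∧ 1 < 4 * P.1 + 2 * P.2 ∧ 1 < 2 * P.1 + 4 * P.2) →
      (Q.1 + Q.2 < 1 / 2 ∧ 1 < 4 * Q.1 + 2 * Q.2 ∧ 1 < 2 * Q.1 + 4 * Q.2) →
      (c * P.1 + d * Q.1 + (c * P.2 + d * Q.2) < 1 / 2 ∧ 1 < 4 * (c * P.1 + d * Q.1) + 2 * (c * P.2 + d * Q.2) ∧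
        1 < 2 * (c * P.1 + d * Q.1) + 4 * (c * P.2 + d * Q.2)) := by
    intro c d P Q hc hd hcd hP hQ
    obtain ⟨p1, p2, p3⟩ := hP
    obtain ⟨q1, q2, q3⟩ := hQ
    refine ⟨?_, ?_, ?_⟩
    · have := cvx hc hd hcd p1 q1; linarith
    · have := cvx hc hd hcd (neg_lt_neg p2) (neg_lt_neg q2); linarith
    · have := cvx hc hd hcd (neg_lt_neg p3) (neg_lt_neg q3); linarith
  refine ⟨?_, ?_⟩
  · -- the triangle is convex
    intro P hP Q hQ c d hc hd hcd
    simp only [Set.mem_setOf_eq, Prod.fst_add, Prod.snd_add, Prod.smul_fst, Prod.smul_snd, smul_eq_mul] at hP hQ ⊢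
    exact tri hc hd hcd hP hQ
  · intro P hP Q hQ hPQ c d hc hd hcd
    simp only [Set.mem_setOf_eq] at hP hQ
    obtain ⟨m1, m2, m3⟩ := tri hc.le hd.le hcd hP hQ
    obtain ⟨p1, p2, p3⟩ := hP
    obtain ⟨q1, q2, q3⟩ := hQ
    simp only [Prod.fst_add, Prod.snd_add, Prod.smul_fst, Prod.smul_snd, smul_eq_mul]
    obtain ⟨hY0, hZ0, hbM, hbM', -, -⟩ := contactB_eosY m1 m2 m3
    set YM := eosY (c * P.1 + d * Q.1) (c * P.2 + d * Q.2) with hYM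
    set ZM := eosY (c * P.2 + d * Q.2) (c * P.1 + d * Q.1) with hZM
    -- `P`'s tilt differs from `M`'s tilt (else the densities coincide and `P = Q`)
    have hneP : YM ≠ eosY P.1 P.2 ∨ ZM ≠ eosY P.2 P.1 := by
      by_contra h
      rw [not_or, not_not, not_not] at h
      obtain ⟨-, -, hbP, hbP', -, -⟩ := contactB_eosY p1 p2 p3
      have e1 : c * P.1 + d * Q.1 = P.1 := by rw [← hbM, ← hbP, ← h.1, ← h.2]
      have e2 : c * P.2 + d * Q.2 = P.2 := by rw [← hbM', ← hbP', ← h.1, ← h.2]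
      apply hPQ
      have hd0 : d ≠ 0 := hd.ne'
      refine Prod.ext ?_ ?_
      · rcases mul_eq_zero.1 (by linear_combination e1 - P.1 * hcd : d * (Q.1 - P.1) = 0) with h0 | h0
        · exact absurd h0 hd0
        · linarith
      · rcases mul_eq_zero.1 (by linear_combination e2 - P.2 * hcd : d * (Q.2 - P.2) = 0) with h0 | h0
        · exact absurd h0 hd0
        · linarith
    have hneQ : YM ≠ eosY Q.1 Q.2 ∨ ZM ≠ eosY Q.2 Q.1 := by
      by_contra h
      rw [not_or, not_not, not_not] at h
      obtain ⟨-, -, hbQ, hbQ', -, -⟩ := contactB_eosY q1 q2 q3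
      have e1 : c * P.1 + d * Q.1 = Q.1 := by rw [← hbM, ← hbQ, ← h.1, ← h.2]
      have e2 : c * P.2 + d * Q.2 = Q.2 := by rw [← hbM', ← hbQ', ← h.1, ← h.2]
      apply hPQ
      have hc0 : c ≠ 0 := hc.ne'
      refine Prod.ext ?_ ?_
      · rcases mul_eq_zero.1 (by linear_combination e1 - Q.1 * hcd : c * (P.1 - Q.1) = 0) with h0 | h0
        · exact absurd h0 hc0
        · linarith
      · rcases mul_eq_zero.1 (by linear_combination e2 - Q.2 * hcd : c * (P.2 - Q.2) = 0) with h0 | h0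
        · exact absurd h0 hc0
        · linarith
    -- strict affine bounds at the tilt of `M`, for `P` and for `Q`; equality for `M`
    have hP' := (contactEntropy₂_le p1 p2 p3 hY0 hZ0).2 hneP
    have hQ' := (contactEntropy₂_le q1 q2 q3 hY0 hZ0).2 hneQ
    have hM : contactEntropy₂ (c * P.1 + d * Q.1) (c * P.2 + d * Q.2) =
        Real.log (stripMuY₂ 1 YM ZM) - (c * P.1 + d * Q.1) * Real.log YM - (c * P.2 + d * Q.2) * Real.log ZM := rfl
    rw [hM]
    have k1 := mul_lt_mul_of_pos_left hP' hc
    have k2 := mul_lt_mul_of_pos_left hQ' hd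
    have k3 := congrArg (fun t => Real.log (stripMuY₂ 1 YM ZM) * t) hcd
    simp only [mul_add, mul_one] at k3
    nlinarith [k1, k2, k3]

open Classical in
/-- ★★★ **THE ENTROPY OF STRIP SELF-AVOIDING WALKS WITH TWO PRESCRIBED CONTACT DENSITIES** (north-east side): for `(a,a')` in the density triangle whose
tilt satisfies `Y(a,a') ≥ 1`, `Y(a',a) ≥ 1` (both densities at least the uniform walk's `b(1,1) = v/4 ≈ 0.2057`),
`(1/N) log #{ω ∈ S_N(S_1) : bc(ω) ≥ aN and tc(ω) ≥ a'N} → s(a,a')` — the walk COUNTS grow like `exp(N·s(a,a'))` with the elementary `s` of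
`contactEntropy₂_eq`. [cite: JansevanRensburg2000, §3.2 Theorems 3.17–3.19 (1st ed., pp. 50–52: integrated density functions); HammersleyTorrieWhittington1982, §3; BeatonBousquetMelouDeGierDuminilCopinGuttmann2014, §3.2 Proposition 6 (arXiv v5 p. 10)] -/
theorem tendsto_log_card_contacts_NE_div {a a' : ℝ} (h1 : a + a' < 1 / 2) (h2 : 1 < 4 * a + 2 * a') (h3 : 1 < 2 * a + 4 * a')
    (hY1 : 1 ≤ eosY a a') (hZ1 : 1 ≤ eosY a' a) :
    Tendsto (fun N : ℕ => Real.log (((stripPairs 1 N).filter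
        (fun q => a * N ≤ (bottomVisits₀ q.1 q.2 N : ℝ) ∧ a' * N ≤ (topVisits₀ 1 q.1 q.2 N : ℝ))).card : ℝ) / N)
      atTop (𝓝 (contactEntropy₂ a a')) := by
  obtain ⟨hY0, hZ0, hb, hb', -, -⟩ := contactB_eosY h1 h2 h3
  have hldp := tendsto_log_contacts_NE_div one_pos one_pos hY1 hZ1
  have hpos := eventually_NE_sum_pos one_pos one_pos hY0 hZ0
  rw [hb, hb'] at hldp hpos
  have hlim := hldp.add (tendsto_log_stripZ₂_one_div one_pos one_pos)
  have e : -jointRate 1 1 (eosY a a') (eosY a' a) + Real.log (stripMuY₂ 1 1 1) = contactEntropy₂ a a' := by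
    rw [jointRate_eq_sub_contactEntropy₂ one_pos one_pos h1 h2 h3, Real.log_one]; ring
  rw [e] at hlim
  refine hlim.congr' ?_
  filter_upwards [hpos] with N hN
  have hZ := stripZ₂_pos 1 N one_pos one_pos
  have hcard : (∑ q ∈ (stripPairs 1 N).filter
      (fun q => a * N ≤ (bottomVisits₀ q.1 q.2 N : ℝ) ∧ a' * N ≤ (topVisits₀ 1 q.1 q.2 N : ℝ)), wgt 1 1 N q) =
      (((stripPairs 1 N).filter
        (fun q => a * N ≤ (bottomVisits₀ q.1 q.2 N : ℝ) ∧ a' * N ≤ (topVisits₀ 1 q.1 q.2 N : ℝ))).card : ℝ) := by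
    simp [wgt]
  rw [← hcard, ← add_div, Real.log_div hN.ne' hZ.ne']
  ring

open Classical in
/-- ★★★ **… south-west side**: for `(a,a')` in the triangle with `Y(a,a') ≤ 1`, `Y(a',a) ≤ 1` (both densities at most `b(1,1)`),
`(1/N) log #{ω ∈ S_N(S_1) : bc(ω) ≤ aN and tc(ω) ≤ a'N} → s(a,a')`. [cite: JansevanRensburg2000, §3.2 Theorems 3.17–3.19 (1st ed., pp. 50–52); HammersleyTorrieWhittington1982, §3; BeatonBousquetMelouDeGierDuminilCopinGuttmann2014, §3.2 Proposition 6 (arXiv v5 p. 10)] -/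
theorem tendsto_log_card_contacts_SW_div {a a' : ℝ} (h1 : a + a' < 1 / 2) (h2 : 1 < 4 * a + 2 * a') (h3 : 1 < 2 * a + 4 * a')
    (hY1 : eosY a a' ≤ 1) (hZ1 : eosY a' a ≤ 1) :
    Tendsto (fun N : ℕ => Real.log (((stripPairs 1 N).filter
        (fun q => (bottomVisits₀ q.1 q.2 N : ℝ) ≤ a * N ∧ (topVisits₀ 1 q.1 q.2 N : ℝ) ≤ a' * N)).card : ℝ) / N)
      atTop (𝓝 (contactEntropy₂ a a')) := by
  obtain ⟨hY0, hZ0, hb, hb', -, -⟩ := contactB_eosY h1 h2 h3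
  have hldp := tendsto_log_contacts_SW_div one_pos one_pos hY0 hY1 hZ0 hZ1
  have hpos := eventually_SW_sum_pos one_pos one_pos hY0 hZ0
  rw [hb, hb'] at hldp hpos
  have hlim := hldp.add (tendsto_log_stripZ₂_one_div one_pos one_pos)
  have e : -jointRate 1 1 (eosY a a') (eosY a' a) + Real.log (stripMuY₂ 1 1 1) = contactEntropy₂ a a' := by
    rw [jointRate_eq_sub_contactEntropy₂ one_pos one_pos h1 h2 h3, Real.log_one]; ring
  rw [e] at hlim
  refine hlim.congr' ?_
  filter_upwards [hpos] with N hN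
  have hZ := stripZ₂_pos 1 N one_pos one_pos
  have hcard : (∑ q ∈ (stripPairs 1 N).filter
      (fun q => (bottomVisits₀ q.1 q.2 N : ℝ) ≤ a * N ∧ (topVisits₀ 1 q.1 q.2 N : ℝ) ≤ a' * N), wgt 1 1 N q) =
      (((stripPairs 1 N).filter
        (fun q => (bottomVisits₀ q.1 q.2 N : ℝ) ≤ a * N ∧ (topVisits₀ 1 q.1 q.2 N : ℝ) ≤ a' * N)).card : ℝ) := by
    simp [wgt]
  rw [← hcard, ← add_div, Real.log_div hN.ne' hZ.ne']
  ring

/-- ★★ **THE ENTROPY IS BOUNDED BY THE CONNECTIVE CONSTANT and attains it only at the uniform densities**: `s(a,a') ≤ log μ(S_1)` on the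
triangle, with equality iff `(a,a') = (b(1,1), b(1,1))` (`= ((μ+1)/(2(2μ+3)), ·)`, the contact densities of the uniform strip walk).
[cite: JansevanRensburg2000, §3.3 (1st ed.: the maximum of the density function is the growth constant); MadrasSlade1993, §1.1 eq. (1.1.5)] -/
theorem contactEntropy₂_le_log_stripConnectiveConstant {a a' : ℝ} (h1 : a + a' < 1 / 2) (h2 : 1 < 4 * a + 2 * a') (h3 : 1 < 2 * a + 4 * a') :
    contactEntropy₂ a a' ≤ Real.log (stripConnectiveConstant 1) ∧
      ((a ≠ contactB 1 1 ∨ a' ≠ contactB 1 1) → contactEntropy₂ a a' < Real.log (stripConnectiveConstant 1)) := by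
  rw [← stripMuY₂_one_one_one 1]
  obtain ⟨hmax, hstrict⟩ := isGreatest_log_stripMuY₂_energy_add_entropy one_pos one_pos
  refine ⟨?_, fun hne => ?_⟩
  · have := hmax.2 ⟨a, a', h1, h2, h3, rfl⟩
    simpa [Real.log_one] using this
  · have := hstrict a a' h1 h2 h3 hne
    simpa [Real.log_one] using this

/-! ## §9 (ed.4) The contraction principle: the one-wall rate is the joint rate minimised over the hidden density -/

/-- On the horizontal line `Z = z` the joint rate is the one-wall rate: `J(y,z;Y,z) = I(y,z;Y)`.
[cite: DemboZeitouni2010, §2.2 Theorem 2.2.3 (lane plumbing)] -/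
theorem jointRate_eq_contactRate_of_eq (hz : 0 < z) (y Y : ℝ) : jointRate y z Y z = contactRate y z Y := by
  unfold jointRate contactRate
  rw [div_self hz.ne', Real.log_one, mul_zero, add_zero]

open Classical in
/-- ★★★ **THE CONTRACTION PRINCIPLE, upper side**: for `y ≤ Y₁` and ANY tilt `(Y,Z)` with `Y ≥ y` and the SAME bottom density
`b(Y,Z) = b(Y₁,z)`: `I(y,z;Y₁) ≤ J(y,z;Y,Z)`, with equality at `(Y,Z) = (Y₁,z)` — the one-wall rate function at the level `a = b(Y₁,z)` is the
MINIMUM of the joint rate over the unobserved top density, and the minimiser is the top density `b(z,Y₁)` produced by the one-wall tilt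
(DZ's contraction principle for the projection `(bc,tc) ↦ bc`, here by the event inclusion `{bc ≥ aN, tc ≷ a'N} ⊂ {bc ≥ aN}` and the two
limits). [cite: DemboZeitouni2010, §4.2 Theorem 4.2.1 (contraction principle) and §2.2 Theorem 2.2.3; BeatonBousquetMelouDeGierDuminilCopinGuttmann2014, §3.2 Proposition 6 (arXiv v5 p. 10)] -/
theorem contactRate_le_jointRate (hy : 0 < y) (hz : 0 < z) {Y₁ Y Z : ℝ} (hyY₁ : y ≤ Y₁) (hyY : y ≤ Y) (hZ : 0 < Z)
    (heq : contactB Y Z = contactB Y₁ z) :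
    contactRate y z Y₁ ≤ jointRate y z Y Z ∧ jointRate y z Y₁ z = contactRate y z Y₁ := by
  refine ⟨?_, jointRate_eq_contactRate_of_eq hz y Y₁⟩
  have hY : 0 < Y := hy.trans_le hyY
  have h1 := tendsto_log_contacts_ge_div hy hz hyY₁
  rw [← heq] at h1
  set a := contactB Y Z with ha
  set a' := contactB Z Y with ha'
  rcases le_total z Z with hzZ | hZz
  · -- north-east tilt
    have hJ := tendsto_log_contacts_NE_div hy hz hyY hzZ
    have hpos := eventually_NE_sum_pos hy hz hY hZ
    have hle : ∀ᶠ N : ℕ in atTop, Real.log ((∑ q ∈ (stripPairs 1 N).filter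
        (fun q => a * N ≤ (bottomVisits₀ q.1 q.2 N : ℝ) ∧ a' * N ≤ (topVisits₀ 1 q.1 q.2 N : ℝ)), wgt y z N q) /
          stripZ₂ 1 N y z) / N ≤
        Real.log ((∑ q ∈ (stripPairs 1 N).filter (fun q => a * N ≤ (bottomVisits₀ q.1 q.2 N : ℝ)), wgt y z N q) /
          stripZ₂ 1 N y z) / N := by
      filter_upwards [hpos] with N hN
      have hZN := stripZ₂_pos 1 N hy hz
      refine div_le_div_of_nonneg_right ?_ (Nat.cast_nonneg N)
      refine Real.log_le_log (div_pos hN hZN) (div_le_div_of_nonneg_right ?_ hZN.le)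
      refine Finset.sum_le_sum_of_subset_of_nonneg (fun q hq => ?_) fun q _ _ => wgt_nonneg hy.le hz.le N q
      rw [Finset.mem_filter] at hq ⊢
      exact ⟨hq.1, hq.2.1⟩
    have := le_of_tendsto_of_tendsto hJ h1 hle
    linarith
  · -- north-west tilt
    have hJ := tendsto_log_contacts_NW_div hy hz hyY hZ hZz
    -- positivity of the NW event: it contains the NE∩… no; use the box around the interior tilt of the NW proof? Simpler: the NW sum
    -- dominates nothing we have; instead bound BELOW by comparison is not needed — we need an upper bound `≤ {bc ≥ aN}`, and for the
    -- logarithm to be monotone we need the NW sum positive, which follows from its limit being finite: use the SW∪NE trick: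
    -- the NW event contains the box event of `eventually_half_le_boxSum` at the tilt `(Y(a+δ, a'−δ), Y(a'−δ, a+δ))`.
    obtain ⟨t1, t2, t3⟩ := contactB_mem_triangle hY hZ
    set δ := (2 * a + 4 * a' - 1) / 8 with hδ
    have hδ0 : 0 < δ := by rw [hδ]; linarith
    have s1 : (a + δ) + (a' + (-1) * δ) < 1 / 2 := by linarith
    have s2 : 1 < 4 * (a + δ) + 2 * (a' + (-1) * δ) := by linarith
    have s3 : 1 < 2 * (a + δ) + 4 * (a' + (-1) * δ) := by rw [hδ]; linarith
    obtain ⟨hY'0, hZ'0, hbY', hbZ', -, -⟩ := contactB_eosY s1 s2 s3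
    have hb1 : a < contactB (eosY (a + δ) (a' + (-1) * δ)) (eosY (a' + (-1) * δ) (a + δ)) := by rw [hbY']; linarith
    have hb2 : contactB (eosY (a + δ) (a' + (-1) * δ)) (eosY (a' + (-1) * δ) (a + δ)) < a + 2 * δ := by rw [hbY']; linarith
    have hb1' : a' + (-2) * δ < contactB (eosY (a' + (-1) * δ) (a + δ)) (eosY (a + δ) (a' + (-1) * δ)) := by rw [hbZ']; linarith
    have hb2' : contactB (eosY (a' + (-1) * δ) (a + δ)) (eosY (a + δ) (a' + (-1) * δ)) < a' := by rw [hbZ']; linarith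
    have hpos : ∀ᶠ N : ℕ in atTop, 0 < ∑ q ∈ (stripPairs 1 N).filter
        (fun q => a * N ≤ (bottomVisits₀ q.1 q.2 N : ℝ) ∧ (topVisits₀ 1 q.1 q.2 N : ℝ) ≤ a' * N), wgt y z N q := by
      filter_upwards [eventually_half_le_boxSum hY'0 hZ'0 hb1 hb2 hb1' hb2'] with N hN
      have hZpos := stripZ₂_pos 1 N hY'0 hZ'0
      have hne : ((stripPairs 1 N).filter (fun q => (a * N ≤ (bottomVisits₀ q.1 q.2 N : ℝ) ∧
          (bottomVisits₀ q.1 q.2 N : ℝ) ≤ (a + 2 * δ) * N) ∧ ((a' + (-2) * δ) * N ≤ (topVisits₀ 1 q.1 q.2 N : ℝ) ∧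
          (topVisits₀ 1 q.1 q.2 N : ℝ) ≤ a' * N))).Nonempty := by
        by_contra h
        rw [Finset.not_nonempty_iff_eq_empty] at h
        rw [h, Finset.sum_empty] at hN
        linarith
      obtain ⟨q, hq⟩ := hne
      rw [Finset.mem_filter] at hq
      refine Finset.sum_pos (fun q _ => wgt_pos hy hz N q) ⟨q, ?_⟩
      rw [Finset.mem_filter]
      exact ⟨hq.1, hq.2.1.1, hq.2.2.2⟩
    have hle : ∀ᶠ N : ℕ in atTop, Real.log ((∑ q ∈ (stripPairs 1 N).filter
        (fun q => a * N ≤ (bottomVisits₀ q.1 q.2 N : ℝ) ∧ (topVisits₀ 1 q.1 q.2 N : ℝ) ≤ a' * N), wgt y z N q) /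
          stripZ₂ 1 N y z) / N ≤
        Real.log ((∑ q ∈ (stripPairs 1 N).filter (fun q => a * N ≤ (bottomVisits₀ q.1 q.2 N : ℝ)), wgt y z N q) /
          stripZ₂ 1 N y z) / N := by
      filter_upwards [hpos] with N hN
      have hZN := stripZ₂_pos 1 N hy hz
      refine div_le_div_of_nonneg_right ?_ (Nat.cast_nonneg N)
      refine Real.log_le_log (div_pos hN hZN) (div_le_div_of_nonneg_right ?_ hZN.le)
      refine Finset.sum_le_sum_of_subset_of_nonneg (fun q hq => ?_) fun q _ _ => wgt_nonneg hy.le hz.le N q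
      rw [Finset.mem_filter] at hq ⊢
      exact ⟨hq.1, hq.2.1⟩
    have := le_of_tendsto_of_tendsto hJ h1 hle
    linarith

/-- ★★★ **THE CONTRACTION PRINCIPLE IN DENSITY COORDINATES**: for a bottom density `a ∈ (b(y,z), 1/2)` the one-wall LEVEL RATE `I*_{y,z}(a)`
(`levelRate`, parent §10) is the minimum of the closed-form joint rate over the top densities `a'` with `(a,a')` in the triangle and tilt
`Y(a,a') ≥ y`: `I*(a) ≤ J(y,z; Y(a,a'), Y(a',a))`, with equality at `a' = b(z, Y_a)`.
[cite: DemboZeitouni2010, §4.2 Theorem 4.2.1 (contraction principle); JansevanRensburg2000, §3.2 Theorem 3.19 (1st ed., p. 52)] -/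
theorem levelRate_le_jointRate_eosY (hy : 0 < y) (hz : 0 < z) {a a' : ℝ} (ha : contactB y z < a) (h1 : a + a' < 1 / 2)
    (h2 : 1 < 4 * a + 2 * a') (h3 : 1 < 2 * a + 4 * a') (hyY : y ≤ eosY a a') :
    levelRate y z a ≤ jointRate y z (eosY a a') (eosY a' a) ∧
      levelRate y z a = jointRate y z (levelY z a) z := by
  have ha2 : a < 1 / 2 := by linarith
  have ha0 : 0 < a := by linarith
  obtain ⟨hYa, hbYa⟩ := levelY_spec hz ha0 ha2
  obtain ⟨hY0, hZ0, hb, -, -, -⟩ := contactB_eosY h1 h2 h3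
  have hyYa : y ≤ levelY z a := ((lt_levelY_iff hz ha0 ha2 hy).1.2 ha).le
  obtain ⟨hle, heq⟩ := contactRate_le_jointRate hy hz hyYa hyY hZ0 (by rw [hb, hbYa])
  unfold levelRate
  exact ⟨hle, heq.symm⟩

/-- ★★★ **THE ONE-DENSITY ENTROPY IS THE SUP-CONVOLUTION OF THE TWO-DENSITY ENTROPY** (contraction at the level of entropies): for every top
fugacity `z > 0`, every bottom density `a` and every admissible top density `a'` (i.e. `(a,a')` in the open triangle),
`s(a,a') + a'·log z ≤ σ_z(a)` — the parent's contact entropy `contactEntropy z a = log μ_1(Y_a,z) − a log Y_a` — with EQUALITY at the top density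
`a' = b(z, Y_a)` of the one-wall tilt; at `z = 1`: `σ(a) = max_{a'} s(a,a')` (the number of walks with `bc ≈ aN` is governed by the most numerous
top density).  [The bound does not involve the base point: it is `levelRate_le_jointRate_eosY` in Gibbs form at a base `y` chosen below both tilts.]
[cite: DemboZeitouni2010, §4.2 Theorem 4.2.1 (contraction principle); JansevanRensburg2000, §3.2 Theorems 3.18–3.19 (1st ed., pp. 51–52)] -/
theorem contactEntropy₂_add_le_contactEntropy (hz : 0 < z) {a a' : ℝ} (h1 : a + a' < 1 / 2) (h2 : 1 < 4 * a + 2 * a')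
    (h3 : 1 < 2 * a + 4 * a') :
    contactEntropy₂ a a' + a' * Real.log z ≤ contactEntropy z a ∧
      contactEntropy₂ a (contactB z (levelY z a)) + contactB z (levelY z a) * Real.log z = contactEntropy z a := by
  have ha0 : 0 < a := by linarith
  have ha2 : a < 1 / 2 := by linarith
  obtain ⟨hYa, hbYa⟩ := levelY_spec hz ha0 ha2
  obtain ⟨hY0, hZ0, hb, hb', -, -⟩ := contactB_eosY h1 h2 h3
  constructor
  · -- a base point `y` below both tilts with `b(y,z) < a`
    obtain ⟨y₀, hy₀, hby₀⟩ := exists_pos_contactB_eq hz (by linarith : 0 < a / 2) (by linarith : a / 2 < 1 / 2)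
    set y := min y₀ (eosY a a') with hy
    have hypos : 0 < y := lt_min hy₀ hY0
    have hyY : y ≤ eosY a a' := min_le_right _ _
    have hba : contactB y z < a := by
      have := contactB_mono_left hypos hz (min_le_left y₀ (eosY a a'))
      rw [hby₀] at this; linarith
    obtain ⟨hle, -⟩ := levelRate_le_jointRate_eosY hypos hz hba h1 h2 h3 hyY
    have hG := jointRate_eq_sub_contactEntropy₂ hypos hz h1 h2 h3
    -- `levelRate y z a = I(y,z;Y_a)` in entropy form
    have hL : levelRate y z a = a * Real.log (levelY z a / y) -
        Real.log (stripMuY₂ 1 (levelY z a) z / stripMuY₂ 1 y z) := by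
      unfold levelRate contactRate; rw [hbYa]
    rw [hL, Real.log_div hYa.ne' hypos.ne', Real.log_div (stripMuY₂_pos 1 hYa hz).ne' (stripMuY₂_pos 1 hypos hz).ne'] at hle
    rw [hG] at hle
    unfold contactEntropy
    linarith
  · -- equality at the one-wall tilt `(Y_a, z)`: its density pair is `(a, b(z,Y_a))` and its `eosY` images are `(Y_a, z)`
    obtain ⟨e1, e2⟩ := eosY_contactB hYa hz
    rw [hbYa] at e1 e2
    unfold contactEntropy₂ contactEntropy
    rw [e1, e2]
    ring

/-! ## §10 (ed.4) Cramér in EVERY direction: the large deviations of each linear contact statistic `u·bc + v·tc` -/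

open Classical in
/-- ★ **Half-plane Chernoff**: for the tilt `(Y,Z) = (y e^{κu}, z e^{κv})` along the log-direction `(u,v)` with `κ ≥ 0` and any level `c`,
`(Σ_{q : cN ≤ u·bc + v·tc} y^{bc} z^{tc}) · (e^{κc})^{N} ≤ C_{1,N}(Y,Z)` (on the event the weight ratio `(Y/y)^{bc}(Z/z)^{tc} = e^{κ(u bc + v tc)}`
is at least `e^{κcN}`). [cite: DemboZeitouni2010, §2.2 Theorem 2.2.3 (Chebycheff step); BeatonBousquetMelouDeGierDuminilCopinGuttmann2014, §3.2 (arXiv v5 p. 10)] -/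
theorem sum_halfPlane_mul_exp_le (hy : 0 ≤ y) (hz : 0 ≤ z) (u v : ℝ) {κ : ℝ} (hκ : 0 ≤ κ) (c : ℝ) (N : ℕ) :
    (∑ q ∈ (stripPairs 1 N).filter (fun q => c * N ≤ u * (bottomVisits₀ q.1 q.2 N : ℝ) + v * (topVisits₀ 1 q.1 q.2 N : ℝ)),
        wgt y z N q) * Real.exp (κ * c) ^ ((1 : ℝ) * N + 0) ≤
      stripZ₂ 1 N (y * Real.exp (κ * u)) (z * Real.exp (κ * v)) := by
  rw [Finset.sum_mul, stripZ₂_one_eq_sum_wgt]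
  have hpow : Real.exp (κ * c) ^ ((1 : ℝ) * N + 0) = Real.exp (κ * c * N) := by
    rw [add_zero, one_mul, Real.rpow_natCast, ← Real.exp_nat_mul]; ring_nf
  rw [hpow]
  calc ∑ q ∈ (stripPairs 1 N).filter (fun q => c * N ≤ u * (bottomVisits₀ q.1 q.2 N : ℝ) + v * (topVisits₀ 1 q.1 q.2 N : ℝ)),
        wgt y z N q * Real.exp (κ * c * N)
      ≤ ∑ q ∈ (stripPairs 1 N).filter (fun q => c * N ≤ u * (bottomVisits₀ q.1 q.2 N : ℝ) + v * (topVisits₀ 1 q.1 q.2 N : ℝ)),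
          wgt (y * Real.exp (κ * u)) (z * Real.exp (κ * v)) N q :=
        Finset.sum_le_sum fun q hq => by
          obtain ⟨-, hq⟩ := Finset.mem_filter.1 hq
          have hE : Real.exp (κ * c * N) ≤
              Real.exp (κ * u) ^ bottomVisits₀ q.1 q.2 N * Real.exp (κ * v) ^ topVisits₀ 1 q.1 q.2 N := by
            rw [← Real.exp_nat_mul, ← Real.exp_nat_mul, ← Real.exp_add]
            apply Real.exp_le_exp.2
            have := mul_le_mul_of_nonneg_left hq hκ
            nlinarith
          calc wgt y z N q * Real.exp (κ * c * N)
              ≤ wgt y z N q * (Real.exp (κ * u) ^ bottomVisits₀ q.1 q.2 N * Real.exp (κ * v) ^ topVisits₀ 1 q.1 q.2 N) :=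
                mul_le_mul_of_nonneg_left hE (wgt_nonneg hy hz N q)
            _ = wgt (y * Real.exp (κ * u)) (z * Real.exp (κ * v)) N q := by rw [wgt_tilt₂, mul_assoc]
    _ ≤ ∑ q ∈ stripPairs 1 N, wgt (y * Real.exp (κ * u)) (z * Real.exp (κ * v)) N q :=
        Finset.sum_le_sum_of_subset_of_nonneg (Finset.filter_subset _ _) fun q _ _ =>
          wgt_nonneg (mul_nonneg hy (Real.exp_pos _).le) (mul_nonneg hz (Real.exp_pos _).le) N q

/-- ★★ **The directional statistic is STRICTLY increasing along its own tilt direction**: for `(u,v) ≠ (0,0)` and `δ > 0`, with `(Y',Z') = (Y e^{δu}, Z e^{δv})`: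
`u·b(Y,Z) + v·b(Z,Y) < u·b(Y',Z') + v·b(Z',Y')` (sum of the two strict supporting planes `tangent₂_lt` at `(Y,Z)` and at `(Y',Z')` = strict
monotonicity of the gradient along a line). [cite: DemboZeitouni2010, §2.3 Definition 2.3.5 (steepness along a direction); BeatonBousquetMelouDeGierDuminilCopinGuttmann2014, §3.2 Proposition 6 (arXiv v5 p. 10)] -/
theorem linStat_lt_of_tilt {Y Z : ℝ} (hY : 0 < Y) (hZ : 0 < Z) {u v δ : ℝ} (huv : u ≠ 0 ∨ v ≠ 0) (hδ : 0 < δ) :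
    u * contactB Y Z + v * contactB Z Y <
      u * contactB (Y * Real.exp (δ * u)) (Z * Real.exp (δ * v)) + v * contactB (Z * Real.exp (δ * v)) (Y * Real.exp (δ * u)) := by
  set Y' := Y * Real.exp (δ * u) with hY'
  set Z' := Z * Real.exp (δ * v) with hZ'
  have hY'0 : 0 < Y' := mul_pos hY (Real.exp_pos _)
  have hZ'0 : 0 < Z' := mul_pos hZ (Real.exp_pos _)
  have hne : Y ≠ Y' ∨ Z ≠ Z' := by
    rcases huv with hu | hv
    · left; rw [hY']; intro h
      have : Real.exp (δ * u) = 1 := by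
        have h1 : Y * Real.exp (δ * u) = Y * 1 := by rw [mul_one]; exact h.symm
        exact mul_left_cancel₀ hY.ne' h1
      rw [Real.exp_eq_one_iff] at this
      exact hu ((mul_eq_zero.1 this).resolve_left hδ.ne')
    · right; rw [hZ']; intro h
      have : Real.exp (δ * v) = 1 := by
        have h1 : Z * Real.exp (δ * v) = Z * 1 := by rw [mul_one]; exact h.symm
        exact mul_left_cancel₀ hZ.ne' h1
      rw [Real.exp_eq_one_iff] at this
      exact hv ((mul_eq_zero.1 this).resolve_left hδ.ne')
  have h1 := tangent₂_lt hY hZ hY'0 hZ'0 hne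
  have h2 := tangent₂_lt hY'0 hZ'0 hY hZ (hne.imp Ne.symm Ne.symm)
  have eY : Real.log Y' - Real.log Y = δ * u := by
    rw [hY', Real.log_mul hY.ne' (Real.exp_pos _).ne', Real.log_exp]; ring
  have eZ : Real.log Z' - Real.log Z = δ * v := by
    rw [hZ', Real.log_mul hZ.ne' (Real.exp_pos _).ne', Real.log_exp]; ring
  -- add the two strict inequalities: the free-energy terms cancel
  have hsum : 0 < (contactB Y' Z' - contactB Y Z) * (Real.log Y' - Real.log Y) +
      (contactB Z' Y' - contactB Z Y) * (Real.log Z' - Real.log Z) := by linarith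
  rw [eY, eZ] at hsum
  nlinarith

/-- The box cost along the directional tilt is continuous at `δ = 0` with value `J(y,z;Y,Z)` (for the lower bound of the directional LDP).
[cite: DemboZeitouni2010, §2.2 (lane plumbing)] -/
theorem continuousAt_dirCost (hy : 0 < y) (hz : 0 < z) {Y Z : ℝ} (hY : 0 < Y) (hZ : 0 < Z) (u v w : ℝ) :
    ContinuousAt (fun δ : ℝ =>
      max ((contactB (Y * Real.exp (δ * u)) (Z * Real.exp (δ * v)) - w * δ) * Real.log (Y * Real.exp (δ * u) / y))
          ((contactB (Y * Real.exp (δ * u)) (Z * Real.exp (δ * v)) + w * δ) * Real.log (Y * Real.exp (δ * u) / y)) +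
        max ((contactB (Z * Real.exp (δ * v)) (Y * Real.exp (δ * u)) - w * δ) * Real.log (Z * Real.exp (δ * v) / z))
          ((contactB (Z * Real.exp (δ * v)) (Y * Real.exp (δ * u)) + w * δ) * Real.log (Z * Real.exp (δ * v) / z)) -
        Real.log (stripMuY₂ 1 (Y * Real.exp (δ * u)) (Z * Real.exp (δ * v)) / stripMuY₂ 1 y z)) 0 ∧
    (max ((contactB (Y * Real.exp (0 * u)) (Z * Real.exp (0 * v)) - w * 0) * Real.log (Y * Real.exp (0 * u) / y))
          ((contactB (Y * Real.exp (0 * u)) (Z * Real.exp (0 * v)) + w * 0) * Real.log (Y * Real.exp (0 * u) / y)) +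
        max ((contactB (Z * Real.exp (0 * v)) (Y * Real.exp (0 * u)) - w * 0) * Real.log (Z * Real.exp (0 * v) / z))
          ((contactB (Z * Real.exp (0 * v)) (Y * Real.exp (0 * u)) + w * 0) * Real.log (Z * Real.exp (0 * v) / z)) -
        Real.log (stripMuY₂ 1 (Y * Real.exp (0 * u)) (Z * Real.exp (0 * v)) / stripMuY₂ 1 y z) = jointRate y z Y Z) := by
  have hpath : ContinuousAt (fun δ : ℝ => (Y * Real.exp (δ * u), Z * Real.exp (δ * v))) 0 :=
    (continuousAt_const.mul ((continuousAt_id.mul continuousAt_const).rexp)).prodMk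
      (continuousAt_const.mul ((continuousAt_id.mul continuousAt_const).rexp))
  have hpath' : ContinuousAt (fun δ : ℝ => (Z * Real.exp (δ * v), Y * Real.exp (δ * u))) 0 :=
    (continuousAt_const.mul ((continuousAt_id.mul continuousAt_const).rexp)).prodMk
      (continuousAt_const.mul ((continuousAt_id.mul continuousAt_const).rexp))
  have h0 : (fun δ : ℝ => (Y * Real.exp (δ * u), Z * Real.exp (δ * v))) 0 = (Y, Z) := by simp
  have h0' : (fun δ : ℝ => (Z * Real.exp (δ * v), Y * Real.exp (δ * u))) 0 = (Z, Y) := by simp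
  have hb : ContinuousAt (fun δ : ℝ => contactB (Y * Real.exp (δ * u)) (Z * Real.exp (δ * v))) 0 := by
    have h := continuousAt_contactB₂ hY hZ
    rw [← h0] at h
    exact ContinuousAt.comp (f := fun δ : ℝ => (Y * Real.exp (δ * u), Z * Real.exp (δ * v)))
      (g := fun p : ℝ × ℝ => contactB p.1 p.2) h hpath
  have hb' : ContinuousAt (fun δ : ℝ => contactB (Z * Real.exp (δ * v)) (Y * Real.exp (δ * u))) 0 := by
    have h := continuousAt_contactB₂ hZ hY
    rw [← h0'] at h
    exact ContinuousAt.comp (f := fun δ : ℝ => (Z * Real.exp (δ * v), Y * Real.exp (δ * u)))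
      (g := fun p : ℝ × ℝ => contactB p.1 p.2) h hpath'
  have hYδ : ContinuousAt (fun δ : ℝ => Y * Real.exp (δ * u)) 0 := continuousAt_const.mul ((continuousAt_id.mul continuousAt_const).rexp)
  have hZδ : ContinuousAt (fun δ : ℝ => Z * Real.exp (δ * v)) 0 := continuousAt_const.mul ((continuousAt_id.mul continuousAt_const).rexp)
  have hlog : ContinuousAt (fun δ : ℝ => Real.log (Y * Real.exp (δ * u) / y)) 0 :=
    (hYδ.div_const y).log (by simpa using (div_pos hY hy).ne')
  have hlog' : ContinuousAt (fun δ : ℝ => Real.log (Z * Real.exp (δ * v) / z)) 0 :=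
    (hZδ.div_const z).log (by simpa using (div_pos hZ hz).ne')
  have hμ2 : ContinuousAt (fun p : ℝ × ℝ => stripMuY₂ 1 p.1 p.2) ((fun δ : ℝ => (Y * Real.exp (δ * u), Z * Real.exp (δ * v))) 0) := by
    rw [h0]; exact (continuousOn_stripMuY₂ 1).continuousAt ((isOpen_Ioi.prod isOpen_Ioi).mem_nhds ⟨hY, hZ⟩)
  have hμ : ContinuousAt (fun δ : ℝ => stripMuY₂ 1 (Y * Real.exp (δ * u)) (Z * Real.exp (δ * v))) 0 :=
    ContinuousAt.comp (f := fun δ : ℝ => (Y * Real.exp (δ * u), Z * Real.exp (δ * v)))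
      (g := fun p : ℝ × ℝ => stripMuY₂ 1 p.1 p.2) hμ2 hpath
  have hμlog : ContinuousAt (fun δ : ℝ => Real.log (stripMuY₂ 1 (Y * Real.exp (δ * u)) (Z * Real.exp (δ * v)) / stripMuY₂ 1 y z)) 0 :=
    (hμ.div_const _).log (by simpa using (div_pos (stripMuY₂_pos 1 hY hZ) (stripMuY₂_pos 1 hy hz)).ne')
  have hw : ContinuousAt (fun δ : ℝ => w * δ) 0 := continuousAt_const.mul continuousAt_id
  refine ⟨(((hb.sub hw).mul hlog).max ((hb.add hw).mul hlog)).add (((hb'.sub hw).mul hlog').max ((hb'.add hw).mul hlog')) |>.sub hμlog, ?_⟩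
  simp only [zero_mul, mul_zero, Real.exp_zero, mul_one, sub_zero, add_zero, max_self]
  unfold jointRate
  ring

open Classical in
/-- ★★★ **CRAMÉR IN EVERY DIRECTION — THE LDP OF EACH LINEAR CONTACT STATISTIC `u·bc + v·tc`.**  For every base `y, z > 0`, every direction
`(u,v) ≠ (0,0)` and every `κ > 0`, with the tilt `(Y,Z) = (y e^{κu}, z e^{κv})` along that log-direction and its density pair `(a,a') = (b(Y,Z), b(Z,Y))`:
`lim_{N→∞} (1/N) log P_{N,y,z}(u·bc + v·tc ≥ (u a + v a')·N) = −J(y,z;Y,Z)`.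
The cases `(u,v) = (1,0)` and `(1,1)` are the parent files' one-wall and ray (total-contact) principles; `(1,−1)` is the CONTACT IMBALANCE
`bc − tc`; the lower tail is the case `(−u,−v)`.  Upper bound: the half-plane Chernoff `sum_halfPlane_mul_exp_le`; lower bound: the box around
the density pair of the further tilt `(Y e^{δu}, Z e^{δv})`, which lies strictly inside the half-plane by `linStat_lt_of_tilt` (strict convexity).
[cite: DemboZeitouni2010, §2.2 Theorem 2.2.3 (Cramér) and §2.3 Theorem 2.3.6 (Gärtner–Ellis); JansevanRensburg2000, §3.2 Theorems 3.17–3.19 (1st ed., pp. 50–52); BeatonBousquetMelouDeGierDuminilCopinGuttmann2014, §3.2 Proposition 6 (arXiv v5 p. 10)] -/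
theorem tendsto_log_linStat_ge_div (hy : 0 < y) (hz : 0 < z) {u v κ : ℝ} (huv : u ≠ 0 ∨ v ≠ 0) (hκ : 0 < κ) :
    Tendsto (fun N : ℕ => Real.log ((∑ q ∈ (stripPairs 1 N).filter
        (fun q => (u * contactB (y * Real.exp (κ * u)) (z * Real.exp (κ * v)) +
            v * contactB (z * Real.exp (κ * v)) (y * Real.exp (κ * u))) * N ≤
          u * (bottomVisits₀ q.1 q.2 N : ℝ) + v * (topVisits₀ 1 q.1 q.2 N : ℝ)), wgt y z N q) / stripZ₂ 1 N y z) / N)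
      atTop (𝓝 (-jointRate y z (y * Real.exp (κ * u)) (z * Real.exp (κ * v)))) := by
  set Y := y * Real.exp (κ * u) with hYd
  set Z := z * Real.exp (κ * v) with hZd
  have hY : 0 < Y := mul_pos hy (Real.exp_pos _)
  have hZ : 0 < Z := mul_pos hz (Real.exp_pos _)
  set a := contactB Y Z with ha
  set a' := contactB Z Y with ha'
  have hℓ : Real.log (Y / y) = κ * u := by rw [hYd, mul_div_cancel_left₀ _ hy.ne', Real.log_exp]
  have hℓ' : Real.log (Z / z) = κ * v := by rw [hZd, mul_div_cancel_left₀ _ hz.ne', Real.log_exp]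
  refine tendsto_log_div_of_exp_bounds (fun ε hε => ?_) (fun ε hε => ?_)
  · -- LOWER bound: the box around the density pair of the further tilt `(Y e^{δu}, Z e^{δv})`
    have hε2 : 0 < ε / 2 := by linarith
    set w := |u| + |v| + 1 with hw
    have hw0 : 0 < w := by positivity
    -- the gap of the directional statistic and the box half-width `η(δ) = gap/(2w)`; we use the fixed-width device: first choose `δ`, then `η`
    obtain ⟨hcont, hval⟩ := continuousAt_dirCost hy hz hY hZ u v 0
    -- Step 1: `δ > 0` small with the δ-tilt's cost (zero-width box) within `ε/4` of `J`
    have hlt := hval.trans_lt (show jointRate y z Y Z < jointRate y z Y Z + ε / 4 by linarith)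
    have hev := hcont.eventually (gt_mem_nhds hlt)
    obtain ⟨δ, hδc, hδ0, -⟩ := ((hev.filter_mono nhdsWithin_le_nhds).and (Ioo_mem_nhdsGT one_pos)).exists
    simp only [zero_mul, sub_zero, add_zero, max_self] at hδc
    set Y' := Y * Real.exp (δ * u) with hY'
    set Z' := Z * Real.exp (δ * v) with hZ'
    have hY'0 : 0 < Y' := mul_pos hY (Real.exp_pos _)
    have hZ'0 : 0 < Z' := mul_pos hZ (Real.exp_pos _)
    set aδ := contactB Y' Z' with haδ
    set aδ' := contactB Z' Y' with haδ'
    have hgap : u * a + v * a' < u * aδ + v * aδ' := linStat_lt_of_tilt hY hZ huv hδ0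
    -- Step 2: the box half-width
    set η := (u * aδ + v * aδ' - (u * a + v * a')) / (2 * w) with hη
    have hη0 : 0 < η := div_pos (by linarith) (by positivity)
    have hwη : (|u| + |v|) * η < u * aδ + v * aδ' - (u * a + v * a') := by
      rw [hη]
      have : (|u| + |v|) * ((u * aδ + v * aδ' - (u * a + v * a')) / (2 * w)) =
          (u * aδ + v * aδ' - (u * a + v * a')) * ((|u| + |v|) / (2 * w)) := by ring
      rw [this]
      have hfrac : (|u| + |v|) / (2 * w) < 1 := by
        rw [div_lt_one (by positivity), hw]; linarith [abs_nonneg u, abs_nonneg v]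
      have hpos : 0 < u * aδ + v * aδ' - (u * a + v * a') := by linarith
      exact mul_lt_of_lt_one_right hpos hfrac
    have hbox : ∀ {θ : ℝ}, 0 < θ → θ ≤ η → ∀ x x' : ℝ, aδ - θ ≤ x → x ≤ aδ + θ → aδ' - θ ≤ x' → x' ≤ aδ' + θ →
        u * a + v * a' < u * x + v * x' := by
      intro θ hθ0 hθη x x' h1 h2 h3 h4
      have hu' : |u * (x - aδ)| ≤ |u| * θ := by
        rw [abs_mul]; exact mul_le_mul_of_nonneg_left (abs_le.2 ⟨by linarith, by linarith⟩) (abs_nonneg u)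
      have hv' : |v * (x' - aδ')| ≤ |v| * θ := by
        rw [abs_mul]; exact mul_le_mul_of_nonneg_left (abs_le.2 ⟨by linarith, by linarith⟩) (abs_nonneg v)
      have hθ' : (|u| + |v|) * θ ≤ (|u| + |v|) * η := mul_le_mul_of_nonneg_left hθη (by positivity)
      have e : u * x + v * x' = u * aδ + v * aδ' + (u * (x - aδ) + v * (x' - aδ')) := by ring
      rw [e]
      have := abs_le.1 (le_trans (abs_add_le _ _) (add_le_add hu' hv'))
      linarith [this.1, hθ', hwη]
    -- Step 3: shrink the box so that its extra cost `η(|ℓ| + |ℓ'|)` is at most `ε/4`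
    set L := |Real.log (Y' / y)| + |Real.log (Z' / z)| + 1 with hL
    have hL0 : 0 < L := by positivity
    set η' := min η (ε / (4 * L)) with hη'
    have hη'0 : 0 < η' := lt_min hη0 (by positivity)
    have hη'1 : η' ≤ η := min_le_left _ _
    have hη'2 : η' ≤ ε / (4 * L) := min_le_right _ _
    have hb1 : aδ - η' < contactB Y' Z' := by rw [← haδ]; linarith
    have hb2 : contactB Y' Z' < aδ + η' := by rw [← haδ]; linarith
    have hb1' : aδ' - η' < contactB Z' Y' := by rw [← haδ']; linarith
    have hb2' : contactB Z' Y' < aδ' + η' := by rw [← haδ']; linarith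
    -- the η'-box cost is at most the zero-width cost plus `η' (|ℓ| + |ℓ'|) ≤ ε/4`
    have hmax1 : max ((aδ - η') * Real.log (Y' / y)) ((aδ + η') * Real.log (Y' / y)) ≤
        aδ * Real.log (Y' / y) + η' * |Real.log (Y' / y)| := by
      have k1 := mul_le_mul_of_nonneg_left (neg_le_abs (Real.log (Y' / y))) hη'0.le
      have k2 := mul_le_mul_of_nonneg_left (le_abs_self (Real.log (Y' / y))) hη'0.le
      refine max_le ?_ ?_
      · linarith
      · linarith
    have hmax2 : max ((aδ' - η') * Real.log (Z' / z)) ((aδ' + η') * Real.log (Z' / z)) ≤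
        aδ' * Real.log (Z' / z) + η' * |Real.log (Z' / z)| := by
      have k1 := mul_le_mul_of_nonneg_left (neg_le_abs (Real.log (Z' / z))) hη'0.le
      have k2 := mul_le_mul_of_nonneg_left (le_abs_self (Real.log (Z' / z))) hη'0.le
      refine max_le ?_ ?_
      · linarith
      · linarith
    have hextra : η' * |Real.log (Y' / y)| + η' * |Real.log (Z' / z)| ≤ ε / 4 := by
      have h1 : η' * (|Real.log (Y' / y)| + |Real.log (Z' / z)|) ≤ η' * L :=
        mul_le_mul_of_nonneg_left (by rw [hL]; linarith) hη'0.le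
      have h2 : η' * L ≤ ε / (4 * L) * L := mul_le_mul_of_nonneg_right hη'2 hL0.le
      have h3 : ε / (4 * L) * L = ε / 4 := by field_simp
      have h4 : η' * (|Real.log (Y' / y)| + |Real.log (Z' / z)|) = η' * |Real.log (Y' / y)| + η' * |Real.log (Z' / z)| := by ring
      linarith
    -- `hδc` is the zero-width cost at `δ`: `aδ ℓ + aδ' ℓ' − log(μ₁(Y',Z')/μ₁(y,z)) < J + ε/4`
    filter_upwards [exp_le_boxFraction hy hz hY'0 hZ'0 hb1 hb2 hb1' hb2' hε2, Filter.eventually_gt_atTop 0] with N hN hN0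
    have hNr : (0 : ℝ) < N := by exact_mod_cast hN0
    refine le_trans ?_ (hN.trans ?_)
    · refine Real.exp_le_exp.2 (mul_le_mul_of_nonneg_right ?_ (Nat.cast_nonneg N))
      have := hδc
      linarith [hmax1, hmax2, hextra]
    · refine div_le_div_of_nonneg_right ?_ (stripZ₂_pos 1 N hy hz).le
      refine Finset.sum_le_sum_of_subset_of_nonneg (fun q hq => ?_) fun q _ _ => wgt_nonneg hy.le hz.le N q
      rw [Finset.mem_filter] at hq ⊢
      obtain ⟨hq0, ⟨h1, h2⟩, ⟨h3, h4⟩⟩ := hq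
      refine ⟨hq0, ?_⟩
      have key := hbox hη'0 hη'1 ((bottomVisits₀ q.1 q.2 N : ℝ) / N) ((topVisits₀ 1 q.1 q.2 N : ℝ) / N)
        (by rw [le_div_iff₀ hNr]; linarith) (by rw [div_le_iff₀ hNr]; linarith)
        (by rw [le_div_iff₀ hNr]; linarith) (by rw [div_le_iff₀ hNr]; linarith)
      have e : u * ((bottomVisits₀ q.1 q.2 N : ℝ) / N) + v * ((topVisits₀ 1 q.1 q.2 N : ℝ) / N) =
          (u * (bottomVisits₀ q.1 q.2 N : ℝ) + v * (topVisits₀ 1 q.1 q.2 N : ℝ)) / N := by ring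
      rw [e, lt_div_iff₀ hNr] at key
      exact key.le
  · -- UPPER bound: half-plane Chernoff with the tilt `(Y,Z)` itself
    set c := u * a + v * a' with hc
    have hS := fun N : ℕ => sum_halfPlane_mul_exp_le hy.le hz.le u v hκ.le c N
    have hu0 : 0 < Real.exp (κ * c) := Real.exp_pos _
    have h := fraction_le_exp_of_chernoff₂ hy hz hY hZ hu0 1 0 _ hS hε
    filter_upwards [h] with N hN
    have e : -jointRate y z Y Z + ε = -((1 : ℝ) * Real.log (Real.exp (κ * c)) - Real.log (stripMuY₂ 1 Y Z / stripMuY₂ 1 y z)) + ε := by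
      rw [Real.log_exp]; unfold jointRate; rw [hℓ, hℓ', hc]; ring
    rw [e]
    exact hN

end Literature.Probability.RandomPlanarGeometry.SAW.HexBW
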